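import Literature.Analysis.FluidPDE.PressureSpaceTimeTools
import Literature.Analysis.FluidPDE.SereginSverakPressureDecayBalls
import Mathlib.Analysis.FunctionalSpaces.SobolevInequality
import Literature.Analysis.FluidPDE.SereginSverakAxisymmetric
import Literature.Analysis.FluidPDE.CylindricalIntegration
import Literature.Analysis.FluidPDE.AxisymQuotientBounds
import Literature.Analysis.FluidPDE.AxisymWeights
import Literature.Analysis.FluidPDE.SereginZajaczkowski2007L42VorticityProofs
import Literature.Analysis.FluidPDE.CylinderTenThirds
import Literature.Analysis.FluidPDE.NSBoundedHigherRegularityOfLemma61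
import Literature.Analysis.FluidPDE.SereginEpsilonRegularityHigherHolds
import Literature.Analysis.FluidPDE.RusinSverakBackwardRegularity
import Literature.Analysis.FluidPDE.SuitableWeakStability
import Literature.Analysis.FluidPDE.SuitableWeakRescaling
import Literature.Analysis.FluidPDE.AxisymGradientField
import Literature.Analysis.FluidPDE.TaoEnstrophyLocalisation
import Literature.Analysis.FluidPDE.SereginZajaczkowski2007
import Mathlib.MeasureTheory.Integral.IntervalIntegral.Basic
import Literature.Analysis.FluidPDE.AxisymPoloidalCutoff
import Literature.Analysis.FluidPDE.Wei2016PoloidalCurl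
import Literature.Analysis.FluidPDE.CollapseDebris
import Literature.Analysis.FluidPDE.SuitableWeakProofs
import Literature.Analysis.FluidPDE.AxisymQuotientEquationsJ
import Literature.Analysis.FluidPDE.AxisymPoloidalMoments
import Literature.Analysis.FluidPDE.SqIntegralBalance
import Literature.Analysis.FluidPDE.HouLiSpaceTime
import Literature.Analysis.FluidPDE.BiotSavartCurlPair
import Literature.Analysis.Calculus.HardyLogarithmic
import Literature.Analysis.Calculus.PlanarPolarIntegral
import Literature.Analysis.FluidPDE.Seregin2022LogSwirlOriginKeyEstimate
import HarnessLib

/-!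
# Seregin 2022 local regularity of axisymmetric solutions, file 3 of 6: the Step-4 assembly — poloidal and swirl parts of `∫_{Q(R)}|v|³`, the `v_θ` passage, `C(R) ≤ C R^{3/2}`, the endgame, the cut-off chain (re-homed proofs)

**G. Seregin, *A note on local regularity of axisymmetric solutions to the Navier–Stokes equations*, J. Math. Fluid Mech. 24
(2022), Paper 27 = arXiv:2201.00153, Theorem 1.2 via §2 from the swirl decay (2.2) [Seregin2022LocalAxisym]: for a suitable weak
solution in the unit parabolic cylinder `Q = 𝒞 × ]-1,0[`, axisymmetric, with `v ∈ L_{2,∞}(Q)`, `∇v ∈ L₂(Q)`, `q ∈ L_{3/2}(Q)` and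
`|v_θ(x,t)| ≤ C₁ |x'|⁻¹ / ln³(e/|x'|)` off the axis, the origin is a regular point.**  The named fact
`Literature.Analysis.FluidPDE.seregin2022_logSwirl_regularAtOrigin` (`Seregin2022LogSwirlCriterion.lean`) is PROVED in the tree by
the Navier–Stokes cell's `AxisymmetricKatoGlobal` line (Steps 1–4 of §2: reduction to a first singular time and a clean slab with a
smooth axisymmetric representative, the product cut-off, the Leray logarithmic Hardy inequality (Lemma 2.2), Lemma 2.1 and the
Chen–Fang–Zhang / Lei–Zhang elliptic bounds for `u_r/r`, the `η⁶`-weighted energy estimates of `Γ = ω_θ/r` and `Φ = ω_r/r` with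
the swirl source absorbed through (2.2), the key estimate, the Step-4 assembly `C(R) ≤ C R^{3/2} → 0` and ε-regularity) — until now
Summits-side only (`Summits/NavierStokesRegularity/NavierStokesRegularity/Theorems/AxisymmetricExtremalityAxisymmetricKatoGlobalStubSereginLogSwirlOrigin.lean`,
`seregin2022_logSwirl_regularAtOrigin_holds := stub_sereginLogSwirlOrigin`).  RE-HOMED into `Literature/` by the Hodge foundations
lane (`lit-hodgefound`, prover p20, generation 39) as SIX files: verbatim DECLARATION-LEVEL ports (the 312 declarations the
discharge needs, in dependency order; each Part header lists the declarations of its source module that are NOT carried) of 55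
Summits modules `Summits/NavierStokesRegularity/NavierStokesRegularity/Theorems/AxisymmetricExtremalityAxisymmetricKatoGlobalStub*.lean`,
namespaces `Summit.NavierStokesRegularity.NavierStokesRegularity.Theorems.AxisymmetricKatoGlobal{.EulerScaling,.Registered}` re-rooted
to `Literature.Analysis.SereginLogSwirlOrigin{.EulerScaling,.Registered}` (a root outside `Literature.Analysis.FluidPDE` on purpose:
namespace-prefix resolution would otherwise shadow the cone's lemmas by same-named `FluidPDE` lemmas); the sources' `local notation`
`ℝ³` is expanded textually; imports from `Literature/` and Mathlib only; no `sorry`, no new axiom, NO named fact (D-0026).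
PROVENANCE CONVENTION: docstrings are carried byte-for-byte; declarations the cell cites keep their cites; `[folklore]`-tagged and
untagged declarations (the cell's own lemmas) carry the Part's tag `[cite: <Key>, <loc> (source of the ARGUMENT this module
implements; this declaration is the cell's own lemma or plumbing, NOT a printed statement)]`, because the gate does not admit a
public Literature theorem without a cite tag.

THIS FILE (3 of 6) ports: …StubSereginLogSwirlOriginStep4AssemblyPoloidal, …StubSereginLogSwirlOriginVThetaPassage, …StubSereginLogSwirlOriginStep4AssemblySwirl, …StubSereginLogSwirlOriginStep4AssemblyParts, …StubSereginLogSwirlOriginStep4Endgame, …StubSereginLogSwirlOriginStep4Assembly, …StubSereginLogSwirlOriginStep1CutoffBcut, …StubSereginLogSwirlOriginStep1CutoffCompact, …StubSereginLogSwirlOriginStep4AssemblyKeyEstimate, …StubSereginLogSwirlOriginStep1CutoffChain.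
-/

noncomputable section

/-!
## Part 1 — port of `Summits/NavierStokesRegularity/NavierStokesRegularity/Theorems/AxisymmetricExtremalityAxisymmetricKatoGlobalStubSereginLogSwirlOriginStep4AssemblyPoloidal.lean` (9 declarations kept)

# Seregin 2022, §2 Step 4 (assembly, I): the poloidal part
# `∫_{𝒞(R)} |v̄|³ ≤ c R^{3/2}` from `sup_t ‖η³Γ‖₂ ≤ K` — crux stmt-NavierStokesRegularity-15453 (`AxisymmetricExtremality.AxisymmetricKatoGlobal`), line registered, support for stub `stub_sereginLogSwirlOrigin`

Support file (`--supports stmt-NavierStokesRegularity-15453`; theorems only, everything proved)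
toward the registered stub `stub_sereginLogSwirlOrigin` = the named fact
`Literature.Analysis.FluidPDE.seregin2022_logSwirl_regularAtOrigin` (G. Seregin, J. Math. Fluid
Mech. 24 (2022), Paper 27 = arXiv:2201.00153, §2).  Step 4 ("Final Conclusion", arXiv p. 7)
derives `C(R) = R⁻²∫_{Q(R)}|v|³ → 0` from the Step-3 bound
`sup_t ∫_𝒞 η⁶(|Γ|² + |Φ|²) + ∫_Q (η³|∇Φ|)² + (η³|∇Γ|)² ≤ K` (`Γ = ω_θ/r`, `Φ = ω_r/r`).  For the
poloidal part `v̄ = v_r e_r + v₃ e₃` the printed route is "`ω_θ = rΓ` ⇒ `|η³ω_θ|_{2,Q} < ∞`", the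
first elliptic bound `‖∇(η³v̄)‖_{2,𝒞} ≤ c‖ω_θη³‖_{2,𝒞} + c‖|∇η³||v̄|‖_{2,𝒞}` (landed:
`lintegral_frobeniusNormSq_fderiv_smul_poloidal_le`, sibling file `…CutoffDivCurl.lean`) and a
Sobolev embedding, giving (2.8) `R⁻²∫_{Q(R)}|v̄|³ ≤ cR^γ → 0`.  This file proves the slice form
with `γ = 3/2` through `L^∞_t Ḣ¹ ⊂ L^∞_t L⁶` (any positive rate feeds the landed endgame
`isRegularAtOrigin_of_tendsto_cubicC`), with `ζ` for `η³`, the tree's smooth poloidal field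
`b = u − (u_θ/r)J` (`angVelQuot`, `rotGen`) for `v̄`, `Γ = angVortQuot u`, `Φ = radVelQuot (curl u)`:

* `lintegral_enorm_rpow_six_le` — Gagliardo–Nirenberg–Sobolev `∫‖w‖⁶ ≤ C_S⁶(∫‖Dw‖²)³` for `C¹_c`
  maps `ℝ³ → F'` into a Hilbert space, lower-integral form of Mathlib's
  `eLpNorm_le_eLpNorm_fderiv_of_eq_inner` (constant `C_S`);
* `norm_le_norm_poloidal_add_abs_swirlVelocity`, `enorm_pow_three_le_poloidal_add_swirl` —
  `|v| ≤ |v̄| + |v_θ|`, `|v|³ ≤ 4(|v̄|³ + |v_θ|³)`;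
* `lintegral_enorm_fderiv_smul_poloidal_sq_le` — at a fixed time,
  **`∫ ‖D(ζb)‖² ≤ 2K + 12 C_ζ² A`** from `∫ ζ²(Γ² + Φ²) ≤ K` (the Step-3 `sup` term),
  `∫_𝒞 |u|² ≤ A` (energy class), `‖Dζ‖ ≤ C_ζ`, `tsupport ζ ⊆ 𝒞` (so `r ≤ 1` there, `ω_θ² = r²Γ² ≤ Γ²`);
* `lintegral_enorm_smul_poloidal_rpow_six_le` — hence `∫ ‖ζb‖⁶ ≤ C_S⁶ (2K + 12C_ζ²A)³`;
* `setLIntegral_spaceCyl_enorm_poloidal_pow_three_le` (registered; hypothesis form `…_le'`) —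
  on every `𝒞(R)` where `ζ = 1`,
  **`∫_{𝒞(R)} |b|³ ≤ |𝒞(R)|^{1/2} (C_S⁶(2K + 12C_ζ²A)³)^{1/2}`**, `|𝒞(R)| ≤ 8|B₁|R³`
  (`volume_spaceCyl_le_rpow`).

## References

* G. Seregin, J. Math. Fluid Mech. 24 (2022), Paper No. 27 = arXiv:2201.00153, §2 Step 4 (arXiv
  p. 7: (2.7), the first "classical bound", (2.8)). [`Seregin2022LocalAxisym`]

Not carried from this source module (not needed by the declarations re-homed here; their consumers are Summits-side): `setLIntegral_spaceCyl_enorm_poloidal_pow_three_le`.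
-/

section Part1

open _root_.Set _root_.MeasureTheory _root_.Filter _root_.Topology _root_.Function _root_.Metric
open scoped _root_.ENNReal _root_.NNReal RealInnerProductSpace
open Literature.Analysis.FluidPDE

namespace Literature.Analysis.SereginLogSwirlOrigin.EulerScaling

/-! ### Gagliardo–Nirenberg–Sobolev in lower-integral form -/

/-- **GNS, `Ḣ¹(ℝ³) ⊂ L⁶`, lower-integral form**: for a `C¹` compactly supported map `w : ℝ³ → F'`
into a real Hilbert space, `∫ ‖w‖⁶ ≤ C_S⁶ (∫ ‖Dw‖²)³` with `C_S` Mathlib's constant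
(`eLpNorm_le_eLpNorm_fderiv_of_eq_inner`, sixth power). [folklore]
[cite: Seregin2022LocalAxisym, §2 proof of Thm. 1.2, Step 4 (arXiv:2201.00153 pp. 4–7) (source of the ARGUMENT this module implements; this declaration is the cell’s own lemma or plumbing, NOT a printed statement)] -/
theorem lintegral_enorm_rpow_six_le {F' : Type*} [NormedAddCommGroup F'] [InnerProductSpace ℝ F']
    {w : EuclideanSpace ℝ (Fin 3) → F'} (hw : ContDiff ℝ 1 w) (hc : HasCompactSupport w) :
    ∫⁻ x, ‖w x‖ₑ ^ (6 : ℝ) ≤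
      (eLpNormLESNormFDerivOfEqInnerConst (volume : Measure (EuclideanSpace ℝ (Fin 3))) 2 : ℝ≥0∞)
          ^ (6 : ℝ) * (∫⁻ x, ‖fderiv ℝ w x‖ₑ ^ 2) ^ (3 : ℝ) := by
  have e2n : ∀ x, ‖fderiv ℝ w x‖ₑ ^ 2 = ‖fderiv ℝ w x‖ₑ ^ (2 : ℝ) := fun x =>
    (ENNReal.rpow_ofNat _ 2).symm
  simp only [e2n]
  have h := eLpNorm_le_eLpNorm_fderiv_of_eq_inner (volume : Measure (EuclideanSpace ℝ (Fin 3)))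
    hw hc (p := 2) (p' := 6) (by norm_num) (by rw [finrank_euclideanSpace_fin]; norm_num)
    (by rw [finrank_euclideanSpace_fin]; norm_num)
  rw [eLpNorm_eq_lintegral_rpow_enorm_toReal (by norm_num) (by norm_num),
    eLpNorm_eq_lintegral_rpow_enorm_toReal (by norm_num) (by norm_num)] at h
  have e6 : ((6 : ℝ≥0) : ℝ≥0∞).toReal = 6 := by norm_num
  have e2 : ((2 : ℝ≥0) : ℝ≥0∞).toReal = 2 := by norm_num
  have e2' : ((2 : ℝ≥0) : ℝ) = 2 := by norm_num
  rw [e6, e2, e2'] at h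
  have h6 := ENNReal.rpow_le_rpow h (by norm_num : (0 : ℝ) ≤ 6)
  rw [← ENNReal.rpow_mul, show (1 : ℝ) / 6 * 6 = 1 by norm_num, ENNReal.rpow_one,
    ENNReal.mul_rpow_of_nonneg _ _ (by norm_num : (0 : ℝ) ≤ 6), ← ENNReal.rpow_mul,
    show (1 : ℝ) / 2 * 6 = 3 by norm_num] at h6
  exact h6

/-! ### The decomposition `v = v̄ + v_θ e_θ` pointwise -/

section Pointwise

variable {u : EuclideanSpace ℝ (Fin 3) → EuclideanSpace ℝ (Fin 3)}

/-- **`|v| ≤ |v̄| + |v_θ|`**: for an axisymmetric `u ∈ C²` and its smooth poloidal part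
`b = u − (u_θ/r)J`, `‖u x‖ ≤ ‖b x‖ + |u_θ x|` everywhere (`‖(u_θ/r)J‖ = |u_θ|` off the axis,
`J = 0` on it). [folklore]
[cite: Seregin2022LocalAxisym, §2 proof of Thm. 1.2, Step 4 (arXiv:2201.00153 pp. 4–7) (source of the ARGUMENT this module implements; this declaration is the cell’s own lemma or plumbing, NOT a printed statement)] -/
theorem norm_le_norm_poloidal_add_abs_swirlVelocity (hax : IsAxisymmetric u) (hu : ContDiff ℝ 2 u)
    (x : EuclideanSpace ℝ (Fin 3)) :
    ‖u x‖ ≤ ‖u x - angVelQuot u x • rotGen x‖ + |swirlVelocity u x| := by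
  have hJ : ‖rotGen x‖ = cylRadius x := by rw [norm_rotGen]; rfl
  have hsm : ‖angVelQuot u x • rotGen x‖ ≤ |swirlVelocity u x| := by
    rw [norm_smul, Real.norm_eq_abs, hJ]
    rcases eq_or_ne (cylRadius x) 0 with h0 | h0
    · rw [h0, mul_zero]; exact abs_nonneg _
    · have h1 : cylRadius x ^ 2 * angVelQuot u x = cylRadius x * swirlVelocity u x := by
        rw [hax.cylRadius_sq_mul_angVelQuot hu x, swirl_eq_cylRadius_mul_swirlVelocity u h0]
      have h2 : cylRadius x * angVelQuot u x = swirlVelocity u x := by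
        have h3 : cylRadius x * (cylRadius x * angVelQuot u x) = cylRadius x * swirlVelocity u x := by
          rw [← h1]; ring
        exact mul_left_cancel₀ h0 h3
      rw [← h2, abs_mul, abs_of_nonneg (cylRadius_nonneg x), mul_comm]
  calc ‖u x‖ = ‖(u x - angVelQuot u x • rotGen x) + angVelQuot u x • rotGen x‖ := by
        rw [sub_add_cancel]
    _ ≤ ‖u x - angVelQuot u x • rotGen x‖ + ‖angVelQuot u x • rotGen x‖ := norm_add_le _ _
    _ ≤ ‖u x - angVelQuot u x • rotGen x‖ + |swirlVelocity u x| := by linarith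

/-- **`|v|³ ≤ 4(|v̄|³ + |v_θ|³)`** in `ℝ≥0∞`, for an axisymmetric `u ∈ C²`. [folklore]
[cite: Seregin2022LocalAxisym, §2 proof of Thm. 1.2, Step 4 (arXiv:2201.00153 pp. 4–7) (source of the ARGUMENT this module implements; this declaration is the cell’s own lemma or plumbing, NOT a printed statement)] -/
theorem enorm_pow_three_le_poloidal_add_swirl (hax : IsAxisymmetric u) (hu : ContDiff ℝ 2 u)
    (x : EuclideanSpace ℝ (Fin 3)) :
    ‖u x‖ₑ ^ (3 : ℕ) ≤ 4 * (‖u x - angVelQuot u x • rotGen x‖ₑ ^ (3 : ℕ) +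
      ‖swirlVelocity u x‖ₑ ^ (3 : ℕ)) := by
  have h1 : ‖u x‖ₑ ≤ ‖u x - angVelQuot u x • rotGen x‖ₑ + ‖swirlVelocity u x‖ₑ := by
    rw [← ofReal_norm, ← ofReal_norm, Real.enorm_eq_ofReal_abs,
      ← ENNReal.ofReal_add (norm_nonneg _) (abs_nonneg _)]
    exact ENNReal.ofReal_le_ofReal (norm_le_norm_poloidal_add_abs_swirlVelocity hax hu x)
  have h2 := ENNReal.rpow_add_le_mul_rpow_add_rpow (‖u x - angVelQuot u x • rotGen x‖ₑ)
    (‖swirlVelocity u x‖ₑ) (p := 3) (by norm_num)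
  rw [show (3 : ℝ) - 1 = 2 by norm_num] at h2
  have h4 : (2 : ℝ≥0∞) ^ (2 : ℝ) = 4 := by
    rw [show (2 : ℝ) = ((2 : ℕ) : ℝ) by norm_num, ENNReal.rpow_natCast]; norm_num
  rw [h4] at h2
  simp only [ENNReal.rpow_ofNat] at h2
  exact (pow_le_pow_left' h1 3).trans h2

end Pointwise

/-! ### The first elliptic bound fed by the Step-3 `sup` term -/

section Slice

variable {u : EuclideanSpace ℝ (Fin 3) → EuclideanSpace ℝ (Fin 3)} {ζ : EuclideanSpace ℝ (Fin 3) → ℝ}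
  {U : Set (EuclideanSpace ℝ (Fin 3))} {K A : ℝ≥0} {Cζ : ℝ}

/-- A cut-off supported in the unit cylinder `𝒞` has compact support. [folklore]
[cite: Seregin2022LocalAxisym, §2 proof of Thm. 1.2, Step 4 (arXiv:2201.00153 pp. 4–7) (source of the ARGUMENT this module implements; this declaration is the cell’s own lemma or plumbing, NOT a printed statement)] -/
theorem hasCompactSupport_of_tsupport_subset_spaceCyl
    (hζ1 : tsupport ζ ⊆ SereginSverak2009.spaceCyl 0 1) : HasCompactSupport ζ := by
  refine (ProperSpace.isCompact_closedBall (0 : EuclideanSpace ℝ (Fin 3)) (Real.sqrt 2 * 1)).of_isClosed_subset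
    (isClosed_tsupport ζ) (hζ1.trans ((spaceCyl_subset_ball 0 zero_le_one).trans ball_subset_closedBall))

/-- **Lower integrals of functions vanishing off a set**: if `f = 0` off `S` and `f ≤ g` on `S`
(`S` measurable), then `∫ f ≤ ∫_S g`. [folklore]
[cite: Seregin2022LocalAxisym, §2 proof of Thm. 1.2, Step 4 (arXiv:2201.00153 pp. 4–7) (source of the ARGUMENT this module implements; this declaration is the cell’s own lemma or plumbing, NOT a printed statement)] -/
theorem lintegral_le_setLIntegral_of_forall_notMem {α : Type*} [MeasurableSpace α] {μ : Measure α}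
    {S : Set α} (hS : MeasurableSet S) {f g : α → ℝ≥0∞} (h0 : ∀ x ∉ S, f x = 0)
    (hle : ∀ x ∈ S, f x ≤ g x) : ∫⁻ x, f x ∂μ ≤ ∫⁻ x in S, g x ∂μ := by
  have hf : f = S.indicator f := by
    funext x
    by_cases hx : x ∈ S
    · rw [indicator_of_mem hx]
    · rw [indicator_of_notMem hx, h0 x hx]
  rw [hf, lintegral_indicator hS]
  exact setLIntegral_mono' hS hle

/-- **`∫ ‖D(ζb)‖² ≤ 2K + 12 C_ζ² A` at a fixed time** (Seregin: "Since `ω_θ = rΓ`, one can state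
that `|η³ω_θ|_{2,Q} < ∞` as well", then the first elliptic bound and "our previous arguments … in
the support of `∇η`"). Inputs: `u ∈ C⁴(ℝ³)` axisymmetric and divergence free on an open
`U ⊇ tsupport ζ`; `ζ ∈ C²` with `tsupport ζ ⊆ 𝒞 = spaceCyl 0 1` and `‖Dζ‖ ≤ C_ζ`; the Step-3
`sup` term for `Γ` in the form (2.7), `‖ζΓ‖²₂ ≤ K`; the energy class `∫_𝒞 |u|² ≤ A`. (`r ≤ 1` on `𝒞`
turns `ζ²r²Γ²` into `≤ (ζΓ)²`; `|b| ≤ 2|u|`.) [cite: Seregin2022LocalAxisym, §2 Step 4 (arXiv:2201.00153 p. 7), (2.7) and the first elliptic bound] -/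
theorem lintegral_enorm_fderiv_smul_poloidal_sq_le (hax : IsAxisymmetric u) (hu : ContDiff ℝ 4 u)
    (hζ : ContDiff ℝ 2 ζ) (hU : IsOpen U) (hζU : tsupport ζ ⊆ U)
    (hζ1 : tsupport ζ ⊆ SereginSverak2009.spaceCyl 0 1)
    (hdiv : ∀ y ∈ U, VectorCalculus.divergence u y = 0) (hCζ : ∀ x, ‖fderiv ℝ ζ x‖ ≤ Cζ)
    (hΓ : ∫⁻ x, ‖ζ x * angVortQuot u x‖ₑ ^ 2 ≤ K)
    (hA : ∫⁻ x in SereginSverak2009.spaceCyl 0 1, ‖u x‖ₑ ^ 2 ≤ A) :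
    ∫⁻ x, ‖fderiv ℝ (fun y => ζ y • (u y - angVelQuot u y • rotGen y)) x‖ₑ ^ 2 ≤
      2 * K + 12 * ENNReal.ofReal (Cζ ^ 2) * A := by
  have hζc : HasCompactSupport ζ := hasCompactSupport_of_tsupport_subset_spaceCyl hζ1
  have hCζ0 : 0 ≤ Cζ := (norm_nonneg _).trans (hCζ 0)
  have key := lintegral_frobeniusNormSq_fderiv_smul_poloidal_le hax hu hζ hζc hU hζU hdiv
  -- first term: `ζ² r² Γ² ≤ (ζΓ)²` on `𝒞`
  have h1 : ∫⁻ x, ENNReal.ofReal (ζ x ^ 2 * ((x 0 ^ 2 + x 1 ^ 2) * angVortQuot u x ^ 2)) ≤ K := by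
    refine (lintegral_mono fun x => ?_).trans hΓ
    rw [Real.enorm_eq_ofReal_abs, ← ENNReal.ofReal_pow (abs_nonneg _), sq_abs]
    refine ENNReal.ofReal_le_ofReal ?_
    by_cases hx : x ∈ tsupport ζ
    · have hr : cylRadius x < 1 := by
        have := hζ1 hx
        rw [SereginSverak2009.mem_spaceCyl, sub_zero] at this
        exact this.1
      have hr2 : x 0 ^ 2 + x 1 ^ 2 ≤ 1 := by
        rw [← cylRadius_sq]; nlinarith [cylRadius_nonneg x]
      rw [mul_pow]
      refine mul_le_mul_of_nonneg_left ?_ (sq_nonneg _)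
      nlinarith [sq_nonneg (angVortQuot u x), add_nonneg (sq_nonneg (x 0)) (sq_nonneg (x 1))]
    · rw [image_eq_zero_of_notMem_tsupport hx]; simp
  -- second term: `‖Dζ‖² |b|² ≤ 4 C_ζ² |u|²` on `𝒞`, zero off `tsupport ζ`
  have h2 : ∫⁻ x, ENNReal.ofReal (‖fderiv ℝ ζ x‖ ^ 2 * ‖u x - angVelQuot u x • rotGen x‖ ^ 2) ≤
      4 * ENNReal.ofReal (Cζ ^ 2) * A := by
    have hb := Wei2016.norm_sub_angVelQuot_smul_rotGen_le hax (hu.of_le (by norm_num))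
    calc ∫⁻ x, ENNReal.ofReal (‖fderiv ℝ ζ x‖ ^ 2 * ‖u x - angVelQuot u x • rotGen x‖ ^ 2)
        ≤ ∫⁻ x in SereginSverak2009.spaceCyl 0 1, 4 * ENNReal.ofReal (Cζ ^ 2) * ‖u x‖ₑ ^ 2 := by
          refine lintegral_le_setLIntegral_of_forall_notMem
            (SereginSverak2009.isOpen_spaceCyl 0 1).measurableSet (fun x hx => ?_) (fun x _ => ?_)
          · have hx' : x ∉ tsupport ζ := fun h => hx (hζ1 h)
            rw [fderiv_of_notMem_tsupport ℝ hx', norm_zero]; simp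
          · have e1 : (4 : ℝ≥0∞) * ENNReal.ofReal (Cζ ^ 2) * ‖u x‖ₑ ^ 2 =
                ENNReal.ofReal (4 * Cζ ^ 2 * ‖u x‖ ^ 2) := by
              rw [← ofReal_norm, ← ENNReal.ofReal_pow (norm_nonneg _), ← ENNReal.ofReal_ofNat,
                ← ENNReal.ofReal_mul (by norm_num), ← ENNReal.ofReal_mul (by positivity)]
            rw [e1]
            refine ENNReal.ofReal_le_ofReal ?_
            have h3 : ‖fderiv ℝ ζ x‖ ^ 2 ≤ Cζ ^ 2 := pow_le_pow_left₀ (norm_nonneg _) (hCζ x) 2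
            have h4 : ‖u x - angVelQuot u x • rotGen x‖ ^ 2 ≤ (2 * ‖u x‖) ^ 2 :=
              pow_le_pow_left₀ (norm_nonneg _) (hb x) 2
            calc ‖fderiv ℝ ζ x‖ ^ 2 * ‖u x - angVelQuot u x • rotGen x‖ ^ 2
                ≤ Cζ ^ 2 * (2 * ‖u x‖) ^ 2 :=
                  mul_le_mul h3 h4 (sq_nonneg _) (sq_nonneg _)
              _ = 4 * Cζ ^ 2 * ‖u x‖ ^ 2 := by ring
      _ = 4 * ENNReal.ofReal (Cζ ^ 2) * ∫⁻ x in SereginSverak2009.spaceCyl 0 1, ‖u x‖ₑ ^ 2 := by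
          rw [lintegral_const_mul' _ _ (ENNReal.mul_ne_top (by norm_num) ENNReal.ofReal_ne_top)]
      _ ≤ 4 * ENNReal.ofReal (Cζ ^ 2) * A := by gcongr
  calc ∫⁻ x, ‖fderiv ℝ (fun y => ζ y • (u y - angVelQuot u y • rotGen y)) x‖ₑ ^ 2
      ≤ ∫⁻ x, ENNReal.ofReal (frobeniusNormSq
          (fderiv ℝ (fun y => ζ y • (u y - angVelQuot u y • rotGen y)) x)) :=
        lintegral_mono fun x => by
          -- `‖L‖ₑ² ≤ |L|²_F` (operator norm against Frobenius norm)
          rw [← ofReal_norm, ← ENNReal.ofReal_pow (norm_nonneg _)]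
          exact ENNReal.ofReal_le_ofReal (sq_opNorm_le_frobeniusNormSq _)
    _ ≤ 2 * K + 3 * (4 * ENNReal.ofReal (Cζ ^ 2) * A) := key.trans (add_le_add (by gcongr) (by gcongr))
    _ = 2 * K + 12 * ENNReal.ofReal (Cζ ^ 2) * A := by ring

/-- **`∫ ‖ζ b‖⁶ ≤ C_S⁶ (2K + 12C_ζ²A)³`** at a fixed time (GNS applied to the `C²_c` field `ζb` and
the previous bound): Seregin's "`|∇(η³v̄)|_{2,Q}` is bounded, that in turn yields boundedness
of" a Lebesgue norm of `η³v̄`, here `L^∞_t L⁶_x`. [cite: Seregin2022LocalAxisym, §2 Step 4 (arXiv:2201.00153 p. 7), before (2.8)] -/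
theorem lintegral_enorm_smul_poloidal_rpow_six_le (hax : IsAxisymmetric u) (hu : ContDiff ℝ 4 u)
    (hζ : ContDiff ℝ 2 ζ) (hU : IsOpen U) (hζU : tsupport ζ ⊆ U)
    (hζ1 : tsupport ζ ⊆ SereginSverak2009.spaceCyl 0 1)
    (hdiv : ∀ y ∈ U, VectorCalculus.divergence u y = 0) (hCζ : ∀ x, ‖fderiv ℝ ζ x‖ ≤ Cζ)
    (hΓ : ∫⁻ x, ‖ζ x * angVortQuot u x‖ₑ ^ 2 ≤ K)
    (hA : ∫⁻ x in SereginSverak2009.spaceCyl 0 1, ‖u x‖ₑ ^ 2 ≤ A) :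
    ∫⁻ x, ‖ζ x • (u x - angVelQuot u x • rotGen x)‖ₑ ^ (6 : ℝ) ≤
      (eLpNormLESNormFDerivOfEqInnerConst (volume : Measure (EuclideanSpace ℝ (Fin 3))) 2 : ℝ≥0∞)
          ^ (6 : ℝ) * (2 * K + 12 * ENNReal.ofReal (Cζ ^ 2) * A) ^ (3 : ℝ) := by
  have hζc : HasCompactSupport ζ := hasCompactSupport_of_tsupport_subset_spaceCyl hζ1
  have hJ : ContDiff ℝ 2 (rotGen : EuclideanSpace ℝ (Fin 3) → EuclideanSpace ℝ (Fin 3)) := by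
    rw [show (rotGen : EuclideanSpace ℝ (Fin 3) → EuclideanSpace ℝ (Fin 3)) = ⇑rotGenL from
      funext fun v => rfl]
    exact rotGenL.contDiff
  have hb : ContDiff ℝ 2 fun y => u y - angVelQuot u y • rotGen y :=
    (hu.of_le (by norm_num)).sub ((contDiff_angVelQuot (n := 2) hu).smul hJ)
  have hW : ContDiff ℝ 1 fun y => ζ y • (u y - angVelQuot u y • rotGen y) :=
    (hζ.of_le (by norm_num)).smul (hb.of_le (by norm_num))
  have hWc : HasCompactSupport fun y => ζ y • (u y - angVelQuot u y • rotGen y) := hζc.smul_right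
  refine (lintegral_enorm_rpow_six_le hW hWc).trans ?_
  gcongr
  exact lintegral_enorm_fderiv_smul_poloidal_sq_le hax hu hζ hU hζU hζ1 hdiv hCζ hΓ hA

/-- `|𝒞(R)| ≤ 8|B₁| R³` with `R³` as a real power of `ENNReal.ofReal R`. [folklore]
[cite: Seregin2022LocalAxisym, §2 proof of Thm. 1.2, Step 4 (arXiv:2201.00153 pp. 4–7) (source of the ARGUMENT this module implements; this declaration is the cell’s own lemma or plumbing, NOT a printed statement)] -/
theorem volume_spaceCyl_le_rpow {R : ℝ} (hR : 0 < R) :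
    volume (SereginSverak2009.spaceCyl (0 : EuclideanSpace ℝ (Fin 3)) R) ≤
      8 * volume (ball (0 : EuclideanSpace ℝ (Fin 3)) 1) * ENNReal.ofReal R ^ (3 : ℝ) := by
  refine (SereginSverak2009.volume_spaceCyl_le 0 hR).trans (le_of_eq ?_)
  rw [mul_pow, show (2 : ℝ) ^ 3 = 8 by norm_num, ENNReal.ofReal_mul (by norm_num),
    ENNReal.ofReal_ofNat, ENNReal.ofReal_pow hR.le,
    show (3 : ℝ) = ((3 : ℕ) : ℝ) by norm_num, ENNReal.rpow_natCast]
  ring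

/-- **The poloidal slice bound** (Seregin's (2.8) at a fixed time, rate `R^{3/2}`): under the
hypotheses of `lintegral_enorm_smul_poloidal_rpow_six_le`, on every cylinder `𝒞(R)`, `R > 0`, on
which `ζ = 1`:
`∫_{𝒞(R)} |b|³ ≤ (8|B₁|R³)^{1/2} · (C_S⁶ (2K + 12C_ζ²A)³)^{1/2}` (Cauchy–Schwarz on `𝒞(R)`).
[cite: Seregin2022LocalAxisym, §2 Step 4 (arXiv:2201.00153 p. 7), (2.8)] -/
theorem setLIntegral_spaceCyl_enorm_poloidal_pow_three_le' (hax : IsAxisymmetric u)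
    (hu : ContDiff ℝ 4 u) (hζ : ContDiff ℝ 2 ζ) (hU : IsOpen U) (hζU : tsupport ζ ⊆ U)
    (hζ1 : tsupport ζ ⊆ SereginSverak2009.spaceCyl 0 1)
    (hdiv : ∀ y ∈ U, VectorCalculus.divergence u y = 0) (hCζ : ∀ x, ‖fderiv ℝ ζ x‖ ≤ Cζ)
    (hΓ : ∫⁻ x, ‖ζ x * angVortQuot u x‖ₑ ^ 2 ≤ K)
    (hA : ∫⁻ x in SereginSverak2009.spaceCyl 0 1, ‖u x‖ₑ ^ 2 ≤ A)
    {R : ℝ} (hR : 0 < R) (hζR : ∀ x ∈ SereginSverak2009.spaceCyl 0 R, ζ x = 1) :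
    ∫⁻ x in SereginSverak2009.spaceCyl 0 R, ‖u x - angVelQuot u x • rotGen x‖ₑ ^ (3 : ℕ) ≤
      (8 * volume (ball (0 : EuclideanSpace ℝ (Fin 3)) 1) * ENNReal.ofReal R ^ (3 : ℝ)) ^ (1 / 2 : ℝ) *
        ((eLpNormLESNormFDerivOfEqInnerConst (volume : Measure (EuclideanSpace ℝ (Fin 3))) 2 : ℝ≥0∞)
          ^ (6 : ℝ) * (2 * K + 12 * ENNReal.ofReal (Cζ ^ 2) * A) ^ (3 : ℝ)) ^ (1 / 2 : ℝ) := by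
  set b : EuclideanSpace ℝ (Fin 3) → EuclideanSpace ℝ (Fin 3) := fun x => u x - angVelQuot u x • rotGen x
    with hbdef
  set μ : Measure (EuclideanSpace ℝ (Fin 3)) := volume.restrict (SereginSverak2009.spaceCyl 0 R) with hμ
  have hJ : ContDiff ℝ 2 (rotGen : EuclideanSpace ℝ (Fin 3) → EuclideanSpace ℝ (Fin 3)) := by
    rw [show (rotGen : EuclideanSpace ℝ (Fin 3) → EuclideanSpace ℝ (Fin 3)) = ⇑rotGenL from
      funext fun v => rfl]
    exact rotGenL.contDiff
  have hbc : Continuous b :=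
    ((hu.of_le (by norm_num)).sub ((contDiff_angVelQuot (n := 2) hu).smul hJ)).continuous
  have hbm : AEMeasurable (fun x => ‖b x‖ₑ ^ (3 : ℝ)) μ :=
    (hbc.measurable.enorm.pow_const _).aemeasurable
  -- Cauchy–Schwarz `∫ 1 · |b|³ ≤ (∫ 1)^{1/2} (∫ |b|⁶)^{1/2}` on `𝒞(R)`
  have hCS := ENNReal.lintegral_mul_le_Lp_mul_Lq μ Real.HolderConjugate.two_two
    (f := fun _ => (1 : ℝ≥0∞)) aemeasurable_const hbm
  simp only [Pi.mul_apply, one_mul, ENNReal.one_rpow, lintegral_const, one_div] at hCS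
  have e3 : ∀ x, ‖b x‖ₑ ^ (3 : ℕ) = ‖b x‖ₑ ^ (3 : ℝ) := fun x => by
    rw [show (3 : ℝ) = ((3 : ℕ) : ℝ) by norm_num, ENNReal.rpow_natCast]
  have e6 : ∀ x, (‖b x‖ₑ ^ (3 : ℝ)) ^ (2 : ℝ) = ‖b x‖ₑ ^ (6 : ℝ) := fun x => by
    rw [← ENNReal.rpow_mul]; norm_num
  have hI : ∫⁻ a, (‖b a‖ₑ ^ (3 : ℝ)) ^ (2 : ℝ) ∂μ = ∫⁻ a, ‖b a‖ₑ ^ (6 : ℝ) ∂μ := lintegral_congr e6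
  rw [hI] at hCS
  show ∫⁻ x, ‖b x‖ₑ ^ (3 : ℕ) ∂μ ≤ _
  simp only [e3]
  refine hCS.trans ?_
  rw [one_div]
  gcongr
  · -- `μ univ = |𝒞(R)| ≤ 8|B₁|R³`
    rw [hμ, Measure.restrict_apply_univ]
    exact volume_spaceCyl_le_rpow hR
  · -- `∫_{𝒞(R)} |b|⁶ = ∫_{𝒞(R)} |ζb|⁶ ≤ ∫ |ζb|⁶`
    calc ∫⁻ x, ‖b x‖ₑ ^ (6 : ℝ) ∂μ = ∫⁻ x in SereginSverak2009.spaceCyl 0 R, ‖ζ x • b x‖ₑ ^ (6 : ℝ) := by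
          rw [hμ]
          refine setLIntegral_congr_fun (SereginSverak2009.isOpen_spaceCyl 0 R).measurableSet
            fun x hx => ?_
          simp only [hζR x hx, one_smul]
      _ ≤ ∫⁻ x, ‖ζ x • b x‖ₑ ^ (6 : ℝ) := setLIntegral_le_lintegral _ _
      _ ≤ _ := lintegral_enorm_smul_poloidal_rpow_six_le hax hu hζ hU hζU hζ1 hdiv hCζ hΓ hA

end Slice

end Literature.Analysis.SereginLogSwirlOrigin.EulerScaling

end Part1

/-!
## Part 2 — port of `Summits/NavierStokesRegularity/NavierStokesRegularity/Theorems/AxisymmetricExtremalityAxisymmetricKatoGlobalStubSereginLogSwirlOriginVThetaPassage.lean` (15 declarations kept)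

# Seregin 2022, §2 Step 4: the `v_θ` passage (`x₃`-Poincaré on the cylinder and
# `|∂₃(η³v_θ)| ≤ r|η³Φ| + |∂₃η³||v_θ|`) — crux stmt-NavierStokesRegularity-15453 (`AxisymmetricExtremality.AxisymmetricKatoGlobal`), line registered, support for stub `stub_sereginLogSwirlOrigin`

Support file (`--supports stmt-NavierStokesRegularity-15453`; theorems only, everything proved)
toward the registered stub `stub_sereginLogSwirlOrigin` = the named fact
`Literature.Analysis.FluidPDE.seregin2022_logSwirl_regularAtOrigin` (G. Seregin, J. Math. Fluid
Mech. 24 (2022), Paper 27 = arXiv:2201.00153, §2).  Step 4 of that proof shows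
`C(R) = R⁻²∫_{Q(R)}|v|³ → 0`; the swirl component `v_θ` is handled by the passage (arXiv p. 7)

> `η³v_θ(r,x₃,t) = ∫_{-1}^{x₃} (η³v_θ),₃(r,y,t) dy` and thus
> `sup_{x₃}|η³v_θ(r,x₃,t)| ≤ c(∫_{-1}^{1}|(η³v_θ),₃(r,y,t)|^{10/3}dy)^{3/10}`, re-written so that
> `sup_{x₃}(1/r)|η³v_θ| ≤ c(∫_{-1}^{1}(|Φη³| + |(η³),₃||v_θ|/r)^{10/3}dy)^{3/10}` …
> `∫_{Q(R)}|v_θ|^{10/3}dz ≤ ∫∫(R^{10/3}∫_{-R}^{R}|v_θ/r|^{10/3}dx₃) r dr dt ≤ cR^{10/3+1}[…]`,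

with `Φ = ω_r/r = -v_{θ,3}/r` (arXiv p. 6).  In tree vocabulary (`swirlVelocity = v_θ`,
`radialVelocity (curl v) = ω_r`, `radVelQuot (curl v) = Φ`, `SereginSverak2009.spaceCyl 0 R = 𝒞(R)`,
`∂₃ = D(·)[EuclideanSpace.single 2 1]`) this file proves both ingredients:

* `fderiv_swirlVelocity_single_two` — **`∂₃v_θ = -ω_r`** off the axis for an axisymmetric field
  differentiable at the point (`rω_r = x₀ω₀ + x₁ω₁ = -∂₃Γ` by the infinitesimal axisymmetry
  `(Du[Jx])₂ = 0`), and `fderiv_swirlVelocity_single_two_eq_neg_mul_radVelQuot` — `∂₃v_θ = -rΦ`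
  for `v ∈ C³` with the tree's smooth quotient `Φ = radVelQuot (curl v)`;
* `abs_fderiv_mul_swirlVelocity_single_two_le_radVelQuot` (registered) — the printed
  **`|∂₃(ζv_θ)| ≤ r|ζΦ| + |∂₃ζ||v_θ|`** (`ζ = η³`); `C¹` form `abs_fderiv_mul_swirlVelocity_single_two_le`
  with `ω_r` for `rΦ`;
* `eq_integral_fderiv_vline`, `enorm_le_lintegral_vline` — `F(x',x₃) = ∫_{-1}^{x₃} ∂₃F(x',s) ds`
  along the vertical line `s ↦ x + (s - x₃)e₂`, for `F ∈ C¹` off the axis, `F = 0` where `x₃ ≤ -1`;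
* `lintegral_spaceCyl_rpow_le_lintegral_fderiv` (registered) — the **anisotropic `x₃`-Poincaré
  inequality** `∫_{𝒞(R)}|F|^p ≤ 2^pR ∫_{|x'|<R,|x₃|<1}|∂₃F|^p` (`p ≥ 1`, `R ≤ 1`): Hölder on `]-1,1[`,
  the height `2R` of `𝒞(R)` against the full height of the derivative integral (the printed gain
  `R^{10/3+1}` once `|v_θ| ≤ R|v_θ/r|` is inserted), and Tonelli over `(x₃, x')` through the
  tree's volume-preserving `cylSplit : ℝ³ ≃ᵐ ℝ × ℝ²`; no measurability hypothesis is needed, a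
  function continuous off the (null) axis being a.e.-measurable;
* `lintegral_spaceCyl_mul_swirlVelocity_rpow_le` (registered) — both combined:
  `∫_{𝒞(R)}|ζv_θ|^p ≤ 2^pR ∫_{|x'|<R,|x₃|<1}(|ζω_r| + |∂₃ζ v_θ|)^p` for `ζ ∈ C¹` vanishing where
  `x₃ ≤ -1` and `v` axisymmetric, `C¹` near the off-axis points of `tsupport ζ`.

## References

* G. Seregin, J. Math. Fluid Mech. 24 (2022), Paper No. 27 = arXiv:2201.00153, §2 Step 4 (arXiv
  p. 7) and Step 3 (`Φ = ω_r/r = -v_{θ,3}/r`, arXiv p. 6). [`Seregin2022LocalAxisym`]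
* Z. Lei, Q. S. Zhang, Pacific J. Math. 289 (2017), §1 (`J = ωʳ/r = -∂_z v^θ/r`). [`LeiZhang2017`]

Not carried from this source module (not needed by the declarations re-homed here; their consumers are Summits-side): `fderiv_swirlVelocity_single_two_eq_neg_mul_radVelQuot`, `abs_fderiv_mul_swirlVelocity_single_two_le`, `abs_fderiv_mul_swirlVelocity_single_two_le_radVelQuot`, `lintegral_spaceCyl_rpow_le_lintegral_fderiv`.
-/

section Part2

open _root_.Set _root_.MeasureTheory _root_.Filter _root_.Topology _root_.Function _root_.Metric
open scoped _root_.ENNReal _root_.NNReal RealInnerProductSpace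
open Literature.Analysis.FluidPDE

namespace Literature.Analysis.SereginLogSwirlOrigin.EulerScaling

section Swirl
variable {v : EuclideanSpace ℝ (Fin 3) → EuclideanSpace ℝ (Fin 3)} {x : EuclideanSpace ℝ (Fin 3)}

/-- **`r ω_r = -∂₃Γ`**: `x₀ω₀ + x₁ω₁ = -∂₃(swirl v)` wherever the axisymmetric `v` is differentiable
(`x₀ω₀ + x₁ω₁ = -(x₀∂₃v₁ - x₁∂₃v₀) + (Dv[Jx])₂` and `(Dv[Jx])₂ = (J v)₂ = 0`). [cite: Seregin2022LocalAxisym, §2 Step 4] -/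
theorem horizontal_curl_eq_neg_fderiv_swirl (hax : IsAxisymmetric v) (hd : DifferentiableAt ℝ v x) :
    x 0 * curl v x 0 + x 1 * curl v x 1 = -fderiv ℝ (swirl v) x (EuclideanSpace.single 2 1) := by
  -- adapted from `Literature.Analysis.FluidPDE.IsAxisymmetric.radVelQuot_curl_eq_neg_fderiv_angVelQuot`
  have hJ := congrArg (fun w : EuclideanSpace ℝ (Fin 3) => w 2) (hax.fderiv_rotGen hd)
  simp [rotGen_eq_sub_single] at hJ
  rw [fderiv_swirl_single_two hd]
  simp [swirl, curl]
  linear_combination hJ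

/-- `v_θ = r⁻¹Γ` is differentiable off the axis where `v` is:
`Dv_θ(x) = r⁻¹ DΓ(x) + Γ(x) D(r⁻¹)(x)`, `D(r⁻¹)(x) = -r⁻² ⟪e_r(x), ·⟫`. [folklore]
[cite: Seregin2022LocalAxisym, §2 proof of Thm. 1.2, Step 4 (arXiv:2201.00153 pp. 4–7) (source of the ARGUMENT this module implements; this declaration is the cell’s own lemma or plumbing, NOT a printed statement)] -/
theorem hasFDerivAt_swirlVelocity (hd : DifferentiableAt ℝ v x) (hx : cylRadius x ≠ 0) :
    HasFDerivAt (swirlVelocity v)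
      ((cylRadius x)⁻¹ • fderiv ℝ (swirl v) x +
        swirl v x • ((ContinuousLinearMap.toSpanSingleton ℝ (-(cylRadius x ^ 2)⁻¹)).comp
          (innerSL ℝ (eR x)))) x := by
  rw [SereginZajaczkowski2007.swirlVelocity_eq_inv_mul_swirl]
  exact ((hasFDerivAt_inv hx).comp x (hasFDerivAt_cylRadius hx)).mul
    (differentiableAt_swirl hd).hasFDerivAt

/-- `v_θ` is `Cⁿ` at an off-axis point where `v` is. [folklore]
[cite: Seregin2022LocalAxisym, §2 proof of Thm. 1.2, Step 4 (arXiv:2201.00153 pp. 4–7) (source of the ARGUMENT this module implements; this declaration is the cell’s own lemma or plumbing, NOT a printed statement)] -/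
theorem contDiffAt_swirlVelocity_of_contDiffAt {n : WithTop ℕ∞} (hv : ContDiffAt ℝ n v x)
    (hx : cylRadius x ≠ 0) : ContDiffAt ℝ n (swirlVelocity v) x := by
  rw [SereginZajaczkowski2007.swirlVelocity_eq_inv_mul_swirl]
  refine ((contDiffAt_cylRadius hx).inv hx).mul ?_
  rw [swirl_eq_inner_rotGen]
  exact (rotGenL.contDiff.contDiffAt (x := x)).inner ℝ hv

/-- **`∂₃ v_θ = -ω_r` off the axis** (Seregin: "`Φ = ω_r/r = -v_{θ,3}/r`"), for an axisymmetric
field differentiable at the point: `D(v_θ)(x)[e₂] = -radialVelocity (curl v) x` (`r` is constant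
along `e₂`: `⟪e_r, e₂⟫ = 0`, and `r ω_r = -∂₃Γ`). [cite: Seregin2022LocalAxisym, §2 Step 4] -/
theorem fderiv_swirlVelocity_single_two (hax : IsAxisymmetric v) (hd : DifferentiableAt ℝ v x)
    (hx : cylRadius x ≠ 0) :
    fderiv ℝ (swirlVelocity v) x (EuclideanSpace.single 2 1) = -radialVelocity (curl v) x := by
  rw [(hasFDerivAt_swirlVelocity hd hx).fderiv, SereginZajaczkowski2007.radialVelocity_eq_div,
    horizontal_curl_eq_neg_fderiv_swirl hax hd]
  have h2 : ⟪eR x, EuclideanSpace.single 2 (1 : ℝ)⟫ = 0 := inner_eR_eZ x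
  simp only [add_apply, smul_apply, ContinuousLinearMap.comp_apply, innerSL_apply_apply, h2,
    ContinuousLinearMap.toSpanSingleton_apply, smul_eq_mul]
  field_simp
  ring

/-- **`∂₃(ζ v_θ) = ∂₃ζ · v_θ - ζ ω_r`** off the axis (`ζ = η³` in Seregin's Step 4).
[cite: Seregin2022LocalAxisym, §2 Step 4] -/
theorem fderiv_mul_swirlVelocity_single_two (hax : IsAxisymmetric v) (hd : DifferentiableAt ℝ v x)
    (hx : cylRadius x ≠ 0) {ζ : EuclideanSpace ℝ (Fin 3) → ℝ} (hζ : DifferentiableAt ℝ ζ x) :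
    fderiv ℝ (fun y => ζ y * swirlVelocity v y) x (EuclideanSpace.single 2 1) =
      fderiv ℝ ζ x (EuclideanSpace.single 2 1) * swirlVelocity v x -
        ζ x * radialVelocity (curl v) x := by
  rw [fderiv_fun_mul hζ (hasFDerivAt_swirlVelocity hd hx).differentiableAt]
  simp only [add_apply, smul_apply, smul_eq_mul, fderiv_swirlVelocity_single_two hax hd hx]
  ring

end Swirl

section LineFTC
variable {F : EuclideanSpace ℝ (Fin 3) → ℝ} {x : EuclideanSpace ℝ (Fin 3)}

/-- The vertical line `s ↦ x + (s - x₃)e₂` has velocity `e₂`. [folklore]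
[cite: Seregin2022LocalAxisym, §2 proof of Thm. 1.2, Step 4 (arXiv:2201.00153 pp. 4–7) (source of the ARGUMENT this module implements; this declaration is the cell’s own lemma or plumbing, NOT a printed statement)] -/
theorem hasDerivAt_vline (x : EuclideanSpace ℝ (Fin 3)) (s : ℝ) :
    HasDerivAt (fun t : ℝ => x + (t - x 2) • EuclideanSpace.single 2 (1 : ℝ))
      (EuclideanSpace.single 2 (1 : ℝ)) s := by
  simpa using (((hasDerivAt_id s).sub_const (x 2)).smul_const
    (EuclideanSpace.single (2 : Fin 3) (1 : ℝ))).const_add x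

/-- In the split variables `(z, w)` of `cylSplit`, the vertical line through `(w, z)` at
parameter `s` is `(w, s)`. [folklore]
[cite: Seregin2022LocalAxisym, §2 proof of Thm. 1.2, Step 4 (arXiv:2201.00153 pp. 4–7) (source of the ARGUMENT this module implements; this declaration is the cell’s own lemma or plumbing, NOT a printed statement)] -/
theorem cylSplit_symm_vline (s z : ℝ) (w : EuclideanSpace ℝ (Fin 2)) :
    cylSplit.symm (z, w) + (s - z) • EuclideanSpace.single 2 (1 : ℝ) = cylSplit.symm (s, w) := by
  rw [cylSplit_symm_apply, cylSplit_symm_apply]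
  ext i
  fin_cases i <;> simp

/-- **`F(x', x₃) = ∫_{-1}^{x₃} ∂₃F(x', s) ds`** (Seregin: "`η³v_θ(r,x₃,t) = ∫_{-1}^{x₃}
(η³v_θ),₃(r,y,t) dy`") for `F` of class `C¹` off the axis vanishing where `x₃ ≤ -1`, at every
off-axis point `x`. [cite: Seregin2022LocalAxisym, §2 Step 4] -/
theorem eq_integral_fderiv_vline (hF : ∀ y, cylRadius y ≠ 0 → ContDiffAt ℝ 1 F y)
    (hF0 : ∀ y : EuclideanSpace ℝ (Fin 3), y 2 ≤ -1 → F y = 0) (hx : cylRadius x ≠ 0) :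
    F x = ∫ s in (-1 : ℝ)..(x 2),
      fderiv ℝ F (x + (s - x 2) • EuclideanSpace.single 2 (1 : ℝ)) (EuclideanSpace.single 2 1) := by
  set ℓ : ℝ → EuclideanSpace ℝ (Fin 3) := fun s => x + (s - x 2) • EuclideanSpace.single 2 (1 : ℝ)
    with hℓ
  have hFℓ : ∀ s, ContDiffAt ℝ 1 F (ℓ s) := fun s => hF _ (by simpa [hℓ, cylRadius] using hx)
  have hg : ∀ s, HasDerivAt (F ∘ ℓ) (fderiv ℝ F (ℓ s) (EuclideanSpace.single 2 1)) s := fun s =>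
    ((hFℓ s).differentiableAt one_ne_zero).hasFDerivAt.comp_hasDerivAt s (hasDerivAt_vline x s)
  have hC1 : ContDiff ℝ 1 (F ∘ ℓ) := contDiff_iff_contDiffAt.2 fun s => (hFℓ s).comp s
    (contDiff_const.add ((contDiff_id.sub contDiff_const).smul contDiff_const)).contDiffAt
  have hcont : Continuous fun s => fderiv ℝ F (ℓ s) (EuclideanSpace.single 2 1) := by
    have he : deriv (F ∘ ℓ) = fun s => fderiv ℝ F (ℓ s) (EuclideanSpace.single 2 1) :=
      funext fun s => (hg s).deriv
    simpa only [he] using hC1.continuous_deriv_one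
  rw [intervalIntegral.integral_eq_sub_of_hasDerivAt (fun s _ => hg s) (hcont.intervalIntegrable _ _)]
  have h1 : (F ∘ ℓ) (x 2) = F x := by simp [hℓ]
  have h2 : (F ∘ ℓ) (-1) = 0 := hF0 _ (by simp [hℓ])
  rw [h1, h2, sub_zero]

/-- **`|F(x', x₃)| ≤ ∫_{-1}^{x₃} |∂₃F(x', s)| ds`** in `ℝ≥0∞` (no integrability proviso), for `F`
of class `C¹` off the axis vanishing where `x₃ ≤ -1`, at every off-axis point.
[cite: Seregin2022LocalAxisym, §2 Step 4] -/
theorem enorm_le_lintegral_vline (hF : ∀ y, cylRadius y ≠ 0 → ContDiffAt ℝ 1 F y)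
    (hF0 : ∀ y : EuclideanSpace ℝ (Fin 3), y 2 ≤ -1 → F y = 0) (hx : cylRadius x ≠ 0) :
    ‖F x‖ₑ ≤ ∫⁻ s in Ioc (-1) (x 2),
      ‖fderiv ℝ F (x + (s - x 2) • EuclideanSpace.single 2 (1 : ℝ)) (EuclideanSpace.single 2 1)‖ₑ := by
  rcases lt_or_ge (x 2) (-1) with h | h
  · simp [hF0 x h.le]
  · rw [eq_integral_fderiv_vline hF hF0 hx, intervalIntegral.integral_of_le h]
    exact enorm_integral_le_lintegral_enorm _

end LineFTC

/-- **Hölder against the constant `1`**: `(∫ f)^p ≤ μ(univ)^{p-1} ∫ f^p` for `p ≥ 1`. [folklore]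
[cite: Seregin2022LocalAxisym, §2 proof of Thm. 1.2, Step 4 (arXiv:2201.00153 pp. 4–7) (source of the ARGUMENT this module implements; this declaration is the cell’s own lemma or plumbing, NOT a printed statement)] -/
theorem lintegral_rpow_le_measure_rpow_mul {α : Type*} [MeasurableSpace α] (μ : Measure α)
    {f : α → ℝ≥0∞} (hf : AEMeasurable f μ) {p : ℝ} (hp : 1 ≤ p) :
    (∫⁻ a, f a ∂μ) ^ p ≤ μ univ ^ (p - 1) * ∫⁻ a, f a ^ p ∂μ := by
  have hp0 : 0 < p := one_pos.trans_le hp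
  have h := eLpNorm'_le_eLpNorm'_mul_rpow_measure_univ one_pos hp hf.aestronglyMeasurable
  simp only [eLpNorm', enorm_eq_self, ENNReal.rpow_one, inv_one, one_div] at h
  have h2 := ENNReal.rpow_le_rpow h hp0.le
  rwa [ENNReal.mul_rpow_of_nonneg _ _ hp0.le, ← ENNReal.rpow_mul, ← ENNReal.rpow_mul,
    inv_mul_cancel₀ hp0.ne', ENNReal.rpow_one, show (1 - p⁻¹) * p = p - 1 by field_simp,
    mul_comm] at h2

/-- Almost every point of `ℝ³` is off the axis (the tree's `volume_axis_eq_zero`). [folklore]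
[cite: Seregin2022LocalAxisym, §2 proof of Thm. 1.2, Step 4 (arXiv:2201.00153 pp. 4–7) (source of the ARGUMENT this module implements; this declaration is the cell’s own lemma or plumbing, NOT a printed statement)] -/
theorem ae_cylRadius_ne_zero_volume :
    ∀ᵐ y ∂(volume : Measure (EuclideanSpace ℝ (Fin 3))), cylRadius y ≠ 0 := by
  have h : volume {y : EuclideanSpace ℝ (Fin 3) | cylRadius y = 0} = 0 := by
    refine measure_mono_null (fun y hy => ?_) volume_axis_eq_zero
    rw [mem_setOf_eq, cylRadius_eq_zero_iff] at hy
    show y 0 ^ 2 + y 1 ^ 2 = 0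
    simp [hy.1, hy.2]
  simpa [ae_iff] using h

/-- **A function continuous off the axis is a.e.-measurable** (the axis is null, its complement
open). [folklore]
[cite: Seregin2022LocalAxisym, §2 proof of Thm. 1.2, Step 4 (arXiv:2201.00153 pp. 4–7) (source of the ARGUMENT this module implements; this declaration is the cell’s own lemma or plumbing, NOT a printed statement)] -/
theorem aemeasurable_of_continuousAt_off_axis {β : Type*} [MeasurableSpace β]
    [TopologicalSpace β] [BorelSpace β] {F : EuclideanSpace ℝ (Fin 3) → β}
    (hF : ∀ y, cylRadius y ≠ 0 → ContinuousAt F y) : AEMeasurable F volume := by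
  have hU : IsOpen {y : EuclideanSpace ℝ (Fin 3) | cylRadius y ≠ 0} :=
    isOpen_ne_fun continuous_cylRadius continuous_const
  have hc : ContinuousOn F {y | cylRadius y ≠ 0} := fun y hy => (hF y hy).continuousWithinAt
  have h2 : volume.restrict {y : EuclideanSpace ℝ (Fin 3) | cylRadius y ≠ 0} = volume :=
    Measure.restrict_eq_self_of_ae_mem (s := {y | cylRadius y ≠ 0}) ae_cylRadius_ne_zero_volume
  simpa only [h2] using hc.aemeasurable (μ := volume) hU.measurableSet

/-- **Tonelli over `(x₃, x')` on cylinders** (lower Lebesgue integrals, no integrability proviso):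
`∫_{|x'| < R, x₃ ∈ I} G = ∫_{|w| < R} dw ∫_{z ∈ I} G(w, z) dz`, through the tree's
volume-preserving `cylSplit : ℝ³ ≃ᵐ ℝ × ℝ²`. [folklore]
[cite: Seregin2022LocalAxisym, §2 proof of Thm. 1.2, Step 4 (arXiv:2201.00153 pp. 4–7) (source of the ARGUMENT this module implements; this declaration is the cell’s own lemma or plumbing, NOT a printed statement)] -/
theorem setLIntegral_cyl_eq_lintegral_lintegral {G : EuclideanSpace ℝ (Fin 3) → ℝ≥0∞}
    (hG : AEMeasurable G volume) (R : ℝ) (I : Set ℝ) :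
    ∫⁻ x in {x : EuclideanSpace ℝ (Fin 3) | cylRadius x < R ∧ x 2 ∈ I}, G x =
      ∫⁻ w in ball (0 : EuclideanSpace ℝ (Fin 2)) R, ∫⁻ z in I, G (cylSplit.symm (z, w)) := by
  have hset : {x : EuclideanSpace ℝ (Fin 3) | cylRadius x < R ∧ x 2 ∈ I} =
      cylSplit ⁻¹' (I ×ˢ ball (0 : EuclideanSpace ℝ (Fin 2)) R) := by
    ext x
    simp [cylRadius_eq_norm_cylSplit_snd, and_comm]
  have h1 : ∫⁻ x in {x : EuclideanSpace ℝ (Fin 3) | cylRadius x < R ∧ x 2 ∈ I}, G x =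
      ∫⁻ q in I ×ˢ ball (0 : EuclideanSpace ℝ (Fin 2)) R, G (cylSplit.symm q) := by
    rw [hset, ← measurePreserving_cylSplit.setLIntegral_comp_preimage_emb
      cylSplit.measurableEmbedding]
    simp only [MeasurableEquiv.symm_apply_apply]
  have hG' : AEMeasurable (fun q => G (cylSplit.symm q))
      ((volume.restrict I).prod (volume.restrict (ball (0 : EuclideanSpace ℝ (Fin 2)) R))) := by
    rw [Measure.prod_restrict, ← Measure.volume_eq_prod]
    exact ((measurePreserving_cylSplit_symm.aemeasurable_comp_iff
      cylSplit.symm.measurableEmbedding).2 hG).restrict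
  rw [h1, Measure.volume_eq_prod, ← Measure.prod_restrict, lintegral_prod_symm _ hG']

/-- **`x₃`-Poincaré on the cylinder** `𝒞(R) = spaceCyl 0 R`: for `F ∈ C¹` off the axis vanishing
where `x₃ ≤ -1`, `p ≥ 1`, `R ≤ 1`: `∫_{𝒞(R)} |F|^p ≤ 2^p R ∫_{|x'| < R, |x₃| < 1} |∂₃F|^p` — Seregin's
"`sup_{x₃}|F(r,x₃)| ≤ c(∫_{-1}^{1}|F,₃|^{10/3}dy)^{3/10}`" integrated over `𝒞(R)` (FTC along vertical
lines, Hölder on `]-1,1[`, the height `2R` of `𝒞(R)`, Tonelli). [cite: Seregin2022LocalAxisym, §2 Step 4] -/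
theorem lintegral_spaceCyl_rpow_le_lintegral_fderiv' {F : EuclideanSpace ℝ (Fin 3) → ℝ}
    (hF : ∀ y, cylRadius y ≠ 0 → ContDiffAt ℝ 1 F y)
    (hF0 : ∀ y : EuclideanSpace ℝ (Fin 3), y 2 ≤ -1 → F y = 0)
    {p : ℝ} (hp : 1 ≤ p) {R : ℝ} (hR1 : R ≤ 1) :
    ∫⁻ x in SereginSverak2009.spaceCyl 0 R, ‖F x‖ₑ ^ p ≤
      2 ^ p * ENNReal.ofReal R *
        ∫⁻ x in {x : EuclideanSpace ℝ (Fin 3) | cylRadius x < R ∧ |x 2| < 1},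
          ‖fderiv ℝ F x (EuclideanSpace.single 2 1)‖ₑ ^ p := by
  have hp0 : 0 < p := one_pos.trans_le hp
  set A : EuclideanSpace ℝ (Fin 2) → ℝ≥0∞ := fun w => ∫⁻ s in Ioo (-1 : ℝ) 1,
    ‖fderiv ℝ F (cylSplit.symm (s, w)) (EuclideanSpace.single 2 1)‖ₑ ^ p with hA
  have hcyl : SereginSverak2009.spaceCyl 0 R =
      {x : EuclideanSpace ℝ (Fin 3) | cylRadius x < R ∧ x 2 ∈ Ioo (-R) R} := by
    ext x
    simp [SereginSverak2009.spaceCyl, abs_lt, mem_Ioo]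
  have htall : {x : EuclideanSpace ℝ (Fin 3) | cylRadius x < R ∧ |x 2| < 1} =
      {x : EuclideanSpace ℝ (Fin 3) | cylRadius x < R ∧ x 2 ∈ Ioo (-1 : ℝ) 1} := by
    ext x
    simp [abs_lt, mem_Ioo]
  have hmeas : Measurable fun x => fderiv ℝ F x (EuclideanSpace.single 2 (1 : ℝ)) :=
    measurable_fderiv_apply_const ℝ F _
  rw [hcyl, htall, setLIntegral_cyl_eq_lintegral_lintegral ((aemeasurable_of_continuousAt_off_axis
      fun y hy => (hF y hy).continuousAt).enorm.pow_const p) R,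
    setLIntegral_cyl_eq_lintegral_lintegral (hmeas.enorm.pow_const p).aemeasurable R]
  -- the bound on each vertical line off the axis
  have hline : ∀ w : EuclideanSpace ℝ (Fin 2), w ≠ 0 → ∀ z ∈ Ioo (-R) R,
      ‖F (cylSplit.symm (z, w))‖ₑ ^ p ≤ 2 ^ (p - 1) * A w := by
    intro w hw z hz
    have hx : cylRadius (cylSplit.symm (z, w)) ≠ 0 := by
      rw [cylRadius_cylSplit_symm]; exact norm_ne_zero_iff.2 hw
    have h1 := enorm_le_lintegral_vline hF hF0 hx
    simp only [cylSplit_symm_apply_two, cylSplit_symm_vline] at h1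
    have h2 : ‖F (cylSplit.symm (z, w))‖ₑ ≤ ∫⁻ s in Ioo (-1 : ℝ) 1,
        ‖fderiv ℝ F (cylSplit.symm (s, w)) (EuclideanSpace.single 2 1)‖ₑ :=
      h1.trans (lintegral_mono_set (Ioc_subset_Ioo_right (hz.2.trans_le hR1)))
    have hgm : AEMeasurable (fun s : ℝ =>
        ‖fderiv ℝ F (cylSplit.symm (s, w)) (EuclideanSpace.single 2 (1 : ℝ))‖ₑ)
        (volume.restrict (Ioo (-1 : ℝ) 1)) :=
      (hmeas.comp (cylSplit.symm.measurable.comp measurable_prodMk_right)).enorm.aemeasurable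
    have h3 := lintegral_rpow_le_measure_rpow_mul (volume.restrict (Ioo (-1 : ℝ) 1)) hgm hp
    rw [Measure.restrict_apply_univ, Real.volume_Ioo,
      show (1 : ℝ) - -1 = 2 by norm_num, ENNReal.ofReal_ofNat] at h3
    exact (ENNReal.rpow_le_rpow h2 hp0.le).trans h3
  have hae : ∀ᵐ w ∂(volume.restrict (ball (0 : EuclideanSpace ℝ (Fin 2)) R)), w ≠ 0 :=
    ae_restrict_of_ae ((compl_mem_ae_iff (s := {(0 : EuclideanSpace ℝ (Fin 2))})).2
      (measure_singleton _))
  have hconst : ENNReal.ofReal (R - -R) * 2 ^ (p - 1) = 2 ^ p * ENNReal.ofReal R := by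
    rw [show R - -R = 2 * R by ring, ENNReal.ofReal_mul zero_le_two, ENNReal.ofReal_ofNat]
    conv_rhs => rw [show p = (p - 1) + 1 by ring,
      ENNReal.rpow_add _ _ two_ne_zero ENNReal.ofNat_ne_top, ENNReal.rpow_one]
    ring
  calc ∫⁻ w in ball (0 : EuclideanSpace ℝ (Fin 2)) R, ∫⁻ z in Ioo (-R) R,
          ‖F (cylSplit.symm (z, w))‖ₑ ^ p
      ≤ ∫⁻ w in ball (0 : EuclideanSpace ℝ (Fin 2)) R, ∫⁻ _z in Ioo (-R) R, 2 ^ (p - 1) * A w :=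
        lintegral_mono_ae (hae.mono fun w hw => setLIntegral_mono' measurableSet_Ioo (hline w hw))
    _ = ∫⁻ w in ball (0 : EuclideanSpace ℝ (Fin 2)) R, 2 ^ p * ENNReal.ofReal R * A w := by
        refine lintegral_congr fun w => ?_
        rw [setLIntegral_const, Real.volume_Ioo, mul_comm, ← mul_assoc, hconst]
    _ = 2 ^ p * ENNReal.ofReal R * ∫⁻ w in ball (0 : EuclideanSpace ℝ (Fin 2)) R, A w := by
        rw [lintegral_const_mul' _ _ (ENNReal.mul_ne_top
          (ENNReal.rpow_ne_top_of_nonneg hp0.le ENNReal.ofNat_ne_top) ENNReal.ofReal_ne_top)]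

/-- **The integrated `v_θ` passage of Seregin 2022, §2 Step 4**: for an axisymmetric field `v`,
`C¹` near every off-axis point of `tsupport ζ`, a `C¹` weight `ζ` (`= η³`) vanishing where
`x₃ ≤ -1`, `p ≥ 1` (`= 10/3`) and `R ≤ 1`: `∫_{𝒞(R)} |ζ v_θ|^p ≤ 2^p R ∫_{|x'|<R, |x₃|<1} (|ζ ω_r| +
|∂₃ζ · v_θ|)^p` (`ω_r = radialVelocity (curl v) = rΦ`; the `x₃`-Poincaré inequality for `F = ζ v_θ`
and `|∂₃(ζv_θ)| ≤ |ζω_r| + |∂₃ζ||v_θ|` a.e.). [cite: Seregin2022LocalAxisym, §2 Step 4] -/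
theorem lintegral_spaceCyl_mul_swirlVelocity_rpow_le : ∀ (v : EuclideanSpace ℝ (Fin 3) → EuclideanSpace ℝ (Fin 3)) (ζ : EuclideanSpace ℝ (Fin 3) → ℝ) (p R : ℝ), IsAxisymmetric v → ContDiff ℝ 1 ζ → (∀ y : EuclideanSpace ℝ (Fin 3), y 2 ≤ -1 → ζ y = 0) → (∀ y, cylRadius y ≠ 0 → y ∈ tsupport ζ → ContDiffAt ℝ 1 v y) → 1 ≤ p → R ≤ 1 → ∫⁻ x in SereginSverak2009.spaceCyl 0 R, ‖ζ x * swirlVelocity v x‖ₑ ^ p ≤ 2 ^ p * ENNReal.ofReal R * ∫⁻ x in {x : EuclideanSpace ℝ (Fin 3) | cylRadius x < R ∧ |x 2| < 1}, (‖ζ x * radialVelocity (curl v) x‖ₑ + ‖fderiv ℝ ζ x (EuclideanSpace.single 2 1) * swirlVelocity v x‖ₑ) ^ p := by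
  intro v ζ p R hax hζ hζ0 hv hp hR1
  have hp0 : 0 < p := one_pos.trans_le hp
  set F : EuclideanSpace ℝ (Fin 3) → ℝ := fun y => ζ y * swirlVelocity v y with hFdef
  -- off the support of `ζ`, `F` vanishes identically near the point
  have hzero : ∀ y, y ∉ tsupport ζ → F =ᶠ[𝓝 y] fun _ => 0 := fun y hy =>
    (notMem_tsupport_iff_eventuallyEq.1 hy).mono fun z hz => by
      simp only [Pi.zero_apply] at hz
      simp [hFdef, hz]
  have hF : ∀ y, cylRadius y ≠ 0 → ContDiffAt ℝ 1 F y := by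
    intro y hy
    by_cases hmem : y ∈ tsupport ζ
    · exact hζ.contDiffAt.mul (contDiffAt_swirlVelocity_of_contDiffAt (hv y hy hmem) hy)
    · exact contDiffAt_const.congr_of_eventuallyEq (hzero y hmem)
  have hF0 : ∀ y : EuclideanSpace ℝ (Fin 3), y 2 ≤ -1 → F y = 0 := fun y hy => by
    simp [hFdef, hζ0 y hy]
  refine (lintegral_spaceCyl_rpow_le_lintegral_fderiv' hF hF0 hp hR1).trans
    (mul_le_mul' le_rfl (lintegral_mono_ae (ae_restrict_of_ae ?_)))
  filter_upwards [ae_cylRadius_ne_zero_volume] with y hy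
  refine ENNReal.rpow_le_rpow ?_ hp0.le
  by_cases hmem : y ∈ tsupport ζ
  · rw [hFdef, fderiv_mul_swirlVelocity_single_two hax ((hv y hy hmem).differentiableAt one_ne_zero)
      hy (hζ.contDiffAt.differentiableAt one_ne_zero)]
    exact enorm_sub_le.trans_eq (add_comm _ _)
  · rw [(hzero y hmem).fderiv_eq]
    simp

end Literature.Analysis.SereginLogSwirlOrigin.EulerScaling

end Part2

/-!
## Part 3 — port of `Summits/NavierStokesRegularity/NavierStokesRegularity/Theorems/AxisymmetricExtremalityAxisymmetricKatoGlobalStubSereginLogSwirlOriginStep4AssemblySwirl.lean` (7 declarations kept)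

# Seregin 2022, §2 Step 4 (assembly, II): the swirl part at a fixed time and the `L^{10/3}`
# bound of `η³Φ` from (2.7) — crux stmt-NavierStokesRegularity-15453 (`AxisymmetricExtremality.AxisymmetricKatoGlobal`), line registered, support for stub `stub_sereginLogSwirlOrigin`

Support file (`--supports stmt-NavierStokesRegularity-15453`; theorems only, everything proved)
toward the registered stub `stub_sereginLogSwirlOrigin` = the named fact
`Literature.Analysis.FluidPDE.seregin2022_logSwirl_regularAtOrigin` (G. Seregin, J. Math. Fluid
Mech. 24 (2022), Paper 27 = arXiv:2201.00153, §2).  Second file of the Step-4 assembly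
("Step-3 bounds ⇒ `C(R) → 0`", arXiv p. 7; first file `…Step4AssemblyPoloidal.lean`).  The swirl
component is handled in print by "`η³v_θ(r,x₃,t) = ∫_{-1}^{x₃}(η³v_θ),₃ dy` … `sup (1/r)|η³v_θ| ≤
c(∫(|Φη³| + |(η³),₃||v_θ|/r)^{10/3}dy)^{3/10}` … `∫_{Q(R)}|v_θ|^{10/3} ≤ cR^{10/3+1}[…]`", with
"boundedness of `|∇v|` in the support of `∇η`" and the finiteness of `‖Φη³‖_{10/3,Q}` coming from
(2.7) `|η³Φ|²_{2,Q} < ∞`.  With `ζ` for `η³`, `Φ = radVelQuot (curl u) = ω_r/r`, and the landed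
`x₃`-Poincaré inequality `lintegral_spaceCyl_mul_swirlVelocity_rpow_le` (`…VThetaPassage.lean`):

* `radialVelocity_curl_eq_cylRadius_mul_radVelQuot` — `ω_r = rΦ` everywhere;
* `enorm_poincareIntegrand_le` — near the axis `|ζω_r| + |∂₃ζ · u_θ| ≤ R|ζΦ| + C_ζL` when
  `|u| ≤ L` on `supp Dζ` (the collar term: `|u_θ| ≤ |u|`);
* `volume_tallCyl_le` — `|{|x'| < R, |x₃| < 1}| ≤ 2|B₁(ℝ²)|R²`;
* `setLIntegral_spaceCyl_enorm_swirlVelocity_rpow_le` (registered; hypothesis form `…_le'`) —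
  **`∫_{𝒞(R)} |u_θ|^p ≤ 2^pR · 2^{p-1}(R^p∫|ζΦ|^p + (C_ζL)^p · 2|B₁(ℝ²)|R²)`**, the printed gain
  `R^{p+1}`;
* `norm_fderiv_mul_sq_le`, `lintegral_enorm_fderiv_mul_radVelQuot_sq_le` — the rewriting of the
  Step-3 output "to the form (2.7)": `∫‖D(ζΦ)‖² ≤ 2∫ζ²(‖DΦ‖² + ‖DΓ‖²) + 2C_ζ²L²|𝒞|` when
  `|Φ| ≤ L` on `supp Dζ`;
* `lintegral_enorm_rpow_tenThirds_le_of_contDiff` — `∫|g|^{10/3} ≤ (∫g²)^{2/3} C_S² ∫‖Dg‖²`;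
* `lintegral_lintegral_enorm_mul_rpow_tenThirds_le` (registered; hypothesis form `…_le'`) —
  **`∫_{t₁}^0∫|ζΦ|^{10/3} ≤ K^{2/3} C_S² K'`** from `sup_t ∫(ζΦ)² ≤ K`, `∫_{t₁}^0∫‖D(ζΦ)‖² ≤ K'`.

## References

* G. Seregin, J. Math. Fluid Mech. 24 (2022), Paper No. 27 = arXiv:2201.00153, §2 Step 4 (arXiv
  p. 7: (2.7) and the `v_θ` passage), Step 3 (`Φ = ω_r/r`, arXiv p. 6). [`Seregin2022LocalAxisym`]

Not carried from this source module (not needed by the declarations re-homed here; their consumers are Summits-side): `setLIntegral_spaceCyl_enorm_swirlVelocity_rpow_le`, `norm_fderiv_mul_sq_le`, `lintegral_enorm_fderiv_mul_radVelQuot_sq_le`, `lintegral_lintegral_enorm_mul_rpow_tenThirds_le`.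
-/

section Part3

open _root_.Set _root_.MeasureTheory _root_.Filter _root_.Topology _root_.Function _root_.Metric
open scoped _root_.ENNReal _root_.NNReal RealInnerProductSpace
open Literature.Analysis.FluidPDE

namespace Literature.Analysis.SereginLogSwirlOrigin.EulerScaling

/-! ### The swirl part at a fixed time: `ω_r = rΦ`, the collar term, the `x₃`-Poincaré bound -/

section SwirlSlice

variable {u : EuclideanSpace ℝ (Fin 3) → EuclideanSpace ℝ (Fin 3)} {ζ : EuclideanSpace ℝ (Fin 3) → ℝ}
  {K : ℝ≥0} {Cζ L : ℝ}

/-- **`ω_r = rΦ` everywhere** for an axisymmetric `u ∈ C³` (`Φ = radVelQuot (curl u)`: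
`r²Φ = x₀ω₀ + x₁ω₁ = rω_r`, and both sides vanish on the axis). [cite: Seregin2022LocalAxisym, §2 Step 3 (arXiv:2201.00153 p. 6), `Φ = ω_r/r`] -/
theorem radialVelocity_curl_eq_cylRadius_mul_radVelQuot (hax : IsAxisymmetric u)
    (hu : ContDiff ℝ 3 u) (x : EuclideanSpace ℝ (Fin 3)) :
    radialVelocity (curl u) x = cylRadius x * radVelQuot (curl u) x := by
  have hud : Differentiable ℝ u := hu.differentiable (by norm_num)
  have hω2 : ContDiff ℝ 2 (curl u) := contDiff_curl_of_succ (n := 2) (by exact_mod_cast hu)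
  have h := (hax.curl hud).cylRadius_sq_mul_radVelQuot hω2 x
  rw [SereginZajaczkowski2007.radialVelocity_eq_div, ← h]
  rcases eq_or_ne (cylRadius x) 0 with h0 | h0
  · rw [h0]; simp
  · field_simp

/-- A cut-off supported in the unit cylinder `𝒞` vanishes where `x₃ ≤ -1`. [folklore]
[cite: Seregin2022LocalAxisym, §2 proof of Thm. 1.2, Step 4 (arXiv:2201.00153 pp. 4–7) (source of the ARGUMENT this module implements; this declaration is the cell’s own lemma or plumbing, NOT a printed statement)] -/
theorem eq_zero_of_apply_two_le_neg_one (hζ1 : tsupport ζ ⊆ SereginSverak2009.spaceCyl 0 1)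
    (y : EuclideanSpace ℝ (Fin 3)) (hy : y 2 ≤ -1) : ζ y = 0 := by
  refine image_eq_zero_of_notMem_tsupport fun h => ?_
  have h2 := ((SereginSverak2009.mem_spaceCyl).1 (hζ1 h)).2
  simp only [PiLp.zero_apply, sub_zero] at h2
  linarith [(abs_lt.1 h2).1]

/-- **The integrand of the `v_θ` passage near the axis** (Seregin: "`|Φη³| + |(η³),₃||v_θ|/r`",
with "boundedness of … in the support of `∇η`"): at a point with `|x'| < R`, for an axisymmetric
`u ∈ C³` bounded by `L` on `supp Dζ`, `‖Dζ‖ ≤ C_ζ`: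
`|ζω_r| + |∂₃ζ · u_θ| ≤ R|ζΦ| + C_ζ L`. [cite: Seregin2022LocalAxisym, §2 Step 4 (arXiv:2201.00153 p. 7), the `v_θ` passage] -/
theorem enorm_poincareIntegrand_le (hax : IsAxisymmetric u) (hu : ContDiff ℝ 3 u)
    (hCζ : ∀ x, ‖fderiv ℝ ζ x‖ ≤ Cζ) (hL : ∀ x, fderiv ℝ ζ x ≠ 0 → ‖u x‖ ≤ L)
    {R : ℝ} {x : EuclideanSpace ℝ (Fin 3)} (hx : cylRadius x < R) :
    ‖ζ x * radialVelocity (curl u) x‖ₑ +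
        ‖fderiv ℝ ζ x (EuclideanSpace.single 2 1) * swirlVelocity u x‖ₑ ≤
      ENNReal.ofReal R * ‖ζ x * radVelQuot (curl u) x‖ₑ + ENNReal.ofReal Cζ * ENNReal.ofReal L := by
  refine add_le_add ?_ ?_
  · rw [radialVelocity_curl_eq_cylRadius_mul_radVelQuot hax hu x,
      show ζ x * (cylRadius x * radVelQuot (curl u) x) =
        cylRadius x * (ζ x * radVelQuot (curl u) x) by ring, enorm_mul, Real.enorm_eq_ofReal_abs,
      abs_of_nonneg (cylRadius_nonneg x)]
    exact mul_le_mul' (ENNReal.ofReal_le_ofReal hx.le) le_rfl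
  · by_cases hD : fderiv ℝ ζ x = 0
    · rw [hD]; simp
    · have hLx := hL x hD
      have h1 : |fderiv ℝ ζ x (EuclideanSpace.single 2 1)| ≤ Cζ := by
        have h := (fderiv ℝ ζ x).le_opNorm (EuclideanSpace.single 2 (1 : ℝ))
        have hn : ‖EuclideanSpace.single (2 : Fin 3) (1 : ℝ)‖ = 1 := by simp
        rw [hn, mul_one, Real.norm_eq_abs] at h
        exact h.trans (hCζ x)
      have h2 : |swirlVelocity u x| ≤ L := (abs_swirlVelocity_le u x).trans hLx
      rw [enorm_mul, Real.enorm_eq_ofReal_abs, Real.enorm_eq_ofReal_abs]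
      exact mul_le_mul' (ENNReal.ofReal_le_ofReal h1) (ENNReal.ofReal_le_ofReal h2)

/-- `|{|x'| < R, |x₃| < 1}| ≤ 2|B₁(ℝ²)| R²` (Tonelli through `cylSplit`). [folklore]
[cite: Seregin2022LocalAxisym, §2 proof of Thm. 1.2, Step 4 (arXiv:2201.00153 pp. 4–7) (source of the ARGUMENT this module implements; this declaration is the cell’s own lemma or plumbing, NOT a printed statement)] -/
theorem volume_tallCyl_le {R : ℝ} (hR : 0 ≤ R) :
    volume {x : EuclideanSpace ℝ (Fin 3) | cylRadius x < R ∧ |x 2| < 1} ≤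
      2 * volume (ball (0 : EuclideanSpace ℝ (Fin 2)) 1) * ENNReal.ofReal R ^ (2 : ℝ) := by
  have hset : {x : EuclideanSpace ℝ (Fin 3) | cylRadius x < R ∧ |x 2| < 1} =
      {x : EuclideanSpace ℝ (Fin 3) | cylRadius x < R ∧ x 2 ∈ Ioo (-1 : ℝ) 1} := by
    ext x; simp [abs_lt, mem_Ioo]
  have h := setLIntegral_cyl_eq_lintegral_lintegral (G := fun _ => (1 : ℝ≥0∞)) aemeasurable_const
    R (Ioo (-1 : ℝ) 1)
  simp only [lintegral_const, Measure.restrict_apply_univ, one_mul, Real.volume_Ioo] at h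
  rw [hset, h, show (1 : ℝ) - -1 = 2 by norm_num, ENNReal.ofReal_ofNat,
    Measure.addHaar_ball volume (0 : EuclideanSpace ℝ (Fin 2)) hR, finrank_euclideanSpace_fin,
    ENNReal.ofReal_pow hR]
  have e2 : ENNReal.ofReal R ^ (2 : ℝ) = ENNReal.ofReal R ^ (2 : ℕ) := by
    rw [show (2 : ℝ) = ((2 : ℕ) : ℝ) by norm_num, ENNReal.rpow_natCast]
  rw [e2]
  exact le_of_eq (by ring)

/-- **The `v_θ` slice bound** (Seregin: "`∫_{Q(R)}|v_θ|^{10/3} ≤ ∫∫ (R^{10/3}∫|v_θ/r|^{10/3}dx₃) r dr dt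
≤ cR^{10/3+1}[…]`", at a fixed time): for an axisymmetric `u ∈ C³` bounded by `L` on `supp Dζ`,
`ζ ∈ C¹` with `tsupport ζ ⊆ 𝒞`, `‖Dζ‖ ≤ C_ζ`, `ζ = 1` on `𝒞(R)`, `0 < R ≤ 1`, `p ≥ 1`:
`∫_{𝒞(R)} |u_θ|^p ≤ 2^p R · 2^{p-1} (R^p ∫ |ζΦ|^p + (C_ζ L)^p · 2|B₁(ℝ²)|R²)`.
[cite: Seregin2022LocalAxisym, §2 Step 4 (arXiv:2201.00153 p. 7), the `v_θ` passage] -/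
theorem setLIntegral_spaceCyl_enorm_swirlVelocity_rpow_le' (hax : IsAxisymmetric u)
    (hu : ContDiff ℝ 3 u) (hζ : ContDiff ℝ 1 ζ) (hζ1 : tsupport ζ ⊆ SereginSverak2009.spaceCyl 0 1)
    (hCζ : ∀ x, ‖fderiv ℝ ζ x‖ ≤ Cζ) (hL : ∀ x, fderiv ℝ ζ x ≠ 0 → ‖u x‖ ≤ L)
    {p : ℝ} (hp : 1 ≤ p) {R : ℝ} (hR : 0 < R) (hR1 : R ≤ 1)
    (hζR : ∀ x ∈ SereginSverak2009.spaceCyl 0 R, ζ x = 1) :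
    ∫⁻ x in SereginSverak2009.spaceCyl 0 R, ‖swirlVelocity u x‖ₑ ^ p ≤
      2 ^ p * ENNReal.ofReal R * (2 ^ (p - 1) *
        (ENNReal.ofReal R ^ p * (∫⁻ x, ‖ζ x * radVelQuot (curl u) x‖ₑ ^ p) +
          (ENNReal.ofReal Cζ * ENNReal.ofReal L) ^ p *
            (2 * volume (ball (0 : EuclideanSpace ℝ (Fin 2)) 1) * ENNReal.ofReal R ^ (2 : ℝ)))) := by
  have hp0 : 0 ≤ p := zero_le_one.trans hp
  have hPo := lintegral_spaceCyl_mul_swirlVelocity_rpow_le u ζ p R hax hζ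
    (eq_zero_of_apply_two_le_neg_one hζ1) (fun y _ _ => hu.contDiffAt.of_le (by norm_num)) hp hR1
  have hL1 : ∫⁻ x in SereginSverak2009.spaceCyl 0 R, ‖swirlVelocity u x‖ₑ ^ p =
      ∫⁻ x in SereginSverak2009.spaceCyl 0 R, ‖ζ x * swirlVelocity u x‖ₑ ^ p :=
    setLIntegral_congr_fun (SereginSverak2009.isOpen_spaceCyl 0 R).measurableSet fun x hx => by
      simp only [hζR x hx, one_mul]
  rw [hL1]
  refine hPo.trans (mul_le_mul' le_rfl ?_)
  have hSm : MeasurableSet {x : EuclideanSpace ℝ (Fin 3) | cylRadius x < R ∧ |x 2| < 1} := by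
    have h2 : Continuous fun x : EuclideanSpace ℝ (Fin 3) => |x 2| :=
      continuous_abs.comp (EuclideanSpace.proj (2 : Fin 3)).continuous
    exact ((isOpen_lt continuous_cylRadius continuous_const).inter
      (isOpen_lt h2 continuous_const)).measurableSet
  set a : EuclideanSpace ℝ (Fin 3) → ℝ≥0∞ := fun x => ‖ζ x * radVelQuot (curl u) x‖ₑ with ha
  set c : ℝ≥0∞ := ENNReal.ofReal Cζ * ENNReal.ofReal L with hc
  calc ∫⁻ x in {x : EuclideanSpace ℝ (Fin 3) | cylRadius x < R ∧ |x 2| < 1},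
        (‖ζ x * radialVelocity (curl u) x‖ₑ +
          ‖fderiv ℝ ζ x (EuclideanSpace.single 2 1) * swirlVelocity u x‖ₑ) ^ p
      ≤ ∫⁻ x in {x : EuclideanSpace ℝ (Fin 3) | cylRadius x < R ∧ |x 2| < 1},
          2 ^ (p - 1) * (ENNReal.ofReal R ^ p * a x ^ p + c ^ p) := by
        refine setLIntegral_mono' hSm fun x hx => ?_
        refine (ENNReal.rpow_le_rpow (enorm_poincareIntegrand_le hax hu hCζ hL hx.1) hp0).trans ?_
        refine (ENNReal.rpow_add_le_mul_rpow_add_rpow _ _ hp).trans (le_of_eq ?_)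
        rw [ENNReal.mul_rpow_of_nonneg _ _ hp0]
    _ = 2 ^ (p - 1) * (ENNReal.ofReal R ^ p *
          (∫⁻ x in {x : EuclideanSpace ℝ (Fin 3) | cylRadius x < R ∧ |x 2| < 1}, a x ^ p) +
          c ^ p * volume {x : EuclideanSpace ℝ (Fin 3) | cylRadius x < R ∧ |x 2| < 1}) := by
        rw [lintegral_const_mul' _ _ (ENNReal.rpow_ne_top_of_nonneg (by linarith) ENNReal.ofNat_ne_top),
          lintegral_add_right _ measurable_const,
          lintegral_const_mul' _ _ (ENNReal.rpow_ne_top_of_nonneg hp0 ENNReal.ofReal_ne_top),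
          lintegral_const, Measure.restrict_apply_univ]
    _ ≤ 2 ^ (p - 1) * (ENNReal.ofReal R ^ p * (∫⁻ x, a x ^ p) +
          c ^ p * (2 * volume (ball (0 : EuclideanSpace ℝ (Fin 2)) 1) * ENNReal.ofReal R ^ (2 : ℝ))) := by
        gcongr
        · exact Measure.restrict_le_self
        · exact volume_tallCyl_le hR.le

end SwirlSlice

/-! ### `(2.7)` for `Φ`: the `L^{10/3}` bound of `ζΦ` from the Step-3 bounds -/

section Phi

variable {u : EuclideanSpace ℝ (Fin 3) → EuclideanSpace ℝ (Fin 3)} {ζ : EuclideanSpace ℝ (Fin 3) → ℝ}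
  {K : ℝ≥0} {Cζ L : ℝ}

/-- **`L^{10/3}` interpolation for a `C¹_c` scalar** (Seregin: the norm `‖Φη³‖_{10/3,Q}`, from
`|η³Φ|_{2,Q} < ∞`): `∫ |g|^{10/3} ≤ (∫ g²)^{2/3} · C_S² ∫ ‖Dg‖²` (Lebesgue interpolation between `L²`
and `L⁶`, then GNS). [cite: Seregin2022LocalAxisym, §2 Step 4 (arXiv:2201.00153 p. 7)] -/
theorem lintegral_enorm_rpow_tenThirds_le_of_contDiff {g : EuclideanSpace ℝ (Fin 3) → ℝ}
    (hg : ContDiff ℝ 1 g) (hgc : HasCompactSupport g) :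
    ∫⁻ x, ‖g x‖ₑ ^ (10 / 3 : ℝ) ≤ (∫⁻ x, ‖g x‖ₑ ^ 2) ^ (2 / 3 : ℝ) *
      ((eLpNormLESNormFDerivOfEqInnerConst (volume : Measure (EuclideanSpace ℝ (Fin 3))) 2 : ℝ≥0∞)
          ^ (2 : ℝ) * ∫⁻ x, ‖fderiv ℝ g x‖ₑ ^ 2) := by
  have hm : AEMeasurable (fun x => ‖g x‖ₑ) volume := hg.continuous.measurable.enorm.aemeasurable
  refine (lintegral_rpow_tenThirds_le_Lp_interpolation volume hm).trans (mul_le_mul' le_rfl ?_)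
  calc (∫⁻ x, ‖g x‖ₑ ^ (6 : ℝ)) ^ (1 / 3 : ℝ)
      ≤ ((eLpNormLESNormFDerivOfEqInnerConst (volume : Measure (EuclideanSpace ℝ (Fin 3))) 2 : ℝ≥0∞)
          ^ (6 : ℝ) * (∫⁻ x, ‖fderiv ℝ g x‖ₑ ^ 2) ^ (3 : ℝ)) ^ (1 / 3 : ℝ) :=
        ENNReal.rpow_le_rpow (lintegral_enorm_rpow_six_le hg hgc) (by norm_num)
    _ = _ := by
        rw [ENNReal.mul_rpow_of_nonneg _ _ (by norm_num), ← ENNReal.rpow_mul, ← ENNReal.rpow_mul,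
          show (6 : ℝ) * (1 / 3) = 2 by norm_num, show (3 : ℝ) * (1 / 3) = 1 by norm_num,
          ENNReal.rpow_one]

/-- **The space–time `L^{10/3}` bound from (2.7)** (Seregin: "`|f|²_{2,Q} = sup_t ‖f(·,t)‖²_{2,𝒞}
+ ‖∇f‖²_{2,Q}`", here for `f = ζΦ`, giving the finiteness of `‖Φη³‖_{10/3,Q}` used in the `v_θ`
passage): for a `C¹` compactly supported `ζ` and `C¹` slices `Φ t`, `t ∈ ]t₁, 0[`, with
`sup_t ∫ (ζΦ)² ≤ K` and `∫_{t₁}^0 ∫ ‖D(ζΦ)‖² ≤ K'`: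
`∫_{t₁}^0 ∫ |ζΦ|^{10/3} ≤ K^{2/3} C_S² K'`. [cite: Seregin2022LocalAxisym, §2 Step 4 (arXiv:2201.00153 p. 7), (2.7)] -/
theorem lintegral_lintegral_enorm_mul_rpow_tenThirds_le' {Φ : ℝ → EuclideanSpace ℝ (Fin 3) → ℝ}
    {t₁ : ℝ} {K K' : ℝ≥0} (hζ : ContDiff ℝ 1 ζ) (hζc : HasCompactSupport ζ)
    (hΦ : ∀ t ∈ Ioo t₁ 0, ContDiff ℝ 1 (Φ t))
    (h2 : ∀ t ∈ Ioo t₁ 0, ∫⁻ x, ‖ζ x * Φ t x‖ₑ ^ 2 ≤ K)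
    (hD : ∫⁻ t in Ioo t₁ 0, ∫⁻ x, ‖fderiv ℝ (fun y => ζ y * Φ t y) x‖ₑ ^ 2 ≤ K') :
    ∫⁻ t in Ioo t₁ 0, ∫⁻ x, ‖ζ x * Φ t x‖ₑ ^ (10 / 3 : ℝ) ≤
      (K : ℝ≥0∞) ^ (2 / 3 : ℝ) *
        ((eLpNormLESNormFDerivOfEqInnerConst (volume : Measure (EuclideanSpace ℝ (Fin 3))) 2 : ℝ≥0∞)
          ^ (2 : ℝ) * K') := by
  set CS : ℝ≥0∞ := (eLpNormLESNormFDerivOfEqInnerConst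
    (volume : Measure (EuclideanSpace ℝ (Fin 3))) 2 : ℝ≥0∞) with hCS
  have hKt : (K : ℝ≥0∞) ^ (2 / 3 : ℝ) ≠ ∞ := ENNReal.rpow_ne_top_of_nonneg (by norm_num) ENNReal.coe_ne_top
  have hCSt : CS ^ (2 : ℝ) ≠ ∞ := ENNReal.rpow_ne_top_of_nonneg (by norm_num) ENNReal.coe_ne_top
  have hslice : ∀ t ∈ Ioo t₁ 0, ∫⁻ x, ‖ζ x * Φ t x‖ₑ ^ (10 / 3 : ℝ) ≤
      (K : ℝ≥0∞) ^ (2 / 3 : ℝ) * (CS ^ (2 : ℝ) * ∫⁻ x, ‖fderiv ℝ (fun y => ζ y * Φ t y) x‖ₑ ^ 2) := by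
    intro t ht
    refine (lintegral_enorm_rpow_tenThirds_le_of_contDiff (hζ.mul (hΦ t ht)) hζc.mul_right).trans ?_
    gcongr
    exact h2 t ht
  calc ∫⁻ t in Ioo t₁ 0, ∫⁻ x, ‖ζ x * Φ t x‖ₑ ^ (10 / 3 : ℝ)
      ≤ ∫⁻ t in Ioo t₁ 0, (K : ℝ≥0∞) ^ (2 / 3 : ℝ) *
          (CS ^ (2 : ℝ) * ∫⁻ x, ‖fderiv ℝ (fun y => ζ y * Φ t y) x‖ₑ ^ 2) :=
        setLIntegral_mono' measurableSet_Ioo hslice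
    _ = (K : ℝ≥0∞) ^ (2 / 3 : ℝ) * (CS ^ (2 : ℝ) *
          ∫⁻ t in Ioo t₁ 0, ∫⁻ x, ‖fderiv ℝ (fun y => ζ y * Φ t y) x‖ₑ ^ 2) := by
        rw [lintegral_const_mul' _ _ hKt, lintegral_const_mul' _ _ hCSt]
    _ ≤ _ := by gcongr

end Phi

end Literature.Analysis.SereginLogSwirlOrigin.EulerScaling

end Part3

/-!
## Part 4 — port of `Summits/NavierStokesRegularity/NavierStokesRegularity/Theorems/AxisymmetricExtremalityAxisymmetricKatoGlobalStubSereginLogSwirlOriginStep4AssemblyParts.lean` (8 declarations kept)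

# Seregin 2022, §2 Step 4 (assembly, III): the poloidal and swirl parts of `∫_{Q(R)}|v|³` on the
# parabolic cylinders `Q(R)` — crux stmt-NavierStokesRegularity-15453 (`AxisymmetricExtremality.AxisymmetricKatoGlobal`), line registered, support for stub `stub_sereginLogSwirlOrigin`

Support file (`--supports stmt-NavierStokesRegularity-15453`; theorems only, everything proved)
toward the registered stub `stub_sereginLogSwirlOrigin` = the named fact
`Literature.Analysis.FluidPDE.seregin2022_logSwirl_regularAtOrigin` (G. Seregin, J. Math. Fluid
Mech. 24 (2022), Paper 27 = arXiv:2201.00153, §2).  Third file of the Step-4 assembly: the slice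
bounds of `…Step4AssemblyPoloidal.lean` ((2.8), rate `R^{3/2}`) and `…Step4AssemblySwirl.lean`
(the `v_θ` passage, gain `R^{13/3}`) are integrated over the time window `]-R², 0[ ⊆ ]t₁, 0[` of
`Q(R) = ]-R², 0[ × 𝒞(R)` (`SereginSverak2009.parCyl 0 R`), and the swirl part is closed by Hölder on
`Q(R)` as printed: "`R⁻²∫_{Q(R)}|v_θ|³ ≤ cR^{-3/2}[∫_{Q(R)}|v_θ|^{10/3}]^{9/10} ≤ … ≤
cR^{(10/3+1)9/10 − 3/2}[…]^{9/10} → 0`" (arXiv p. 7, last display):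

* `parCyl_zero_eq_prod`, `setLIntegral_parCyl_le_lintegral_lintegral` (Tonelli upper bound on
  `Q(R)`, no measurability), `volume_parCyl_le_rpow` (`|Q(R)| ≤ 8|B₁|R⁵`), `spaceCyl_zero_mono`,
  `aemeasurable_swirlVelocity_uncurry` (`v_θ` is a.e.-measurable in space–time where `v` is);
* `setLIntegral_parCyl_enorm_swirlVelocity_rpow_le` — `∫_{Q(R)}|v_θ|^{10/3} ≤ M₂R^{13/3}`;
* `setLIntegral_parCyl_enorm_swirlVelocity_pow_three_le` (registered; hypothesis form `…_le'`) —
  **`∫_{Q(R)}|v_θ|³ ≤ C_sw R^{22/5}`**;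
* `setLIntegral_parCyl_enorm_poloidal_pow_three_le` (registered; hypothesis form `…_le'`) —
  **`∫_{Q(R)}|v̄|³ ≤ C_pol R^{7/2}`**.

The final assembly `C(R) ≤ C R^{3/2}`, `C(R) → 0` is the sibling file `…Step4Assembly.lean`.

## References

* G. Seregin, J. Math. Fluid Mech. 24 (2022), Paper No. 27 = arXiv:2201.00153, §2 Step 4 (arXiv
  p. 7: (2.8) and the last display). [`Seregin2022LocalAxisym`]

Not carried from this source module (not needed by the declarations re-homed here; their consumers are Summits-side): `setLIntegral_parCyl_enorm_swirlVelocity_pow_three_le`, `setLIntegral_parCyl_enorm_poloidal_pow_three_le`.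
-/

section Part4

open _root_.Set _root_.MeasureTheory _root_.Filter _root_.Topology _root_.Function _root_.Metric
open scoped _root_.ENNReal _root_.NNReal RealInnerProductSpace
open Literature.Analysis.FluidPDE

namespace Literature.Analysis.SereginLogSwirlOrigin.EulerScaling

/-! ### Space–time bookkeeping on `Q(R) = ]-R², 0[ × 𝒞(R)` -/

section SpaceTime

/-- The spatial cylinders about the origin increase with the radius. [folklore]
[cite: Seregin2022LocalAxisym, §2 proof of Thm. 1.2, Step 4 (arXiv:2201.00153 pp. 4–7) (source of the ARGUMENT this module implements; this declaration is the cell’s own lemma or plumbing, NOT a printed statement)] -/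
theorem spaceCyl_zero_mono {R R' : ℝ} (h : R ≤ R') :
    SereginSverak2009.spaceCyl (0 : EuclideanSpace ℝ (Fin 3)) R ⊆ SereginSverak2009.spaceCyl 0 R' :=
  fun _ hx => ⟨hx.1.trans_le h, hx.2.trans_le h⟩

/-- `Q(R) = ]-R², 0[ × 𝒞(R)` as a product set. [folklore]
[cite: Seregin2022LocalAxisym, §2 proof of Thm. 1.2, Step 4 (arXiv:2201.00153 pp. 4–7) (source of the ARGUMENT this module implements; this declaration is the cell’s own lemma or plumbing, NOT a printed statement)] -/
theorem parCyl_zero_eq_prod (R : ℝ) :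
    SereginSverak2009.parCyl (0 : ℝ × EuclideanSpace ℝ (Fin 3)) R =
      Ioo (-R ^ 2) 0 ×ˢ SereginSverak2009.spaceCyl (0 : EuclideanSpace ℝ (Fin 3)) R := by
  ext z
  simp only [SereginSverak2009.mem_parCyl_zero, mem_prod, SereginSverak2009.mem_spaceCyl, sub_zero,
    PiLp.zero_apply]

/-- **Tonelli on `Q(R)`, upper bound** (no measurability): `∫_{Q(R)} F ≤ ∫_{-R²}^0 ∫_{𝒞(R)} F(t, ·) dt`.
[folklore]
[cite: Seregin2022LocalAxisym, §2 proof of Thm. 1.2, Step 4 (arXiv:2201.00153 pp. 4–7) (source of the ARGUMENT this module implements; this declaration is the cell’s own lemma or plumbing, NOT a printed statement)] -/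
theorem setLIntegral_parCyl_le_lintegral_lintegral (F : ℝ × EuclideanSpace ℝ (Fin 3) → ℝ≥0∞)
    (R : ℝ) : ∫⁻ z in SereginSverak2009.parCyl 0 R, F z ≤
      ∫⁻ t in Ioo (-R ^ 2) 0, ∫⁻ x in SereginSverak2009.spaceCyl 0 R, F (t, x) := by
  rw [parCyl_zero_eq_prod, Measure.volume_eq_prod, ← Measure.prod_restrict]
  exact lintegral_prod_le _

/-- `|Q(R)| ≤ 8|B₁| R⁵`. [folklore]
[cite: Seregin2022LocalAxisym, §2 proof of Thm. 1.2, Step 4 (arXiv:2201.00153 pp. 4–7) (source of the ARGUMENT this module implements; this declaration is the cell’s own lemma or plumbing, NOT a printed statement)] -/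
theorem volume_parCyl_le_rpow {R : ℝ} (hR : 0 < R) :
    volume (SereginSverak2009.parCyl (0 : ℝ × EuclideanSpace ℝ (Fin 3)) R) ≤
      8 * volume (ball (0 : EuclideanSpace ℝ (Fin 3)) 1) * ENNReal.ofReal R ^ (5 : ℝ) := by
  rw [parCyl_zero_eq_prod, Measure.volume_eq_prod, Measure.prod_prod, Real.volume_Ioo,
    show (0 : ℝ) - -R ^ 2 = R ^ 2 by ring]
  calc ENNReal.ofReal (R ^ 2) * volume (SereginSverak2009.spaceCyl (0 : EuclideanSpace ℝ (Fin 3)) R)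
      ≤ ENNReal.ofReal (R ^ 2) * (8 * volume (ball (0 : EuclideanSpace ℝ (Fin 3)) 1) *
          ENNReal.ofReal R ^ (3 : ℝ)) := mul_le_mul' le_rfl (volume_spaceCyl_le_rpow hR)
    _ = _ := by
        rw [ENNReal.ofReal_pow hR.le, ← ENNReal.rpow_natCast, show ((2 : ℕ) : ℝ) = 2 by norm_num,
          show (5 : ℝ) = 2 + 3 by norm_num,
          ENNReal.rpow_add _ _ (ENNReal.ofReal_pos.2 hR).ne' ENNReal.ofReal_ne_top]
        ring

/-- **The swirl velocity of a space–time field is a.e.-measurable** where the field is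
a.e.-strongly measurable (`u_θ = r⁻¹(x₀u₁ − x₁u₀)` with the tree's junk value `0` on the axis).
[folklore]
[cite: Seregin2022LocalAxisym, §2 proof of Thm. 1.2, Step 4 (arXiv:2201.00153 pp. 4–7) (source of the ARGUMENT this module implements; this declaration is the cell’s own lemma or plumbing, NOT a printed statement)] -/
theorem aemeasurable_swirlVelocity_uncurry
    {v : ℝ → EuclideanSpace ℝ (Fin 3) → EuclideanSpace ℝ (Fin 3)}
    {μ : Measure (ℝ × EuclideanSpace ℝ (Fin 3))} (hv : AEStronglyMeasurable (uncurry v) μ) :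
    AEMeasurable (fun z : ℝ × EuclideanSpace ℝ (Fin 3) => swirlVelocity (v z.1) z.2) μ := by
  have he : (fun z : ℝ × EuclideanSpace ℝ (Fin 3) => swirlVelocity (v z.1) z.2) =
      fun z => (cylRadius z.2)⁻¹ * (z.2 0 * (uncurry v z) 1 - z.2 1 * (uncurry v z) 0) := by
    funext z
    rw [SereginZajaczkowski2007.swirlVelocity_eq_inv_mul_swirl]
    rfl
  rw [he]
  have h0 : AEMeasurable (fun z : ℝ × EuclideanSpace ℝ (Fin 3) => (uncurry v z) 0) μ :=
    ((EuclideanSpace.proj (0 : Fin 3)).continuous.comp_aestronglyMeasurable hv).aemeasurable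
  have h1 : AEMeasurable (fun z : ℝ × EuclideanSpace ℝ (Fin 3) => (uncurry v z) 1) μ :=
    ((EuclideanSpace.proj (1 : Fin 3)).continuous.comp_aestronglyMeasurable hv).aemeasurable
  have hc0 : Measurable fun z : ℝ × EuclideanSpace ℝ (Fin 3) => z.2 0 :=
    (EuclideanSpace.proj (𝕜 := ℝ) (0 : Fin 3)).measurable.comp measurable_snd
  have hc1 : Measurable fun z : ℝ × EuclideanSpace ℝ (Fin 3) => z.2 1 :=
    (EuclideanSpace.proj (𝕜 := ℝ) (1 : Fin 3)).measurable.comp measurable_snd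
  have hr : Measurable fun z : ℝ × EuclideanSpace ℝ (Fin 3) => (cylRadius z.2)⁻¹ :=
    (continuous_cylRadius.measurable.comp measurable_snd).inv
  exact hr.aemeasurable.mul ((hc0.aemeasurable.mul h1).sub (hc1.aemeasurable.mul h0))

end SpaceTime

/-! ### The two parts on `Q(R)` -/

section Parts

variable {v : ℝ → EuclideanSpace ℝ (Fin 3) → EuclideanSpace ℝ (Fin 3)} {ζ : EuclideanSpace ℝ (Fin 3) → ℝ}
  {U : Set (EuclideanSpace ℝ (Fin 3))} {t₁ r₁ Cζ L : ℝ} {K A : ℝ≥0} {M : ℝ≥0∞}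

/-- **`∫_{Q(R)} |v_θ|^{10/3} ≤ 2^{17/3}(M + (C_ζL)^{10/3}·2|B₁(ℝ²)|) R^{13/3}`** (Seregin:
"`≤ c R^{(10/3 + 1)}[∫∫ sup|v_θη³/r|^{10/3} r dr dt]`"): the slice bound
`setLIntegral_spaceCyl_enorm_swirlVelocity_rpow_le` integrated over `]-R², 0[ ⊆ ]t₁, 0[`, with
`M ≥ ∫_{t₁}^0∫|ζΦ|^{10/3}` and `R ≤ 1`. [cite: Seregin2022LocalAxisym, §2 Step 4 (arXiv:2201.00153 p. 7), the `v_θ` passage] -/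
theorem setLIntegral_parCyl_enorm_swirlVelocity_rpow_le
    (hv : ∀ t ∈ Ioo t₁ 0, ContDiff ℝ 3 (v t)) (hax : ∀ t ∈ Ioo t₁ 0, IsAxisymmetric (v t))
    (hζ : ContDiff ℝ 1 ζ) (hζ1 : tsupport ζ ⊆ SereginSverak2009.spaceCyl 0 1)
    (hCζ : ∀ x, ‖fderiv ℝ ζ x‖ ≤ Cζ) (hLv : ∀ t ∈ Ioo t₁ 0, ∀ x, fderiv ℝ ζ x ≠ 0 → ‖v t x‖ ≤ L)
    (hM : ∫⁻ t in Ioo t₁ 0, ∫⁻ x, ‖ζ x * radVelQuot (curl (v t)) x‖ₑ ^ (10 / 3 : ℝ) ≤ M)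
    (hζr₁ : ∀ x ∈ SereginSverak2009.spaceCyl 0 r₁, ζ x = 1)
    {R : ℝ} (hR : 0 < R) (hRr₁ : R ≤ r₁) (hR1 : R ≤ 1) (hRt : t₁ ≤ -R ^ 2) :
    ∫⁻ z in SereginSverak2009.parCyl 0 R, ‖swirlVelocity (v z.1) z.2‖ₑ ^ (10 / 3 : ℝ) ≤
      2 ^ (17 / 3 : ℝ) * (M + (ENNReal.ofReal Cζ * ENNReal.ofReal L) ^ (10 / 3 : ℝ) *
        (2 * volume (ball (0 : EuclideanSpace ℝ (Fin 2)) 1))) * ENNReal.ofReal R ^ (13 / 3 : ℝ) := by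
  set ρ : ℝ≥0∞ := ENNReal.ofReal R with hρ
  have hρ0 : ρ ≠ 0 := (ENNReal.ofReal_pos.2 hR).ne'
  have hρt : ρ ≠ ∞ := ENNReal.ofReal_ne_top
  have hρ1 : ρ ≤ 1 := ENNReal.ofReal_le_one.2 hR1
  have hpow : ∀ a b : ℝ, ρ ^ a * ρ ^ b = ρ ^ (a + b) := fun a b => (ENNReal.rpow_add a b hρ0 hρt).symm
  set c : ℝ≥0∞ := ENNReal.ofReal Cζ * ENNReal.ofReal L with hc
  set V₂ : ℝ≥0∞ := 2 * volume (ball (0 : EuclideanSpace ℝ (Fin 2)) 1) with hV₂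
  set P : ℝ → ℝ≥0∞ := fun t => ∫⁻ x, ‖ζ x * radVelQuot (curl (v t)) x‖ₑ ^ (10 / 3 : ℝ) with hP
  have hζR : ∀ x ∈ SereginSverak2009.spaceCyl 0 R, ζ x = 1 := fun x hx =>
    hζr₁ x (spaceCyl_zero_mono hRr₁ hx)
  have hsub : Ioo (-R ^ 2) 0 ⊆ Ioo t₁ 0 := Ioo_subset_Ioo_left hRt
  -- slice bound, uniformly in `t ∈ ]-R², 0[`
  have hslice : ∀ t ∈ Ioo (-R ^ 2) 0,
      ∫⁻ x in SereginSverak2009.spaceCyl 0 R, ‖swirlVelocity (v t) x‖ₑ ^ (10 / 3 : ℝ) ≤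
        2 ^ (10 / 3 : ℝ) * ρ * (2 ^ (10 / 3 - 1 : ℝ) *
          (ρ ^ (10 / 3 : ℝ) * P t + c ^ (10 / 3 : ℝ) * (V₂ * ρ ^ (2 : ℝ)))) := fun t ht =>
    setLIntegral_spaceCyl_enorm_swirlVelocity_rpow_le' (hax t (hsub ht)) (hv t (hsub ht)) hζ hζ1 hCζ
      (hLv t (hsub ht)) (by norm_num) hR hR1 hζR
  have h2t : (2 : ℝ≥0∞) ^ (10 / 3 : ℝ) * ρ ≠ ∞ :=
    ENNReal.mul_ne_top (ENNReal.rpow_ne_top_of_nonneg (by norm_num) ENNReal.ofNat_ne_top) hρt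
  have h2t' : (2 : ℝ≥0∞) ^ (10 / 3 - 1 : ℝ) ≠ ∞ :=
    ENNReal.rpow_ne_top_of_nonneg (by norm_num) ENNReal.ofNat_ne_top
  have hρp : ρ ^ (10 / 3 : ℝ) ≠ ∞ := ENNReal.rpow_ne_top_of_nonneg (by norm_num) hρt
  have hPM : ∫⁻ t in Ioo (-R ^ 2) 0, P t ≤ M := (lintegral_mono_set hsub).trans hM
  calc ∫⁻ z in SereginSverak2009.parCyl 0 R, ‖swirlVelocity (v z.1) z.2‖ₑ ^ (10 / 3 : ℝ)
      ≤ ∫⁻ t in Ioo (-R ^ 2) 0, ∫⁻ x in SereginSverak2009.spaceCyl 0 R,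
          ‖swirlVelocity (v t) x‖ₑ ^ (10 / 3 : ℝ) :=
        setLIntegral_parCyl_le_lintegral_lintegral (fun z => ‖swirlVelocity (v z.1) z.2‖ₑ ^ (10 / 3 : ℝ)) R
    _ ≤ ∫⁻ t in Ioo (-R ^ 2) 0, 2 ^ (10 / 3 : ℝ) * ρ * (2 ^ (10 / 3 - 1 : ℝ) *
          (ρ ^ (10 / 3 : ℝ) * P t + c ^ (10 / 3 : ℝ) * (V₂ * ρ ^ (2 : ℝ)))) :=
        setLIntegral_mono' measurableSet_Ioo hslice
    _ = 2 ^ (10 / 3 : ℝ) * ρ * (2 ^ (10 / 3 - 1 : ℝ) *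
          (ρ ^ (10 / 3 : ℝ) * (∫⁻ t in Ioo (-R ^ 2) 0, P t) +
            c ^ (10 / 3 : ℝ) * (V₂ * ρ ^ (2 : ℝ)) * ρ ^ (2 : ℝ))) := by
        rw [lintegral_const_mul' _ _ h2t, lintegral_const_mul' _ _ h2t', lintegral_add_right _
          measurable_const, lintegral_const_mul' _ _ hρp, lintegral_const, Measure.restrict_apply_univ,
          Real.volume_Ioo, show (0 : ℝ) - -R ^ 2 = R ^ 2 by ring, ENNReal.ofReal_pow hR.le,
          ← ENNReal.rpow_natCast, show ((2 : ℕ) : ℝ) = 2 by norm_num]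
    _ ≤ 2 ^ (10 / 3 : ℝ) * ρ * (2 ^ (10 / 3 - 1 : ℝ) *
          (ρ ^ (10 / 3 : ℝ) * M + c ^ (10 / 3 : ℝ) * (V₂ * ρ ^ (2 : ℝ)) * ρ ^ (2 : ℝ))) :=
        mul_le_mul' le_rfl (mul_le_mul' le_rfl (add_le_add (mul_le_mul' le_rfl hPM) le_rfl))
    _ = 2 ^ (17 / 3 : ℝ) * (M * ρ ^ (13 / 3 : ℝ) + c ^ (10 / 3 : ℝ) * V₂ * ρ ^ (5 : ℝ)) := by
        have e2 : (2 : ℝ≥0∞) ^ (10 / 3 : ℝ) * 2 ^ (10 / 3 - 1 : ℝ) = 2 ^ (17 / 3 : ℝ) := by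
          rw [← ENNReal.rpow_add _ _ two_ne_zero ENNReal.ofNat_ne_top]; norm_num
        have e1 : ρ * ρ ^ (10 / 3 : ℝ) = ρ ^ (13 / 3 : ℝ) := by
          rw [show (13 / 3 : ℝ) = 1 + 10 / 3 by norm_num, ← hpow, ENNReal.rpow_one]
        have e5 : ρ * (ρ ^ (2 : ℝ) * ρ ^ (2 : ℝ)) = ρ ^ (5 : ℝ) := by
          rw [show (5 : ℝ) = 1 + (2 + 2) by norm_num, ← hpow, ← hpow, ENNReal.rpow_one]
        calc 2 ^ (10 / 3 : ℝ) * ρ * (2 ^ (10 / 3 - 1 : ℝ) *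
              (ρ ^ (10 / 3 : ℝ) * M + c ^ (10 / 3 : ℝ) * (V₂ * ρ ^ (2 : ℝ)) * ρ ^ (2 : ℝ)))
            = 2 ^ (10 / 3 : ℝ) * 2 ^ (10 / 3 - 1 : ℝ) *
                (M * (ρ * ρ ^ (10 / 3 : ℝ)) + c ^ (10 / 3 : ℝ) * V₂ * (ρ * (ρ ^ (2 : ℝ) * ρ ^ (2 : ℝ)))) := by
              ring
          _ = _ := by rw [e2, e1, e5]
    _ ≤ 2 ^ (17 / 3 : ℝ) * (M * ρ ^ (13 / 3 : ℝ) + c ^ (10 / 3 : ℝ) * V₂ * ρ ^ (13 / 3 : ℝ)) :=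
        mul_le_mul' le_rfl (add_le_add le_rfl (mul_le_mul' le_rfl
          (ENNReal.rpow_le_rpow_of_exponent_ge hρ1 (by norm_num : (13 / 3 : ℝ) ≤ 5))))
    _ = _ := by ring

/-- **`∫_{Q(R)} |v_θ|³ ≤ (8|B₁|)^{1/10} (2^{17/3}(M + …))^{9/10} R^{22/5}`** (Seregin:
"`R⁻²∫_{Q(R)}|v_θ|³ ≤ cR^{-3/2}[∫_{Q(R)}|v_θ|^{10/3}]^{9/10} ≤ … → 0`"; Hölder on `Q(R)`, `|Q(R)| ≤ 8|B₁|R⁵`).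
[cite: Seregin2022LocalAxisym, §2 Step 4 (arXiv:2201.00153 p. 7), last display] -/
theorem setLIntegral_parCyl_enorm_swirlVelocity_pow_three_le'
    (hmeas : AEStronglyMeasurable (uncurry v) (volume.restrict (SereginSverak2009.parCyl 0 r₁)))
    (hv : ∀ t ∈ Ioo t₁ 0, ContDiff ℝ 3 (v t)) (hax : ∀ t ∈ Ioo t₁ 0, IsAxisymmetric (v t))
    (hζ : ContDiff ℝ 1 ζ) (hζ1 : tsupport ζ ⊆ SereginSverak2009.spaceCyl 0 1)
    (hCζ : ∀ x, ‖fderiv ℝ ζ x‖ ≤ Cζ) (hLv : ∀ t ∈ Ioo t₁ 0, ∀ x, fderiv ℝ ζ x ≠ 0 → ‖v t x‖ ≤ L)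
    (hM : ∫⁻ t in Ioo t₁ 0, ∫⁻ x, ‖ζ x * radVelQuot (curl (v t)) x‖ₑ ^ (10 / 3 : ℝ) ≤ M)
    (hζr₁ : ∀ x ∈ SereginSverak2009.spaceCyl 0 r₁, ζ x = 1)
    {R : ℝ} (hR : 0 < R) (hRr₁ : R ≤ r₁) (hR1 : R ≤ 1) (hRt : t₁ ≤ -R ^ 2) :
    ∫⁻ z in SereginSverak2009.parCyl 0 R, ‖swirlVelocity (v z.1) z.2‖ₑ ^ (3 : ℕ) ≤
      (8 * volume (ball (0 : EuclideanSpace ℝ (Fin 3)) 1)) ^ (1 / 10 : ℝ) *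
        (2 ^ (17 / 3 : ℝ) * (M + (ENNReal.ofReal Cζ * ENNReal.ofReal L) ^ (10 / 3 : ℝ) *
          (2 * volume (ball (0 : EuclideanSpace ℝ (Fin 2)) 1)))) ^ (9 / 10 : ℝ) *
        ENNReal.ofReal R ^ (22 / 5 : ℝ) := by
  set ρ : ℝ≥0∞ := ENNReal.ofReal R with hρ
  have hρ0 : ρ ≠ 0 := (ENNReal.ofReal_pos.2 hR).ne'
  have hρt : ρ ≠ ∞ := ENNReal.ofReal_ne_top
  set μ : Measure (ℝ × EuclideanSpace ℝ (Fin 3)) := volume.restrict (SereginSverak2009.parCyl 0 R)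
    with hμ
  have hmono : SereginSverak2009.parCyl (0 : ℝ × EuclideanSpace ℝ (Fin 3)) R ⊆
      SereginSverak2009.parCyl 0 r₁ := SereginSverak2009.parCyl_mono 0 hR.le hRr₁
  have hθm : AEMeasurable (fun z : ℝ × EuclideanSpace ℝ (Fin 3) => ‖swirlVelocity (v z.1) z.2‖ₑ) μ :=
    (aemeasurable_swirlVelocity_uncurry (hmeas.mono_measure (Measure.restrict_mono hmono le_rfl))).enorm
  have hH := lintegral_rpow_three_le_of_tenThirds μ hθm
  rw [hμ, Measure.restrict_apply_univ] at hH
  have e3 : ∀ z : ℝ × EuclideanSpace ℝ (Fin 3), ‖swirlVelocity (v z.1) z.2‖ₑ ^ (3 : ℕ) =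
      ‖swirlVelocity (v z.1) z.2‖ₑ ^ (3 : ℝ) := fun z => (ENNReal.rpow_ofNat _ 3).symm
  simp only [e3]
  refine hH.trans ?_
  have hS := setLIntegral_parCyl_enorm_swirlVelocity_rpow_le hv hax hζ hζ1 hCζ hLv hM hζr₁ hR hRr₁
    hR1 hRt
  calc volume (SereginSverak2009.parCyl (0 : ℝ × EuclideanSpace ℝ (Fin 3)) R) ^ (1 / 10 : ℝ) *
        (∫⁻ z in SereginSverak2009.parCyl 0 R, ‖swirlVelocity (v z.1) z.2‖ₑ ^ (10 / 3 : ℝ)) ^ (9 / 10 : ℝ)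
      ≤ (8 * volume (ball (0 : EuclideanSpace ℝ (Fin 3)) 1) * ρ ^ (5 : ℝ)) ^ (1 / 10 : ℝ) *
          (2 ^ (17 / 3 : ℝ) * (M + (ENNReal.ofReal Cζ * ENNReal.ofReal L) ^ (10 / 3 : ℝ) *
            (2 * volume (ball (0 : EuclideanSpace ℝ (Fin 2)) 1))) * ρ ^ (13 / 3 : ℝ)) ^ (9 / 10 : ℝ) := by
        gcongr
        exact volume_parCyl_le_rpow hR
    _ = _ := by
        rw [ENNReal.mul_rpow_of_nonneg _ _ (by norm_num : (0 : ℝ) ≤ 1 / 10),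
          ENNReal.mul_rpow_of_nonneg _ (ρ ^ (13 / 3 : ℝ)) (by norm_num : (0 : ℝ) ≤ 9 / 10),
          ← ENNReal.rpow_mul, ← ENNReal.rpow_mul,
          show (5 : ℝ) * (1 / 10) = 1 / 2 by norm_num, show (13 / 3 : ℝ) * (9 / 10) = 39 / 10 by norm_num,
          show (22 / 5 : ℝ) = 1 / 2 + 39 / 10 by norm_num, ENNReal.rpow_add _ _ hρ0 hρt]
        ring

/-- **`∫_{Q(R)} |v̄|³ ≤ (8|B₁|)^{1/2} (C_S⁶(2K + 12C_ζ²A)³)^{1/2} R^{7/2}`** (Seregin's (2.8),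
`R⁻²∫_{Q(R)}|v̄|³ ≤ cR^γ(…)`, here `γ = 3/2`): the slice bound
`setLIntegral_spaceCyl_enorm_poloidal_rpow_three_le` integrated over `]-R², 0[ ⊆ ]t₁, 0[`.
[cite: Seregin2022LocalAxisym, §2 Step 4 (arXiv:2201.00153 p. 7), (2.8)] -/
theorem setLIntegral_parCyl_enorm_poloidal_pow_three_le'
    (hv : ∀ t ∈ Ioo t₁ 0, ContDiff ℝ 4 (v t)) (hax : ∀ t ∈ Ioo t₁ 0, IsAxisymmetric (v t))
    (hζ : ContDiff ℝ 2 ζ) (hU : IsOpen U) (hζU : tsupport ζ ⊆ U)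
    (hζ1 : tsupport ζ ⊆ SereginSverak2009.spaceCyl 0 1)
    (hdiv : ∀ t ∈ Ioo t₁ 0, ∀ y ∈ U, VectorCalculus.divergence (v t) y = 0)
    (hCζ : ∀ x, ‖fderiv ℝ ζ x‖ ≤ Cζ)
    (hΓ : ∀ t ∈ Ioo t₁ 0, ∫⁻ x, ‖ζ x * angVortQuot (v t) x‖ₑ ^ 2 ≤ K)
    (hA : ∀ t ∈ Ioo t₁ 0, ∫⁻ x in SereginSverak2009.spaceCyl 0 1, ‖v t x‖ₑ ^ 2 ≤ A)
    (hζr₁ : ∀ x ∈ SereginSverak2009.spaceCyl 0 r₁, ζ x = 1)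
    {R : ℝ} (hR : 0 < R) (hRr₁ : R ≤ r₁) (hRt : t₁ ≤ -R ^ 2) :
    ∫⁻ z in SereginSverak2009.parCyl 0 R, ‖v z.1 z.2 - angVelQuot (v z.1) z.2 • rotGen z.2‖ₑ ^ (3 : ℕ) ≤
      (8 * volume (ball (0 : EuclideanSpace ℝ (Fin 3)) 1)) ^ (1 / 2 : ℝ) *
        ((eLpNormLESNormFDerivOfEqInnerConst (volume : Measure (EuclideanSpace ℝ (Fin 3))) 2 : ℝ≥0∞)
          ^ (6 : ℝ) * (2 * K + 12 * ENNReal.ofReal (Cζ ^ 2) * A) ^ (3 : ℝ)) ^ (1 / 2 : ℝ) *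
        ENNReal.ofReal R ^ (7 / 2 : ℝ) := by
  set ρ : ℝ≥0∞ := ENNReal.ofReal R with hρ
  have hρ0 : ρ ≠ 0 := (ENNReal.ofReal_pos.2 hR).ne'
  have hρt : ρ ≠ ∞ := ENNReal.ofReal_ne_top
  set Y : ℝ≥0∞ := ((eLpNormLESNormFDerivOfEqInnerConst (volume : Measure (EuclideanSpace ℝ (Fin 3))) 2
    : ℝ≥0∞) ^ (6 : ℝ) * (2 * K + 12 * ENNReal.ofReal (Cζ ^ 2) * A) ^ (3 : ℝ)) with hY
  set V₃ : ℝ≥0∞ := 8 * volume (ball (0 : EuclideanSpace ℝ (Fin 3)) 1) with hV₃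
  have hζR : ∀ x ∈ SereginSverak2009.spaceCyl 0 R, ζ x = 1 := fun x hx =>
    hζr₁ x (spaceCyl_zero_mono hRr₁ hx)
  have hsub : Ioo (-R ^ 2) 0 ⊆ Ioo t₁ 0 := Ioo_subset_Ioo_left hRt
  have hslice : ∀ t ∈ Ioo (-R ^ 2) 0, ∫⁻ x in SereginSverak2009.spaceCyl 0 R,
      ‖v t x - angVelQuot (v t) x • rotGen x‖ₑ ^ (3 : ℕ) ≤
        (V₃ * ρ ^ (3 : ℝ)) ^ (1 / 2 : ℝ) * Y ^ (1 / 2 : ℝ) := fun t ht =>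
    setLIntegral_spaceCyl_enorm_poloidal_pow_three_le' (hax t (hsub ht)) (hv t (hsub ht)) hζ hU hζU hζ1
      (hdiv t (hsub ht)) hCζ (hΓ t (hsub ht)) (hA t (hsub ht)) hR hζR
  calc ∫⁻ z in SereginSverak2009.parCyl 0 R, ‖v z.1 z.2 - angVelQuot (v z.1) z.2 • rotGen z.2‖ₑ ^ (3 : ℕ)
      ≤ ∫⁻ t in Ioo (-R ^ 2) 0, ∫⁻ x in SereginSverak2009.spaceCyl 0 R,
          ‖v t x - angVelQuot (v t) x • rotGen x‖ₑ ^ (3 : ℕ) :=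
        setLIntegral_parCyl_le_lintegral_lintegral
          (fun z => ‖v z.1 z.2 - angVelQuot (v z.1) z.2 • rotGen z.2‖ₑ ^ (3 : ℕ)) R
    _ ≤ ∫⁻ t in Ioo (-R ^ 2) 0, (V₃ * ρ ^ (3 : ℝ)) ^ (1 / 2 : ℝ) * Y ^ (1 / 2 : ℝ) :=
        setLIntegral_mono' measurableSet_Ioo hslice
    _ = (V₃ * ρ ^ (3 : ℝ)) ^ (1 / 2 : ℝ) * Y ^ (1 / 2 : ℝ) * ρ ^ (2 : ℝ) := by
        rw [setLIntegral_const, Real.volume_Ioo, show (0 : ℝ) - -R ^ 2 = R ^ 2 by ring,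
          ENNReal.ofReal_pow hR.le, ← ENNReal.rpow_natCast, show ((2 : ℕ) : ℝ) = 2 by norm_num]
    _ = _ := by
        rw [ENNReal.mul_rpow_of_nonneg _ _ (by norm_num : (0 : ℝ) ≤ 1 / 2), ← ENNReal.rpow_mul,
          show (3 : ℝ) * (1 / 2) = 3 / 2 by norm_num, show (7 / 2 : ℝ) = 3 / 2 + 2 by norm_num,
          ENNReal.rpow_add _ _ hρ0 hρt]
        ring

end Parts

end Literature.Analysis.SereginLogSwirlOrigin.EulerScaling

end Part4

/-!
## Part 5 — port of `Summits/NavierStokesRegularity/NavierStokesRegularity/Theorems/AxisymmetricExtremalityAxisymmetricKatoGlobalStubSereginLogSwirlOriginStep4Endgame.lean` (3 declarations kept)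

# Seregin 2022, §2 Step 4, last sentence: `C(R) → 0` at the origin makes the origin regular —
# crux stmt-NavierStokesRegularity-15453 (`AxisymmetricExtremality.AxisymmetricKatoGlobal`), line registered, support for stub `stub_sereginLogSwirlOrigin`

Support file (`--supports stmt-NavierStokesRegularity-15453`; theorems only, everything proved)
toward the registered stub `stub_sereginLogSwirlOrigin`, which is verbatim the named fact
`Literature.Analysis.FluidPDE.seregin2022_logSwirl_regularAtOrigin` (G. Seregin, J. Math. Fluid
Mech. 24 (2022), Paper 27 = arXiv:2201.00153, §2).  Step 4 of that proof shows
(2.8) `R⁻² ∫_{Q(R)} |v̄|³ → 0` and `R⁻² ∫_{Q(R)} |v_θ|³ → 0` as `R → 0`, and concludes (arXiv p. 7,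
last paragraph): "According to the partial regularity theory for the Navier–Stokes equations and
to (2.8), the origin `z = 0` is a regular point of `v`."  This file proves that concluding
implication for the hypothesis block of the fact (Def. 1.1 in `Q = 𝒞 × ]-1, 0[`):

* `isRegularAtOrigin_of_tendsto_cubicC` — if `(v, q)` is a suitable weak solution on
  `SereginSverak2009.parCylOpens 0 1` with the global classes of Def. 1.1 and
  `SereginSverak2009.cubicC 0 R v → 0` as `R → 0⁺` (`C(R) = R⁻²∫_{Q(R)}|v|³` on the coordinate
  cylinders `Q(R) = 𝒞(R) × ]-R², 0[`), then `SereginSverak2009.IsRegularAtOrigin v`;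
* `isSuitableWeakSolutionInBall_zero_of_parCyl` — the Def.-1.1 class restricts to
  Albritton–Barker's class `IsSuitableWeakSolutionInBall r 0 v q` on every ball cylinder
  `Q_r(0)`, `0 < r ≤ 1`;
* `parabolicCylinder_zero_subset_parCyl` — `Q_r(0) ⊆ Q` for `0 < r ≤ 1`.

Proof ("the partial regularity theory", made explicit with proved inputs of the tree): the ball
functional is dominated by the cylinder one, `C_B(r) ≤ C_𝒞(r)` (`cknC_le_cubicC`), hence `≤ e`
for `0 < r ≤ r₀ ≤ 1/2`; the pressure decay estimate of Seregin–Šverák 2009, (as13)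
(`seregin_sverak_pressure_decay_holds`, ratio form) iterated along the scales `θʲ r₀` with
`c θ ≤ 1/2` (`cknD_iterate_le_of_pressure_decay`, `exists_ratio_mul_le_half`) gives
`D(θᴶr₀) ≤ 2^{-J} D(r₀) + 2cθ⁻²e`, small for `J` large (`D(r₀) ≤ r₀⁻²∫_Q|q|^{3/2} < ∞`) and `e`
small; so `C(s) + D(s) < ε₀` at `s = θᴶr₀`, and Seregin 2014, Lemma 6.1 at scale `s`
(`seregin2014_lemma61_holds` through `exists_smooth_representative_of_small`) yields a bounded
smooth representative of `v` on `Q_{s/2}(0)`, whence `v ∈ L_∞(Q(s/4))` since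
`Q(s/4) ⊆ Q_{√2 s/4}(0) ⊆ Q_{s/2}(0)` (`parCyl_subset_parabolicCylinder`).

## References

* G. Seregin, J. Math. Fluid Mech. 24 (2022), Paper No. 27 = arXiv:2201.00153, §2 Step 4 (arXiv
  p. 7), Def. 1.1. [`Seregin2022LocalAxisym`]
* G. Seregin, V. Šverák, Comm. PDE 34 (2009) = arXiv:0804.1803, proof of Lemma 3.5, (as13).
  [`SereginSverak2009`]
* G. Seregin, *Lecture notes on regularity theory for the Navier–Stokes equations* (2014), Ch. 6,
  Lemma 6.1. [`Seregin2014`]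
-/

section Part5

open _root_.Set _root_.MeasureTheory _root_.Filter _root_.Topology _root_.Function _root_.Metric
open scoped _root_.ENNReal _root_.NNReal
open Literature.Analysis.FluidPDE

namespace Literature.Analysis.SereginLogSwirlOrigin.EulerScaling

/-- For `0 < r ≤ 1`, the ball cylinder `Q_r(0)` lies in Seregin's `Q = 𝒞 × ]-1, 0[`. [folklore]
[cite: Seregin2022LocalAxisym, §2 proof of Thm. 1.2, Step 4 (arXiv:2201.00153 pp. 4–7) (source of the ARGUMENT this module implements; this declaration is the cell’s own lemma or plumbing, NOT a printed statement)] -/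
theorem parabolicCylinder_zero_subset_parCyl {r : ℝ} (hr : 0 < r) (hr1 : r ≤ 1) :
    parabolicCylinder r (0 : ℝ × EuclideanSpace ℝ (Fin 3)) ⊆ SereginSverak2009.parCyl 0 1 :=
  (parabolicCylinder_subset_parCyl 0 r).trans (SereginSverak2009.parCyl_mono 0 hr.le hr1)

/-- **The Def.-1.1 class restricts to Albritton–Barker's class on every ball cylinder `Q_r(0)`,
`0 < r ≤ 1`** (the passage used implicitly when "the partial regularity theory" is applied at
the origin). [cite: Seregin2022LocalAxisym, Def. 1.1 and §2 Step 4 (arXiv:2201.00153 p. 7)] -/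
theorem isSuitableWeakSolutionInBall_zero_of_parCyl
    {v : ℝ → EuclideanSpace ℝ (Fin 3) → EuclideanSpace ℝ (Fin 3)} {q : ℝ → EuclideanSpace ℝ (Fin 3) → ℝ}
    (hsw : IsSuitableWeakSolutionOn (SereginSverak2009.parCylOpens 0 1) 1 0 v q)
    (hA : ∃ C : ℝ≥0, ∀ᵐ t ∂(volume.restrict (Ioo (-1 : ℝ) 0)),
      ∫⁻ x in SereginSverak2009.spaceCyl 0 1, ‖v t x‖ₑ ^ 2 ≤ C)
    (hG : ∃ G : ℝ → EuclideanSpace ℝ (Fin 3) → EuclideanSpace ℝ (Fin 3) →L[ℝ] EuclideanSpace ℝ (Fin 3),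
      HasWeakSpatialGradientOn (SereginSverak2009.parCylOpens 0 1) v G ∧
      ∫⁻ z in SereginSverak2009.parCyl 0 1, ENNReal.ofReal (frobeniusNormSq (G z.1 z.2)) < ∞)
    (hq : ∫⁻ z in SereginSverak2009.parCyl 0 1, ‖q z.1 z.2‖ₑ ^ (3 / 2 : ℝ) < ∞)
    {r : ℝ} (hr : 0 < r) (hr1 : r ≤ 1) :
    IsSuitableWeakSolutionInBall r 0 v q := by
  have hQR : parabolicCylinder r (0 : ℝ × EuclideanSpace ℝ (Fin 3)) ⊆ SereginSverak2009.parCyl 0 1 :=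
    parabolicCylinder_zero_subset_parCyl hr hr1
  have hleR : parabolicCylinderOpens r (0 : ℝ × EuclideanSpace ℝ (Fin 3)) ≤
      SereginSverak2009.parCylOpens 0 1 := fun w hw => hQR hw
  have hIsub : Ioo ((0 : ℝ × EuclideanSpace ℝ (Fin 3)).1 - r ^ 2) (0 : ℝ × EuclideanSpace ℝ (Fin 3)).1 ⊆
      Ioo (-1 : ℝ) 0 := by
    intro t ht
    simp only [Prod.fst_zero] at ht
    have : r ^ 2 ≤ 1 := by nlinarith
    exact ⟨by linarith [ht.1], ht.2⟩
  have hBsub : ball ((0 : ℝ × EuclideanSpace ℝ (Fin 3)).2) r ⊆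
      SereginSverak2009.spaceCyl (0 : EuclideanSpace ℝ (Fin 3)) 1 := by
    intro x hx
    have hx' : x ∈ ball (0 : EuclideanSpace ℝ (Fin 3)) 1 := ball_subset_ball hr1 hx
    exact ball_subset_spaceCyl 0 1 hx'
  obtain ⟨G, hGw, hGE⟩ := hG
  refine ⟨hsw.of_le hleR, ?_, ⟨G, hGw.mono hleR, (lintegral_mono_set hQR).trans_lt hGE⟩, ?_⟩
  · obtain ⟨C, hC⟩ := hA
    refine ⟨C, ?_⟩
    filter_upwards [ae_restrict_of_ae_restrict_of_subset hIsub hC] with t ht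
    exact (lintegral_mono_set hBsub).trans ht
  · have hpm : AEStronglyMeasurable (uncurry q) (volume.restrict (parabolicCylinder r 0)) :=
      hsw.distributional.2.2.1.aestronglyMeasurable.mono_measure
        (Measure.restrict_mono (hQR.trans (subset_of_eq (SereginSverak2009.coe_parCylOpens 0 1).symm))
          le_rfl)
    have hfin : ∫⁻ z in parabolicCylinder r 0, ‖uncurry q z‖ₑ ^ (3 / 2 : ℝ) ≠ ∞ :=
      ((lintegral_mono_set hQR).trans_lt hq).ne
    exact (memLp_threeHalves_of_lintegral_le hpm hfin le_rfl).1

/-- **Seregin 2022, §2 Step 4, the concluding appeal to partial regularity** ("According to the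
partial regularity theory for the Navier–Stokes equations and to (2.8), the origin `z = 0` is a
regular point of `v`"): for a suitable weak solution of Def. 1.1 in `Q = 𝒞 × ]-1, 0[`
(the hypothesis block of `seregin2022_logSwirl_regularAtOrigin`), if the scaled cubic functional
`C(R) = R⁻² ∫_{Q(R)} |v|³` (`SereginSverak2009.cubicC 0 R v`, coordinate cylinders) tends to `0` as
`R → 0⁺`, then the origin is a regular point (`SereginSverak2009.IsRegularAtOrigin v`).  Proof (all
inputs proved in the tree): `C_B(r) ≤ C_𝒞(r)` (`cknC_le_cubicC`) is `≤ e` below some `r₀ ≤ 1/2`; the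
pressure decay estimate (`seregin_sverak_pressure_decay_holds`) iterated along `θʲr₀`
(`cknD_iterate_le_of_pressure_decay`) makes `D(θᴶr₀)` small; Seregin's Lemma 6.1 at scale
`s = θᴶr₀` (`seregin2014_lemma61_holds`, `exists_smooth_representative_of_small`) bounds `v` on
`Q_{s/2}(0) ⊇ Q(s/4)`. [cite: Seregin2022LocalAxisym, §2 Step 4, last paragraph (arXiv:2201.00153 p. 7)] -/
theorem isRegularAtOrigin_of_tendsto_cubicC : ∀ (v : ℝ → EuclideanSpace ℝ (Fin 3) → EuclideanSpace ℝ (Fin 3)) (q : ℝ → EuclideanSpace ℝ (Fin 3) → ℝ), IsSuitableWeakSolutionOn (SereginSverak2009.parCylOpens 0 1) 1 0 v q → (∃ C : ℝ≥0, ∀ᵐ t ∂(volume.restrict (Ioo (-1 : ℝ) 0)), ∫⁻ x in SereginSverak2009.spaceCyl 0 1, ‖v t x‖ₑ ^ 2 ≤ C) → (∃ G : ℝ → EuclideanSpace ℝ (Fin 3) → EuclideanSpace ℝ (Fin 3) →L[ℝ] EuclideanSpace ℝ (Fin 3), HasWeakSpatialGradientOn (SereginSverak2009.parCylOpens 0 1)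 v G ∧ ∫⁻ z in SereginSverak2009.parCyl 0 1, ENNReal.ofReal (frobeniusNormSq (G z.1 z.2)) < ∞) → (∫⁻ z in SereginSverak2009.parCyl 0 1, ‖q z.1 z.2‖ₑ ^ (3 / 2 : ℝ) < ∞) → Tendsto (fun R => SereginSverak2009.cubicC 0 R v) (𝓝[>] 0) (𝓝 0) → SereginSverak2009.IsRegularAtOrigin v := by
  intro v q hsw hA hG hq hC
  -- ### constants
  obtain ⟨ε₀, hε₀, c₀, h61⟩ := seregin2014_lemma61_holds
  obtain ⟨c, hPD⟩ := seregin_sverak_pressure_decay_holds.ratio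
  obtain ⟨θ, hθ, hθhalf, hcθ⟩ := exists_ratio_mul_le_half c
  have hθ1 : θ ≤ 1 := hθhalf.trans (by norm_num)
  set cθ : ℝ := (c : ℝ) * θ⁻¹ ^ 2 with hcθdef
  have hcθ0 : 0 ≤ cθ := by positivity
  set e : ℝ := ε₀ / (8 * (cθ + 1)) with hedef
  have he : 0 < e := by positivity
  have he8 : e ≤ ε₀ / 8 :=
    div_le_div_of_nonneg_left hε₀.le (by norm_num) (by nlinarith)
  have hcθe : 2 * (cθ * e) ≤ ε₀ / 4 := by
    have h1 : cθ * e = (cθ / (cθ + 1)) * (ε₀ / 8) := by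
      rw [hedef]
      field_simp
    have h2 : cθ / (cθ + 1) ≤ 1 := (div_le_one (by positivity)).2 (by linarith)
    nlinarith
  -- ### `C_B(r) ≤ e` below some `r₀ ≤ 1/2`
  have hev : ∀ᶠ R in 𝓝[>] (0 : ℝ), SereginSverak2009.cubicC 0 R v < ENNReal.ofReal e :=
    hC (Iio_mem_nhds (ENNReal.ofReal_pos.2 he))
  obtain ⟨u₁, hu₁, hsub⟩ := mem_nhdsGT_iff_exists_Ioo_subset.1 hev
  set r₀ : ℝ := min (u₁ / 2) (1 / 2) with hr₀def
  have hu₁' : 0 < u₁ := hu₁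
  have hr₀ : 0 < r₀ := lt_min (by positivity) (by norm_num)
  have hr₀u : r₀ < u₁ := (min_le_left _ _).trans_lt (by linarith)
  have hr₀1 : r₀ ≤ 1 := (min_le_right _ _).trans (by norm_num)
  have hCsmall : ∀ r : ℝ, 0 < r → r ≤ r₀ →
      cknC r (0 : ℝ × EuclideanSpace ℝ (Fin 3)) v ≤ ENNReal.ofReal e := by
    intro r hr hrr₀
    have hlt : SereginSverak2009.cubicC 0 r v < ENNReal.ofReal e := hsub ⟨hr, hrr₀.trans_lt hr₀u⟩
    exact ((cknC_le_cubicC 0 r v).trans hlt.le)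
  -- ### geometry and the distributional solution on `Q`
  have hQ0 : parabolicCylinder r₀ (0 : ℝ × EuclideanSpace ℝ (Fin 3)) ⊆
      (SereginSverak2009.parCylOpens 0 1 : Set (ℝ × EuclideanSpace ℝ (Fin 3))) := by
    rw [SereginSverak2009.coe_parCylOpens]
    exact parabolicCylinder_zero_subset_parCyl hr₀ hr₀1
  have hdist : IsDistributionalNSSolutionOn (SereginSverak2009.parCylOpens 0 1) 1 0 v q :=
    hsw.distributional
  -- ### `D(r₀) < ∞` and the choice of `J`
  have hD₀ : cknD r₀ (0 : ℝ × EuclideanSpace ℝ (Fin 3)) q < ∞ := by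
    rw [cknD]
    refine ENNReal.mul_lt_top (ENNReal.inv_lt_top.2 ?_) ?_
    · exact ENNReal.pow_pos (ENNReal.ofReal_pos.2 hr₀) 2
    · exact (lintegral_mono_set (parabolicCylinder_zero_subset_parCyl hr₀ hr₀1)).trans_lt hq
  have hε4 : ENNReal.ofReal (ε₀ / 4) ≠ 0 := (ENNReal.ofReal_pos.2 (by positivity)).ne'
  obtain ⟨J, hJ⟩ := ENNReal.exists_inv_two_pow_lt
    ((ENNReal.div_pos_iff).2 ⟨hε4, hD₀.ne⟩).ne'
  have hJ' : (2⁻¹ : ℝ≥0∞) ^ J * cknD r₀ (0 : ℝ × EuclideanSpace ℝ (Fin 3)) q ≤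
      ENNReal.ofReal (ε₀ / 4) := ENNReal.mul_le_of_le_div hJ.le
  -- ### the scale `s = θᴶ r₀` and the smallness of `C + D` there
  set s : ℝ := θ ^ J * r₀ with hsdef
  have hs : 0 < s := by positivity
  have hsr₀ : s ≤ r₀ := mul_le_of_le_one_left hr₀.le (pow_le_one₀ hθ.le hθ1)
  have hs1 : s ≤ 1 := hsr₀.trans hr₀1
  have hDiter := cknD_iterate_le_of_pressure_decay hPD hθ hθ1 hcθ hdist hr₀ hQ0
    (e := ENNReal.ofReal e) (J := J) (fun j _ => hCsmall _ (by positivity)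
      (mul_le_of_le_one_left hr₀.le (pow_le_one₀ hθ.le hθ1)))
  have hconst : 2 * ((c : ℝ≥0∞) * ENNReal.ofReal (θ⁻¹ ^ 2) * ENNReal.ofReal e) ≤
      ENNReal.ofReal (ε₀ / 4) := by
    have e1 : 2 * ((c : ℝ≥0∞) * ENNReal.ofReal (θ⁻¹ ^ 2) * ENNReal.ofReal e) =
        ENNReal.ofReal (2 * (cθ * e)) := by
      rw [hcθdef, ← ENNReal.ofReal_coe_nnreal, ← ENNReal.ofReal_mul (NNReal.coe_nonneg c),
        ← ENNReal.ofReal_mul (by positivity), ← ENNReal.ofReal_ofNat,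
        ← ENNReal.ofReal_mul (by norm_num)]
    rw [e1]
    exact ENNReal.ofReal_le_ofReal hcθe
  have hDs : cknD s (0 : ℝ × EuclideanSpace ℝ (Fin 3)) q ≤
      ENNReal.ofReal (ε₀ / 4) + ENNReal.ofReal (ε₀ / 4) :=
    hDiter.trans (add_le_add hJ' hconst)
  have hCs : cknC s (0 : ℝ × EuclideanSpace ℝ (Fin 3)) v ≤ ENNReal.ofReal e := hCsmall s hs hsr₀
  have hsmall : cknC s (0 : ℝ × EuclideanSpace ℝ (Fin 3)) v + cknD s 0 q < ENNReal.ofReal ε₀ := by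
    calc cknC s (0 : ℝ × EuclideanSpace ℝ (Fin 3)) v + cknD s 0 q
        ≤ ENNReal.ofReal e + (ENNReal.ofReal (ε₀ / 4) + ENNReal.ofReal (ε₀ / 4)) :=
          add_le_add hCs hDs
      _ = ENNReal.ofReal (e + (ε₀ / 4 + ε₀ / 4)) := by
          rw [← ENNReal.ofReal_add (by positivity) (by positivity),
            ← ENNReal.ofReal_add he.le (by positivity)]
      _ < ENNReal.ofReal ε₀ := (ENNReal.ofReal_lt_ofReal_iff hε₀).2 (by linarith)
  -- ### Lemma 6.1 at scale `s`
  have hIB : IsSuitableWeakSolutionInBall s 0 v q :=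
    isSuitableWeakSolutionInBall_zero_of_parCyl hsw hA hG hq hs hs1
  obtain ⟨V, hae, -, -, hbd⟩ := exists_smooth_representative_of_small h61 hs hIB hsmall
  have hVb : ∀ w ∈ parabolicCylinder (s / 2) (0 : ℝ × EuclideanSpace ℝ (Fin 3)),
      ‖uncurry V w‖ ≤ s⁻¹ ^ (0 + 1) * c₀ 0 := by
    intro w hw
    have := hbd 0 w hw
    rwa [norm_iteratedFDeriv_zero] at this
  have hmeas : MeasurableSet (parabolicCylinder (s / 2) (0 : ℝ × EuclideanSpace ℝ (Fin 3))) :=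
    (isOpen_parabolicCylinder _ _).measurableSet
  have hbddV : eLpNorm (uncurry V) ∞
      (volume.restrict (parabolicCylinder (s / 2) (0 : ℝ × EuclideanSpace ℝ (Fin 3)))) < ∞ := by
    rw [eLpNorm_exponent_top]
    exact eLpNormEssSup_lt_top_of_ae_bound ((ae_restrict_iff' hmeas).2 (Eventually.of_forall hVb))
  have hbdd : eLpNorm (uncurry v) ∞
      (volume.restrict (parabolicCylinder (s / 2) (0 : ℝ × EuclideanSpace ℝ (Fin 3)))) < ∞ := by
    rwa [eLpNorm_congr_ae hae]
  -- ### shrink to a coordinate cylinder `Q(s/4) ⊆ Q_{s/2}(0)`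
  refine ⟨s / 4, by positivity, lt_of_le_of_lt (eLpNorm_mono_measure _ (Measure.restrict_mono ?_ le_rfl)) hbdd⟩
  refine (parCyl_subset_parabolicCylinder 0 (by positivity : (0 : ℝ) ≤ s / 4)).trans
    (parabolicCylinder_mono (by positivity) ?_ 0)
  have h2 : Real.sqrt 2 ≤ 2 := by
    rw [Real.sqrt_le_iff]
    norm_num
  nlinarith [Real.sqrt_nonneg 2]

end Literature.Analysis.SereginLogSwirlOrigin.EulerScaling

end Part5

/-!
## Part 6 — port of `Summits/NavierStokesRegularity/NavierStokesRegularity/Theorems/AxisymmetricExtremalityAxisymmetricKatoGlobalStubSereginLogSwirlOriginStep4Assembly.lean` (3 declarations kept)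

# Seregin 2022, §2 Step 4 (assembly, IV): the Step-3 bounds imply `C(R) ≤ C R^{3/2}` and
# `C(R) → 0` — crux stmt-NavierStokesRegularity-15453 (`AxisymmetricExtremality.AxisymmetricKatoGlobal`), line registered, support for stub `stub_sereginLogSwirlOrigin`

Support file (`--supports stmt-NavierStokesRegularity-15453`; theorems only, everything proved)
toward the registered stub `stub_sereginLogSwirlOrigin` = the named fact
`Literature.Analysis.FluidPDE.seregin2022_logSwirl_regularAtOrigin` (G. Seregin, J. Math. Fluid
Mech. 24 (2022), Paper 27 = arXiv:2201.00153, §2).  Step 4 ("Final Conclusion", arXiv p. 7)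
starts from the Step-3 estimate `sup_{-1<t<0}∫_𝒞 η⁶(|Γ|² + |Φ|²) + ∫_Q (η³|∇Φ|)² + (η³|∇Γ|)² ≤
C(v, η, r₁)`, "re-written to the form (2.7) `|η³Φ|²_{2,Q} + |η³Γ|²_{2,Q} < ∞`", and shows
`C(R) = R⁻²∫_{Q(R)}|v|³ → 0` as `R → 0` ((2.8) for `v̄`, the `v_θ` passage for the swirl),
whence "according to the partial regularity theory … the origin `z = 0` is a regular point of `v`"
(landed: `isRegularAtOrigin_of_tendsto_cubicC`, `…Step4Endgame.lean`).  This file assembles the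
implication **Step-3 bounds ⇒ `C(R) → 0`** in the honest classical-on-a-slab form to which Step 1
reduces the suitable weak case: on a final time slab `]t₁, 0[` the slices `v t` are axisymmetric
`C⁴` fields on `ℝ³`, divergence free on an open `U`; `ζ = η³` is a `C²` (time-independent: `ξ = 1`
for `t ≥ -1/64`) cut-off with `tsupport ζ ⊆ U ∩ 𝒞` and `ζ = 1` on `𝒞(r₁)`; `v` is in the energy
class `sup_t ∫_𝒞 |v|² ≤ A` and bounded on `supp ∇ζ` (Step 1: `v`, `∇v`, `∇²v`, `∇ω` are bounded
on `supp ∇η`).  Proved: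

* `tendsto_cubicC_of_le_rpow` — a rate `C(R) ≤ C R^γ`, `γ > 0`, on `]0, R₀]` gives `C(R) → 0`;
* `cubicC_le_of_twoSeven` (registered) — **from (2.7)** (`sup_t ‖ζΓ‖₂² ≤ K_Γ`, `sup_t ‖ζΦ‖₂² ≤ K_Φ`,
  `‖∇(ζΦ)‖²_{2,]t₁,0[×ℝ³} ≤ K_Φ'`; the gradient of `ζΓ` is not needed):
  `C(R) ≤ C R^{3/2}` for `0 < R ≤ min(r₁, √|t₁|)` (`SereginSverak2009.cubicC`, coordinate cylinders);
* `tendsto_cubicC_of_twoSeven` (registered) — hence `C(R) → 0` as `R → 0⁺`;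
* `cubicC_le_of_step3Bounds`, `tendsto_cubicC_of_step3Bounds` (registered) — the same **from the
  printed Step-3 output** `sup_t ∫ζ²(Γ² + Φ²) ≤ K`, `∫_{t₁}^0∫ζ²(‖∇Φ‖² + ‖∇Γ‖²) ≤ K` (time integral
  iterated, `η⁶ = ζ²`) plus `|Φ| ≤ L` on `supp ∇ζ`, through the rewriting to (2.7)
  (`lintegral_enorm_fderiv_mul_radVelQuot_sq_le`, `…Step4AssemblySwirl.lean`);
* `isRegularAtOrigin_of_step3Bounds` — glued to the landed endgame: Def. 1.1 class on `Q` + the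
  slab hypotheses ⇒ `SereginSverak2009.IsRegularAtOrigin v`;
* `norm_fderiv_sq_eq_sum_sq` — `‖D f x‖² = Σᵢ(∂ᵢf)²` for scalar `f`, the bridge to the coordinate
  form of `‖∇(ζG)‖²` used by the Step-3 files (`…Step3Gamma`, `…Step3Balance`).

Rates: poloidal `R^{3/2}` (`Ḣ¹ ⊂ L⁶` at fixed time; any positive rate suffices), swirl `R^{12/5}`
(= printed `(10/3 + 1)·9/10 − 3/2`).

## References

* G. Seregin, J. Math. Fluid Mech. 24 (2022), Paper No. 27 = arXiv:2201.00153, §2 Step 4 (arXiv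
  p. 7), Step 3 (last display, p. 7), Step 1 (p. 5). [`Seregin2022LocalAxisym`]

Not carried from this source module (not needed by the declarations re-homed here; their consumers are Summits-side): `tendsto_cubicC_of_twoSeven`, `cubicC_le_of_step3Bounds`, `tendsto_cubicC_of_step3Bounds`, `isRegularAtOrigin_of_step3Bounds`.
-/

section Part6

open _root_.Set _root_.MeasureTheory _root_.Filter _root_.Topology _root_.Function _root_.Metric
open scoped _root_.ENNReal _root_.NNReal RealInnerProductSpace
open Literature.Analysis.FluidPDE

namespace Literature.Analysis.SereginLogSwirlOrigin.EulerScaling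

/-! ### Step 4: `C(R) ≤ C R^{3/2}` for small `R`, and `C(R) → 0` -/

section Main

/-- **Rate to limit**: `C(R) ≤ C R^γ` on `]0, R₀]` with `γ > 0` gives `C(R) → 0` as `R → 0⁺`. [folklore]
[cite: Seregin2022LocalAxisym, §2 proof of Thm. 1.2, Step 4 (arXiv:2201.00153 pp. 4–7) (source of the ARGUMENT this module implements; this declaration is the cell’s own lemma or plumbing, NOT a printed statement)] -/
theorem tendsto_cubicC_of_le_rpow {v : ℝ → EuclideanSpace ℝ (Fin 3) → EuclideanSpace ℝ (Fin 3)}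
    {C : ℝ≥0} {R₀ γ : ℝ} (hR₀ : 0 < R₀) (hγ : 0 < γ)
    (h : ∀ R ∈ Ioc 0 R₀, SereginSverak2009.cubicC 0 R v ≤ C * ENNReal.ofReal R ^ γ) :
    Tendsto (fun R => SereginSverak2009.cubicC 0 R v) (𝓝[>] 0) (𝓝 0) := by
  have h0 : Tendsto (fun R : ℝ => R) (𝓝[>] (0 : ℝ)) (𝓝 0) :=
    tendsto_nhdsWithin_of_tendsto_nhds tendsto_id
  have h1 : Tendsto (fun R : ℝ => ENNReal.ofReal R) (𝓝[>] (0 : ℝ)) (𝓝 0) := by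
    have := ENNReal.tendsto_ofReal h0
    rwa [ENNReal.ofReal_zero] at this
  have h2 : Tendsto (fun R : ℝ => ENNReal.ofReal R ^ γ) (𝓝[>] (0 : ℝ)) (𝓝 0) := by
    have hc : Tendsto (fun a : ℝ≥0∞ => a ^ γ) (𝓝 0) (𝓝 ((0 : ℝ≥0∞) ^ γ)) :=
      (ENNReal.continuous_rpow_const (y := γ)).tendsto 0
    rw [ENNReal.zero_rpow_of_pos hγ] at hc
    exact hc.comp h1
  have h3 : Tendsto (fun R : ℝ => (C : ℝ≥0∞) * ENNReal.ofReal R ^ γ) (𝓝[>] (0 : ℝ)) (𝓝 0) := by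
    simpa using ENNReal.Tendsto.const_mul h2 (Or.inr ENNReal.coe_ne_top)
  refine tendsto_of_tendsto_of_tendsto_of_le_of_le' tendsto_const_nhds h3
    (Eventually.of_forall fun R => bot_le) ?_
  filter_upwards [Ioc_mem_nhdsGT hR₀] with R hR using h R hR

/-- **Seregin 2022, §2 Step 4, from (2.7): `C(R) ≤ C R^{3/2}` for `0 < R ≤ min(r₁, √|t₁|)`.**
Classical-on-a-slab form of Step 4 (arXiv p. 7): the slices `v t`, `t ∈ ]t₁, 0[`, are axisymmetric
`C⁴` fields on `ℝ³`, divergence free on an open `U`; `ζ` (`= η³`) is a `C²` cut-off with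
`tsupport ζ ⊆ U ∩ 𝒞`, `ζ = 1` on `𝒞(r₁)`; the hypotheses are the energy class
`sup_t ∫_𝒞 |v|² ≤ A`, boundedness `|v| ≤ L` on `supp ∇ζ` (Step 1: `v` is smooth on `supp ∇η`), and
(2.7) `|η³Φ|²_{2,Q} + |η³Γ|²_{2,Q} < ∞` in the form `sup_t ‖ζΓ‖₂² ≤ K_Γ`, `sup_t ‖ζΦ‖₂² ≤ K_Φ`,
`‖∇(ζΦ)‖²_{2,]t₁,0[×ℝ³} ≤ K_Φ'` (`Γ = angVortQuot = ω_θ/r`, `Φ = radVelQuot ∘ curl = ω_r/r`; the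
gradient of `ζΓ` is not needed).  Conclusion: the scaled functional `C(R) = R⁻²∫_{Q(R)}|v|³`
(`SereginSverak2009.cubicC 0 R v`) is `≤ C R^{3/2}`: poloidal part by the first elliptic bound and
`Ḣ¹ ⊂ L⁶` (`setLIntegral_parCyl_enorm_poloidal_pow_three_le`, rate `R^{3/2}`), swirl part by the
`v_θ` passage (`setLIntegral_parCyl_enorm_swirlVelocity_pow_three_le`, rate `R^{12/5}`), joined by
`|v|³ ≤ 4(|v̄|³ + |v_θ|³)`. [cite: Seregin2022LocalAxisym, §2 Step 4 (arXiv:2201.00153 p. 7), (2.7)–(2.8) and the `v_θ` passage] -/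
theorem cubicC_le_of_twoSeven : ∀ (v : ℝ → EuclideanSpace ℝ (Fin 3) → EuclideanSpace ℝ (Fin 3)) (ζ : EuclideanSpace ℝ (Fin 3) → ℝ) (U : Set (EuclideanSpace ℝ (Fin 3))) (t₁ r₁ L : ℝ) (A KΓ KΦ KΦ' : ℝ≥0), t₁ < 0 → 0 < r₁ → r₁ ≤ 1 → AEStronglyMeasurable (uncurry v) (volume.restrict (SereginSverak2009.parCyl 0 r₁)) → (∀ t ∈ Ioo t₁ 0, ContDiff ℝ 4 (v t)) → (∀ t ∈ Ioo t₁ 0, IsAxisymmetric (v t)) → IsOpen U → (∀ t ∈ Ioo t₁ 0, ∀ x ∈ U, VectorCalculus.divergence (v t) x = 0) → ContDiff ℝ 2 ζ → tsupport ζ ⊆ U → tsupport ζ ⊆ SereginSverak2009.spaceCyl 0 1 → (∀ x ∈ SereginSverak2009.spaceCyl 0 r₁, ζ x = 1) → (∀ t ∈ Ioo t₁ 0, ∫⁻ x in SereginSverak2009.spaceCyl 0 1, ‖v t x‖ₑ ^ 2 ≤ A) → (∀ t ∈ Ioo t₁ 0, ∀ x, fderiv ℝ ζ x ≠ 0 →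 ‖v t x‖ ≤ L) → (∀ t ∈ Ioo t₁ 0, ∫⁻ x, ‖ζ x * angVortQuot (v t) x‖ₑ ^ 2 ≤ KΓ) → (∀ t ∈ Ioo t₁ 0, ∫⁻ x, ‖ζ x * radVelQuot (curl (v t)) x‖ₑ ^ 2 ≤ KΦ) → (∫⁻ t in Ioo t₁ 0, ∫⁻ x, ‖fderiv ℝ (fun y => ζ y * radVelQuot (curl (v t)) y) x‖ₑ ^ 2 ≤ KΦ') → ∃ C : ℝ≥0, ∀ R ∈ Ioc 0 (min r₁ (Real.sqrt (-t₁))), SereginSverak2009.cubicC 0 R v ≤ C * ENNReal.ofReal R ^ (3 / 2 : ℝ) := by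
  intro v ζ U t₁ r₁ L A KΓ KΦ KΦ' ht₁ hr₁ hr₁1 hmeas hv hax hU hdiv hζ hζU hζ1 hζr₁ hA hLv hΓ hΦ hΦ'
  -- the gradient bound of the cut-off
  have hζc : HasCompactSupport ζ := hasCompactSupport_of_tsupport_subset_spaceCyl hζ1
  obtain ⟨Cζ, hCζ⟩ :=
    (hζ.continuous_fderiv (by norm_num)).bounded_above_of_compact_support (hζc.fderiv ℝ)
  -- `(2.7)` ⇒ the space–time `L^{10/3}` bound of `ζΦ`
  have hΦ1 : ∀ t ∈ Ioo t₁ 0, ContDiff ℝ 1 (radVelQuot (curl (v t))) := fun t ht =>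
    contDiff_radVelQuot (n := 1)
      (by exact_mod_cast (contDiff_curl_of_succ (n := 3) (by exact_mod_cast hv t ht)))
  have hM := lintegral_lintegral_enorm_mul_rpow_tenThirds_le' (Φ := fun t => radVelQuot (curl (v t)))
    (hζ.of_le (by norm_num)) hζc hΦ1 hΦ hΦ'
  -- constants
  set CS : ℝ≥0∞ := (eLpNormLESNormFDerivOfEqInnerConst
    (volume : Measure (EuclideanSpace ℝ (Fin 3))) 2 : ℝ≥0∞) with hCS
  set M : ℝ≥0∞ := (KΦ : ℝ≥0∞) ^ (2 / 3 : ℝ) * (CS ^ (2 : ℝ) * KΦ') with hMdef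
  set V₃ : ℝ≥0∞ := volume (ball (0 : EuclideanSpace ℝ (Fin 3)) 1) with hV₃def
  set V₂ : ℝ≥0∞ := volume (ball (0 : EuclideanSpace ℝ (Fin 2)) 1) with hV₂def
  set Cpol : ℝ≥0∞ := (8 * V₃) ^ (1 / 2 : ℝ) *
    (CS ^ (6 : ℝ) * (2 * KΓ + 12 * ENNReal.ofReal (Cζ ^ 2) * A) ^ (3 : ℝ)) ^ (1 / 2 : ℝ) with hCpol
  set Csw : ℝ≥0∞ := (8 * V₃) ^ (1 / 10 : ℝ) * (2 ^ (17 / 3 : ℝ) *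
    (M + (ENNReal.ofReal Cζ * ENNReal.ofReal L) ^ (10 / 3 : ℝ) * (2 * V₂))) ^ (9 / 10 : ℝ) with hCsw
  have hV₃ : V₃ ≠ ∞ := measure_ball_lt_top.ne
  have hV₂ : V₂ ≠ ∞ := measure_ball_lt_top.ne
  have hCSt : CS ≠ ∞ := ENNReal.coe_ne_top
  have hMt : M ≠ ∞ :=
    ENNReal.mul_ne_top (ENNReal.rpow_ne_top_of_nonneg (by norm_num) ENNReal.coe_ne_top)
      (ENNReal.mul_ne_top (ENNReal.rpow_ne_top_of_nonneg (by norm_num) hCSt) ENNReal.coe_ne_top)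
  have hpolt : Cpol ≠ ∞ := by
    refine ENNReal.mul_ne_top (ENNReal.rpow_ne_top_of_nonneg (by norm_num)
      (ENNReal.mul_ne_top ENNReal.ofNat_ne_top hV₃)) (ENNReal.rpow_ne_top_of_nonneg (by norm_num)
      (ENNReal.mul_ne_top (ENNReal.rpow_ne_top_of_nonneg (by norm_num) hCSt)
        (ENNReal.rpow_ne_top_of_nonneg (by norm_num) (ENNReal.add_ne_top.2 ⟨?_, ?_⟩))))
    · exact ENNReal.mul_ne_top ENNReal.ofNat_ne_top ENNReal.coe_ne_top
    · exact ENNReal.mul_ne_top (ENNReal.mul_ne_top ENNReal.ofNat_ne_top ENNReal.ofReal_ne_top)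
        ENNReal.coe_ne_top
  have hswt : Csw ≠ ∞ := by
    refine ENNReal.mul_ne_top (ENNReal.rpow_ne_top_of_nonneg (by norm_num)
      (ENNReal.mul_ne_top ENNReal.ofNat_ne_top hV₃)) (ENNReal.rpow_ne_top_of_nonneg (by norm_num)
      (ENNReal.mul_ne_top (ENNReal.rpow_ne_top_of_nonneg (by norm_num) ENNReal.ofNat_ne_top)
        (ENNReal.add_ne_top.2 ⟨hMt, ?_⟩)))
    exact ENNReal.mul_ne_top (ENNReal.rpow_ne_top_of_nonneg (by norm_num)
      (ENNReal.mul_ne_top ENNReal.ofReal_ne_top ENNReal.ofReal_ne_top))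
      (ENNReal.mul_ne_top ENNReal.ofNat_ne_top hV₂)
  have hfin : 4 * (Cpol + Csw) ≠ ∞ :=
    ENNReal.mul_ne_top ENNReal.ofNat_ne_top (ENNReal.add_ne_top.2 ⟨hpolt, hswt⟩)
  refine ⟨(4 * (Cpol + Csw)).toNNReal, fun R hR => ?_⟩
  rw [ENNReal.coe_toNNReal hfin]
  obtain ⟨hR0, hRle⟩ := hR
  have hRr₁ : R ≤ r₁ := hRle.trans (min_le_left _ _)
  have hR1 : R ≤ 1 := hRr₁.trans hr₁1
  have hRt : t₁ ≤ -R ^ 2 := by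
    have h1 : R ≤ Real.sqrt (-t₁) := hRle.trans (min_le_right _ _)
    have h2 : R ^ 2 ≤ Real.sqrt (-t₁) ^ 2 := pow_le_pow_left₀ hR0.le h1 2
    rw [Real.sq_sqrt (by linarith)] at h2
    linarith
  set ρ : ℝ≥0∞ := ENNReal.ofReal R with hρ
  have hρ0 : ρ ≠ 0 := (ENNReal.ofReal_pos.2 hR0).ne'
  have hρt : ρ ≠ ∞ := ENNReal.ofReal_ne_top
  have hρ1 : ρ ≤ 1 := ENNReal.ofReal_le_one.2 hR1
  -- the two parts on `Q(R)`
  have hpolQ : ∫⁻ z in SereginSverak2009.parCyl 0 R,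
      ‖v z.1 z.2 - angVelQuot (v z.1) z.2 • rotGen z.2‖ₑ ^ (3 : ℕ) ≤ Cpol * ρ ^ (7 / 2 : ℝ) :=
    setLIntegral_parCyl_enorm_poloidal_pow_three_le' hv hax hζ hU hζU hζ1 hdiv hCζ hΓ hA hζr₁ hR0
      hRr₁ hRt
  have hswQ : ∫⁻ z in SereginSverak2009.parCyl 0 R, ‖swirlVelocity (v z.1) z.2‖ₑ ^ (3 : ℕ) ≤
      Csw * ρ ^ (22 / 5 : ℝ) :=
    setLIntegral_parCyl_enorm_swirlVelocity_pow_three_le' hmeas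
      (fun t ht => (hv t ht).of_le (by norm_num)) hax (hζ.of_le (by norm_num)) hζ1 hCζ hLv hM
      hζr₁ hR0 hRr₁ hR1 hRt
  -- splitting `|v|³ ≤ 4(|v̄|³ + |v_θ|³)` on `Q(R)`
  have hsubt : ∀ z ∈ SereginSverak2009.parCyl (0 : ℝ × EuclideanSpace ℝ (Fin 3)) R, z.1 ∈ Ioo t₁ 0 :=
    fun z hz => by
      have h := (SereginSverak2009.mem_parCyl_zero.1 hz).1
      exact ⟨lt_of_le_of_lt hRt h.1, h.2⟩
  have hθm : AEMeasurable (fun z : ℝ × EuclideanSpace ℝ (Fin 3) =>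
      ‖swirlVelocity (v z.1) z.2‖ₑ ^ (3 : ℕ)) (volume.restrict (SereginSverak2009.parCyl 0 R)) :=
    (aemeasurable_swirlVelocity_uncurry (hmeas.mono_measure (Measure.restrict_mono
      (SereginSverak2009.parCyl_mono 0 hR0.le hRr₁) le_rfl))).enorm.pow_const _
  have hI : ∫⁻ z in SereginSverak2009.parCyl 0 R, ‖v z.1 z.2‖ₑ ^ (3 : ℕ) ≤
      4 * (Cpol * ρ ^ (7 / 2 : ℝ) + Csw * ρ ^ (7 / 2 : ℝ)) := by
    calc ∫⁻ z in SereginSverak2009.parCyl 0 R, ‖v z.1 z.2‖ₑ ^ (3 : ℕ)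
        ≤ ∫⁻ z in SereginSverak2009.parCyl 0 R,
            4 * (‖v z.1 z.2 - angVelQuot (v z.1) z.2 • rotGen z.2‖ₑ ^ (3 : ℕ) +
              ‖swirlVelocity (v z.1) z.2‖ₑ ^ (3 : ℕ)) :=
          setLIntegral_mono' (SereginSverak2009.isOpen_parCyl 0 R).measurableSet fun z hz =>
            enorm_pow_three_le_poloidal_add_swirl (hax z.1 (hsubt z hz))
              ((hv z.1 (hsubt z hz)).of_le (by norm_num)) z.2
      _ = 4 * ((∫⁻ z in SereginSverak2009.parCyl 0 R,
            ‖v z.1 z.2 - angVelQuot (v z.1) z.2 • rotGen z.2‖ₑ ^ (3 : ℕ)) +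
            ∫⁻ z in SereginSverak2009.parCyl 0 R, ‖swirlVelocity (v z.1) z.2‖ₑ ^ (3 : ℕ)) := by
          rw [lintegral_const_mul' _ _ ENNReal.ofNat_ne_top, lintegral_add_right' _ hθm]
      _ ≤ 4 * (Cpol * ρ ^ (7 / 2 : ℝ) + Csw * ρ ^ (22 / 5 : ℝ)) := by gcongr
      _ ≤ 4 * (Cpol * ρ ^ (7 / 2 : ℝ) + Csw * ρ ^ (7 / 2 : ℝ)) :=
          mul_le_mul' le_rfl (add_le_add le_rfl (mul_le_mul' le_rfl
            (ENNReal.rpow_le_rpow_of_exponent_ge hρ1 (by norm_num : (7 / 2 : ℝ) ≤ 22 / 5))))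
  -- `C(R) = (R²)⁻¹ ∫_{Q(R)} |v|³`
  show (ENNReal.ofReal R ^ 2)⁻¹ * ∫⁻ z in SereginSverak2009.parCyl 0 R, ‖v z.1 z.2‖ₑ ^ (3 : ℕ) ≤ _
  have hinv : (ρ ^ 2)⁻¹ * ρ ^ 2 = 1 := ENNReal.inv_mul_cancel (pow_ne_zero _ hρ0) (ENNReal.pow_ne_top hρt)
  calc (ρ ^ 2)⁻¹ * ∫⁻ z in SereginSverak2009.parCyl 0 R, ‖v z.1 z.2‖ₑ ^ (3 : ℕ)
      ≤ (ρ ^ 2)⁻¹ * (4 * (Cpol * ρ ^ (7 / 2 : ℝ) + Csw * ρ ^ (7 / 2 : ℝ))) := mul_le_mul' le_rfl hI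
    _ = 4 * (Cpol + Csw) * ρ ^ (3 / 2 : ℝ) := by
        rw [show (7 / 2 : ℝ) = 2 + 3 / 2 by norm_num, ENNReal.rpow_add _ _ hρ0 hρt,
          show ρ ^ (2 : ℝ) = ρ ^ (2 : ℕ) from ENNReal.rpow_ofNat ρ 2]
        calc (ρ ^ 2)⁻¹ * (4 * (Cpol * (ρ ^ 2 * ρ ^ (3 / 2 : ℝ)) + Csw * (ρ ^ 2 * ρ ^ (3 / 2 : ℝ))))
            = (ρ ^ 2)⁻¹ * ρ ^ 2 * (4 * (Cpol + Csw) * ρ ^ (3 / 2 : ℝ)) := by ring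
          _ = _ := by rw [hinv, one_mul]

end Main

section Wrappers

end Wrappers

section Bridge

/-- **`‖Df(x)‖² = (∂₀f)² + (∂₁f)² + (∂₂f)²` for a scalar `f` on `ℝ³`** (Riesz: `‖Df‖ = ‖∇f‖`, and
`norm_gradient_sq`): the bridge between the operator-norm form `‖∇(ζΦ)‖²` of (2.7) used here and the
coordinate form of the Step-3 files. [folklore]
[cite: Seregin2022LocalAxisym, §2 proof of Thm. 1.2, Step 4 (arXiv:2201.00153 pp. 4–7) (source of the ARGUMENT this module implements; this declaration is the cell’s own lemma or plumbing, NOT a printed statement)] -/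
theorem norm_fderiv_sq_eq_sum_sq (f : EuclideanSpace ℝ (Fin 3) → ℝ) (x : EuclideanSpace ℝ (Fin 3)) :
    ‖fderiv ℝ f x‖ ^ 2 = fderiv ℝ f x (EuclideanSpace.single 0 1) ^ 2 +
      fderiv ℝ f x (EuclideanSpace.single 1 1) ^ 2 + fderiv ℝ f x (EuclideanSpace.single 2 1) ^ 2 := by
  rw [← norm_gradient_sq, gradient, LinearIsometryEquiv.norm_map]

end Bridge

end Literature.Analysis.SereginLogSwirlOrigin.EulerScaling

end Part6

/-!
## Part 7 — port of `Summits/NavierStokesRegularity/NavierStokesRegularity/Theorems/AxisymmetricExtremalityAxisymmetricKatoGlobalStubSereginLogSwirlOriginStep1CutoffBcut.lean` (4 declarations kept)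

# Seregin 2022, §2 Step 1 ⇒ Step 3: the cut-off source constant `Bcut` (`A₁ + B₁`, `A₂ + B₂`
# of Step 3) for a time-independent cut-off, from sup-norm bounds of `v, D²v` on `supp ∇ζ` —
# crux stmt-NavierStokesRegularity-15453 (`AxisymmetricExtremality.AxisymmetricKatoGlobal`), line registered, support for stub `stub_sereginLogSwirlOrigin`

Support file (`--supports stmt-NavierStokesRegularity-15453`; theorems only, everything proved)
toward the registered stub `stub_sereginLogSwirlOrigin` = the named fact
`Literature.Analysis.FluidPDE.seregin2022_logSwirl_regularAtOrigin` (G. Seregin, J. Math. Fluid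
Mech. 24 (2022), Paper 27 = arXiv:2201.00153, §2).  The landed key estimate
(`cutoff_energy_keyEstimate_unconditional`, `…Step3KeyUnconditional.lean`) takes at every time
`t` of the slab the hypothesis `hcut`:

  `(2∫ζ ∂ₜζ Γ² + 2∫ζΓ² ∇ζ·v + 2ν∫Γ²|∇ζ|² − 4ν∫ζΓ² q_ζ) + (the same with Φ) ≤ Bcut`

(`Γ = angVortQuot (v t)`, `Φ = radVelQuot (curl (v t))`, `q_ζ = radDerivQuot ζ`, gradients in
coordinates), the integrated cut-off terms `A₁ + B₁ = ∫(Φ² + Γ²)Ψ`, `Ψ = ∂ₜη⁶ + Δη⁶`, and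
`A₂ + B₂ = ∫(v − 2x'/|x'|²)·∇η⁶ (Φ² + Γ²)` of Step 3 (arXiv p. 6), which the paper bounds by
"`C(v, η)`" using "`|Γ|² + |Φ|² ≤ |∇ω|²` and boundedness of `|∇ω|`" on `supp ∇η` and
"`(x'/|x'|²)·∇η = (1/|x'|)η,ᵣ ≤ C(η)`".  On the final slab the Step-1 cut-off is time
independent (`ξ = 1`), so `∂ₜζ = 0`; this file proves `hcut` for `ζ(t, ·) = ζ` from
`‖v‖ ≤ D₀`, `‖D²v‖ ≤ D₂` on a set `K ⊇ tsupport ∇ζ`, `‖∇ζ‖ ≤ Z₁`, `|q_ζ| ≤ Q₀`, `0 ≤ ζ ≤ 1`,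
`tsupport ζ ⊆ 𝒞 ⊆ B̄(0, 2)`, `|B̄(0,2)| ≤ V`, with

  `Bcut = 2 (2Z₁D₀ + 2νZ₁² + 4νQ₀)(κD₂)² V`     (`κ = ‖curlCLM‖`, `|Γ|, |Φ| ≤ κ‖D²v‖`):

* `abs_integral_le_of_forall_abs_le` — `|∫f| ≤ P·vol` for `|f| ≤ P` vanishing off `B̄(0, 2)`;
* `timeDerivWithin_const_eq_zero` — `∂ₜ` of a time-independent cut-off vanishes;
* `cut_group_le` — one group (`Γ` or `Φ` replaced by any `G` with `|G| ≤ B` on `K`);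
* `cut_bound` (registered sub-goal) — **`hcut` for the time-independent cut-off**.

## Mathlib / tree search

Tree: `norm_fderiv_sq_eq_sum_sq` (`…Step4Assembly`), `radDerivQuot_eq_zero_of_notMem_tsupport_fderiv`
(`…Step3KeyUnconditional`), `spaceCyl_subset_closedBall` (`…LerayLogHardy`), `norm_fderiv_curl_le`
(`TaoEnstrophyLocalisation`), `IsAxisymmetric.abs_angVortQuot_le_norm_fderiv_curl`,
`…abs_radVelQuot_curl_le_norm_fderiv_curl` (`AxisymQuotientBounds`). Mathlib:
`norm_setIntegral_le_of_norm_le_const`, `setIntegral_eq_integral_of_forall_compl_eq_zero`,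
`derivWithin_fun_const`, `image_eq_zero_of_notMem_tsupport`, `tsupport_fderiv_subset`.

## References

* G. Seregin, J. Math. Fluid Mech. 24 (2022), Paper No. 27 = arXiv:2201.00153, §2 Step 3
  (arXiv p. 6: `A₁ + B₁ ≤ C(v, η)`, `A₂ + B₂ ≤ C(v, η)`), Step 1 (p. 5, `ξ = 1` for `t ≥ -1/64`).
  [`Seregin2022LocalAxisym`]
-/

section Part7

open _root_.Set _root_.Filter _root_.Topology _root_.Function _root_.Metric _root_.MeasureTheory
open scoped _root_.ContDiff
open Literature.Analysis.FluidPDE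

namespace Literature.Analysis.SereginLogSwirlOrigin.EulerScaling

/-! ### Tools -/

section Tools

/-- **`|∫ f| ≤ P · |B̄(0,2)|`** for a real function with `|f| ≤ P` everywhere which vanishes off
the closed ball `B̄(0, 2)` (no integrability needed). [folklore]
[cite: Seregin2022LocalAxisym, §2 proof of Thm. 1.2, Step 1 (arXiv:2201.00153 pp. 4–7) (source of the ARGUMENT this module implements; this declaration is the cell’s own lemma or plumbing, NOT a printed statement)] -/
theorem abs_integral_le_of_forall_abs_le {f : EuclideanSpace ℝ (Fin 3) → ℝ} {P : ℝ}
    (hP : ∀ x, |f x| ≤ P) (h0 : ∀ x ∉ closedBall (0 : EuclideanSpace ℝ (Fin 3)) 2, f x = 0) :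
    |∫ x, f x| ≤ P * volume.real (closedBall (0 : EuclideanSpace ℝ (Fin 3)) 2) := by
  have h3 : ∫ x in closedBall (0 : EuclideanSpace ℝ (Fin 3)) 2, f x = ∫ x, f x :=
    setIntegral_eq_integral_of_forall_compl_eq_zero fun x hx => h0 x hx
  have h4 := norm_setIntegral_le_of_norm_le_const (μ := volume)
    (s := closedBall (0 : EuclideanSpace ℝ (Fin 3)) 2) (f := f) measure_closedBall_lt_top
    fun x _ => (show ‖f x‖ ≤ P by rw [Real.norm_eq_abs]; exact hP x)
  rwa [h3, Real.norm_eq_abs] at h4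

/-- **`∂ₜζ = 0` for a time-independent cut-off**: `timeDerivWithin S (fun _ => ζ) t x = 0`. [folklore]
[cite: Seregin2022LocalAxisym, §2 proof of Thm. 1.2, Step 1 (arXiv:2201.00153 pp. 4–7) (source of the ARGUMENT this module implements; this declaration is the cell’s own lemma or plumbing, NOT a printed statement)] -/
theorem timeDerivWithin_const_eq_zero (S : Set ℝ) (ζ : EuclideanSpace ℝ (Fin 3) → ℝ) (t : ℝ)
    (x : EuclideanSpace ℝ (Fin 3)) : timeDerivWithin S (fun _ : ℝ => ζ) t x = 0 := by
  rw [timeDerivWithin_apply, derivWithin_fun_const]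
  rfl

end Tools

/-! ### One group of `hcut` -/

section Group

variable {u : EuclideanSpace ℝ (Fin 3) → EuclideanSpace ℝ (Fin 3)} {ζ G : EuclideanSpace ℝ (Fin 3) → ℝ}
  {K : Set (EuclideanSpace ℝ (Fin 3))} {a b ν t D₀ Z₁ Q₀ V B : ℝ}

/-- **One group of the cut-off source** (`Γ` or `Φ` replaced by any `G` with `|G| ≤ B` on
`K ⊇ tsupport ∇ζ`, any real `B`): for a time-independent axisymmetric `ζ ∈ C²` with `0 ≤ ζ ≤ 1`,
`tsupport ζ ⊆ 𝒞`, `‖∇ζ‖ ≤ Z₁`, `|q_ζ| ≤ Q₀`, and `‖v‖ ≤ D₀` on `K`,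
`2∫ζ∂ₜζG² + 2∫ζG²∇ζ·v + 2ν∫G²|∇ζ|² − 4ν∫ζG²q_ζ ≤ (2Z₁D₀ + 2νZ₁² + 4νQ₀)B²V` (the first
integrand is zero; the others vanish off `tsupport ∇ζ ⊆ B̄(0,2)` and are bounded there by
`B²Z₁D₀`, `B²Z₁²`, `B²Q₀`). [cite: Seregin2022LocalAxisym, §2 Step 3 (arXiv:2201.00153 p. 6), A₁+B₁ and A₂+B₂ ≤ C(v,η)] -/
theorem cut_group_le (hζ : ContDiff ℝ 2 ζ) (hζax : IsAxisymmetricScalar ζ)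
    (hζ01 : ∀ x, 0 ≤ ζ x ∧ ζ x ≤ 1) (hζ1 : tsupport ζ ⊆ SereginSverak2009.spaceCyl 0 1)
    (hK : tsupport (fderiv ℝ ζ) ⊆ K) (hν : 0 ≤ ν) (hD₀ : 0 ≤ D₀) (hZ₁0 : 0 ≤ Z₁)
    (hQ₀0 : 0 ≤ Q₀) (hV : volume.real (closedBall (0 : EuclideanSpace ℝ (Fin 3)) 2) ≤ V)
    (hZ₁ : ∀ x, ‖fderiv ℝ ζ x‖ ≤ Z₁) (hQ₀ : ∀ x, |radDerivQuot ζ x| ≤ Q₀)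
    (h0 : ∀ x ∈ K, ‖u x‖ ≤ D₀) (hGB : ∀ x ∈ K, |G x| ≤ B) :
    2 * (∫ x, ζ x * timeDerivWithin (Ioo a b) (fun _ : ℝ => ζ) t x * G x ^ 2) +
      2 * (∫ x, ζ x * G x ^ 2 * fderiv ℝ ζ x (u x)) +
      2 * ν * (∫ x, G x ^ 2 * (fderiv ℝ ζ x (EuclideanSpace.single 0 1) ^ 2 +
        fderiv ℝ ζ x (EuclideanSpace.single 1 1) ^ 2 + fderiv ℝ ζ x (EuclideanSpace.single 2 1) ^ 2)) -
      4 * ν * (∫ x, ζ x * G x ^ 2 * radDerivQuot ζ x) ≤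
      (2 * (Z₁ * D₀) + 2 * ν * Z₁ ^ 2 + 4 * ν * Q₀) * B ^ 2 * V := by
  have hVOL : 0 ≤ volume.real (closedBall (0 : EuclideanSpace ℝ (Fin 3)) 2) := measureReal_nonneg
  set W : ℝ := volume.real (closedBall (0 : EuclideanSpace ℝ (Fin 3)) 2) with hW
  -- geometry: `tsupport ∇ζ ⊆ tsupport ζ ⊆ B̄(0,2)`
  have hT : tsupport (fderiv ℝ ζ) ⊆ closedBall (0 : EuclideanSpace ℝ (Fin 3)) 2 :=
    (tsupport_fderiv_subset ℝ).trans (hζ1.trans spaceCyl_subset_closedBall)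
  have hDζ0 : ∀ x ∉ closedBall (0 : EuclideanSpace ℝ (Fin 3)) 2, fderiv ℝ ζ x = 0 := fun x hx =>
    image_eq_zero_of_notMem_tsupport fun h => hx (hT h)
  have hq0 : ∀ x ∉ tsupport (fderiv ℝ ζ), radDerivQuot ζ x = 0 := fun x hx =>
    radDerivQuot_eq_zero_of_notMem_tsupport_fderiv hζ hζax hx
  have hζle : ∀ x, |ζ x| ≤ 1 := fun x => by rw [abs_of_nonneg (hζ01 x).1]; exact (hζ01 x).2
  have hB2 : ∀ x ∈ K, G x ^ 2 ≤ B ^ 2 := fun x hx => by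
    have h := hGB x hx
    rw [← sq_abs]
    exact pow_le_pow_left₀ (abs_nonneg _) h 2
  have hmemK : ∀ x, fderiv ℝ ζ x ≠ 0 → x ∈ K := fun x hx => hK (subset_tsupport _ (mem_support.2 hx))
  -- (1) the time-derivative term vanishes
  have h1 : (∫ x, ζ x * timeDerivWithin (Ioo a b) (fun _ : ℝ => ζ) t x * G x ^ 2) = 0 := by
    simp only [timeDerivWithin_const_eq_zero, mul_zero, zero_mul, integral_zero]
  -- (2) the drift term
  have h2 : |∫ x, ζ x * G x ^ 2 * fderiv ℝ ζ x (u x)| ≤ B ^ 2 * (Z₁ * D₀) * W := by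
    refine abs_integral_le_of_forall_abs_le (fun x => ?_) (fun x hx => by rw [hDζ0 x hx]; simp)
    by_cases hx : fderiv ℝ ζ x = 0
    · rw [hx]; simp; positivity
    · have hxK := hmemK x hx
      rw [abs_mul, abs_mul, abs_of_nonneg (sq_nonneg (G x))]
      have hd : |fderiv ℝ ζ x (u x)| ≤ Z₁ * D₀ := by
        rw [← Real.norm_eq_abs]
        exact ((fderiv ℝ ζ x).le_opNorm (u x)).trans (mul_le_mul (hZ₁ x) (h0 x hxK) (norm_nonneg _) hZ₁0)
      calc |ζ x| * G x ^ 2 * |fderiv ℝ ζ x (u x)| ≤ 1 * B ^ 2 * (Z₁ * D₀) :=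
            mul_le_mul (mul_le_mul (hζle x) (hB2 x hxK) (sq_nonneg _) zero_le_one) hd (abs_nonneg _)
              (by positivity)
        _ = B ^ 2 * (Z₁ * D₀) := by ring
  -- (3) the `|∇ζ|²` term
  have h3 : |∫ x, G x ^ 2 * (fderiv ℝ ζ x (EuclideanSpace.single 0 1) ^ 2 +
      fderiv ℝ ζ x (EuclideanSpace.single 1 1) ^ 2 + fderiv ℝ ζ x (EuclideanSpace.single 2 1) ^ 2)| ≤
      B ^ 2 * Z₁ ^ 2 * W := by
    refine abs_integral_le_of_forall_abs_le (fun x => ?_) (fun x hx => by rw [hDζ0 x hx]; simp)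
    rw [← norm_fderiv_sq_eq_sum_sq]
    by_cases hx : fderiv ℝ ζ x = 0
    · rw [hx]; simp; positivity
    · have hxK := hmemK x hx
      rw [abs_of_nonneg (by positivity)]
      exact mul_le_mul (hB2 x hxK) (pow_le_pow_left₀ (norm_nonneg _) (hZ₁ x) 2) (sq_nonneg _) (sq_nonneg _)
  -- (4) the radial-derivative term
  have h4 : |∫ x, ζ x * G x ^ 2 * radDerivQuot ζ x| ≤ B ^ 2 * Q₀ * W := by
    refine abs_integral_le_of_forall_abs_le (fun x => ?_) (fun x hx => by rw [hq0 x fun h => hx (hT h)]; simp)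
    by_cases hx : x ∈ tsupport (fderiv ℝ ζ)
    · have hxK := hK hx
      rw [abs_mul, abs_mul, abs_of_nonneg (sq_nonneg (G x))]
      calc |ζ x| * G x ^ 2 * |radDerivQuot ζ x| ≤ 1 * B ^ 2 * Q₀ :=
            mul_le_mul (mul_le_mul (hζle x) (hB2 x hxK) (sq_nonneg _) zero_le_one) (hQ₀ x) (abs_nonneg _)
              (by positivity)
        _ = B ^ 2 * Q₀ := by ring
    · rw [hq0 x hx]; simp; positivity
  -- assemble
  have hWV : B ^ 2 * (2 * (Z₁ * D₀) + 2 * ν * Z₁ ^ 2 + 4 * ν * Q₀) * W ≤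
      B ^ 2 * (2 * (Z₁ * D₀) + 2 * ν * Z₁ ^ 2 + 4 * ν * Q₀) * V :=
    mul_le_mul_of_nonneg_left hV (by positivity)
  rw [h1, mul_zero, zero_add]
  have e2 := (le_abs_self _).trans h2
  have e3 := (le_abs_self _).trans h3
  have e4 := (neg_le_abs _).trans h4
  nlinarith [mul_le_mul_of_nonneg_left e3 (by positivity : (0 : ℝ) ≤ 2 * ν),
    mul_le_mul_of_nonneg_left e4 (by positivity : (0 : ℝ) ≤ 4 * ν)]

end Group

/-! ### `hcut` for the time-independent cut-off -/

/-- **Seregin 2022, §2 Step 3, `A₁ + B₁ + A₂ + B₂ ≤ C(v, η)` on the final slab: the hypothesis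
`hcut` of `cutoff_energy_keyEstimate_unconditional` for a time-independent cut-off.** For one
slice: an axisymmetric `v ∈ C³`, an axisymmetric `ζ ∈ C²` with `0 ≤ ζ ≤ 1`, `tsupport ζ ⊆ 𝒞`,
`‖∇ζ‖ ≤ Z₁`, `|q_ζ| ≤ Q₀`, a set `K ⊇ tsupport ∇ζ` with `‖v‖ ≤ D₀`, `‖D²v‖ ≤ D₂` on `K`, `ν ≥ 0`,
`|B̄(0,2)| ≤ V`: the eight-integral expression of `hcut` (with `ζ(t, ·) = ζ`, `Γ = angVortQuot v`,
`Φ = radVelQuot (curl v)`, `|Γ|, |Φ| ≤ κ‖D²v‖ ≤ κD₂` on `K`) is at most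
`Bcut = 2(2Z₁D₀ + 2νZ₁² + 4νQ₀)(κD₂)²V`, `κ = ‖curlCLM‖`. Registered sub-goal toward
`stub_sereginLogSwirlOrigin`. [cite: Seregin2022LocalAxisym, §2 Step 3 (arXiv:2201.00153 p. 6), A₁+B₁ ≤ C(v,η), A₂+B₂ ≤ C(v,η)] -/
theorem cut_bound : ∀ (u : EuclideanSpace ℝ (Fin 3) → EuclideanSpace ℝ (Fin 3)) (ζ : EuclideanSpace ℝ (Fin 3) → ℝ) (K : Set (EuclideanSpace ℝ (Fin 3))) (a b ν t D₀ D₂ Z₁ Q₀ V : ℝ), ContDiff ℝ 3 u → IsAxisymmetric u → ContDiff ℝ 2 ζ → IsAxisymmetricScalar ζ → (∀ x, 0 ≤ ζ x ∧ ζ x ≤ 1) → tsupport ζ ⊆ SereginSverak2009.spaceCyl 0 1 → tsupport (fderiv ℝ ζ) ⊆ K → 0 ≤ ν → 0 ≤ D₀ → 0 ≤ D₂ → 0 ≤ Z₁ → 0 ≤ Q₀ → volume.real (closedBall (0 : EuclideanSpace ℝ (Fin 3)) 2) ≤ V → (∀ x, ‖fderiv ℝ ζ x‖ ≤ Z₁)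 → (∀ x, |radDerivQuot ζ x| ≤ Q₀) → (∀ x ∈ K, ‖u x‖ ≤ D₀) → (∀ x ∈ K, ‖iteratedFDeriv ℝ 2 u x‖ ≤ D₂) → (2 * (∫ x, ζ x * timeDerivWithin (Ioo a b) (fun _ : ℝ => ζ) t x * angVortQuot u x ^ 2) + 2 * (∫ x, ζ x * angVortQuot u x ^ 2 * fderiv ℝ ζ x (u x)) + 2 * ν * (∫ x, angVortQuot u x ^ 2 * (fderiv ℝ ζ x (EuclideanSpace.single 0 1) ^ 2 + fderiv ℝ ζ x (EuclideanSpace.single 1 1) ^ 2 + fderiv ℝ ζ x (EuclideanSpace.single 2 1) ^ 2)) - 4 * ν * (∫ x, ζ x * angVortQuot u x ^ 2 * radDerivQuot ζ x)) + (2 * (∫ x, ζ x * timeDerivWithin (Ioo a b) (fun _ : ℝ => ζ) t x * radVelQuot (curl u) x ^ 2) + 2 * (∫ x, ζ x * radVelQuot (curl u) x ^ 2 * fderiv ℝ ζ x (u x)) + 2 * ν * (∫ x, radVelQuot (curl u) x ^ 2 * (fderiv ℝ ζ x (EuclideanSpace.single 0 1) ^ 2 + fderiv ℝ ζ x (EuclideanSpace.single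 1 1) ^ 2 + fderiv ℝ ζ x (EuclideanSpace.single 2 1) ^ 2)) - 4 * ν * (∫ x, ζ x * radVelQuot (curl u) x ^ 2 * radDerivQuot ζ x)) ≤ 2 * ((2 * (Z₁ * D₀) + 2 * ν * Z₁ ^ 2 + 4 * ν * Q₀) * (‖curlCLM‖ * D₂) ^ 2 * V) := by
  intro u ζ K a b ν t D₀ D₂ Z₁ Q₀ V hu hax hζ hζax hζ01 hζ1 hK hν hD₀ hD₂ hZ₁0 hQ₀0 hV hZ₁ hQ₀ h0 h2
  have hu2 : ContDiff ℝ 2 u := hu.of_le (by norm_num)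
  have hω : ∀ x ∈ K, ‖fderiv ℝ (curl u) x‖ ≤ ‖curlCLM‖ * D₂ := fun x hx =>
    (norm_fderiv_curl_le hu2 x).trans (mul_le_mul_of_nonneg_left (h2 x hx) (norm_nonneg curlCLM))
  have hΓ : ∀ x ∈ K, |angVortQuot u x| ≤ ‖curlCLM‖ * D₂ := fun x hx =>
    (hax.abs_angVortQuot_le_norm_fderiv_curl hu x).trans (hω x hx)
  have hΦ : ∀ x ∈ K, |radVelQuot (curl u) x| ≤ ‖curlCLM‖ * D₂ := fun x hx =>
    (hax.abs_radVelQuot_curl_le_norm_fderiv_curl hu x).trans (hω x hx)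
  have gΓ := cut_group_le (a := a) (b := b) (t := t) hζ hζax hζ01 hζ1 hK hν hD₀ hZ₁0 hQ₀0 hV hZ₁ hQ₀ h0 hΓ
  have gΦ := cut_group_le (a := a) (b := b) (t := t) hζ hζax hζ01 hζ1 hK hν hD₀ hZ₁0 hQ₀0 hV hZ₁ hQ₀ h0 hΦ
  linarith

end Literature.Analysis.SereginLogSwirlOrigin.EulerScaling

end Part7

/-!
## Part 8 — port of `Summits/NavierStokesRegularity/NavierStokesRegularity/Theorems/AxisymmetricExtremalityAxisymmetricKatoGlobalStubSereginLogSwirlOriginStep1CutoffCompact.lean` (4 declarations kept)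

# Seregin 2022, §2 Step 1: uniform bounds on the regular region by compactness, and the
# energy class / the swirl bound (2.2) for the continuous representative —
# crux stmt-NavierStokesRegularity-15453 (`AxisymmetricExtremality.AxisymmetricKatoGlobal`), line registered, support for stub `stub_sereginLogSwirlOrigin`

Support file (`--supports stmt-NavierStokesRegularity-15453`; theorems only, everything proved)
toward the registered stub `stub_sereginLogSwirlOrigin` = the named fact
`Literature.Analysis.FluidPDE.seregin2022_logSwirl_regularAtOrigin` (G. Seregin, J. Math. Fluid
Mech. 24 (2022), Paper 27 = arXiv:2201.00153, §2).  Step 1 (arXiv p. 5) passes from "regular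
points" to "`v ∈ C([-δ², 0]; C³(𝒞̄((0, h₁), δ)))` … In the set `supp |∇η|`, functions `v`, `∇v`,
and `∇²v` are bounded", i.e. from local derivative bounds on a backward cylinder at each regular
top-slice point to bounds that are UNIFORM on the compact set `supp ∇η` up to the top time; and
it silently replaces the suitable weak solution by its continuous representative in the energy
class and in (2.2) ("Without loss of generality, we may assume also that (2.2) holds in `𝒞`").
In the tree's reduction (`seregin2022_logSwirl_regularAtOrigin_of_cleanRepr`, `…FinalReduction`)
the core hypothesis at `(0, 1)` gives a representative `V` (`IsSmoothAxisymmetricSolutionOn` on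
`Q = 𝒞 × ]-1, 0[`, `v = V` a.e.) and, at every top-slice point `a ∈ 𝒞` off the axis or in the
two strips, a radius `ρ > 0` with `‖D_xⁿV‖ ≤ Cₙ` on `Q((0, a), ρ)`.  This file proves:

* `exists_uniform_bound_of_cylinders` — **compactness**: if every point `a` of a compact `K`
  has `ρ_a > 0` and `C_a` with `‖D_xⁿV‖ ≤ C_a` on the backward cylinder `Q((0, a), ρ_a)`, then
  for some `ρ > 0`, `C`: `‖D_xⁿV(t, x)‖ ≤ C` for all `t ∈ ]-ρ², 0[`, `x ∈ K`;
* `exists_uniform_derivBounds` (registered sub-goal) — the same for `n = 0, 1, 2` at once, in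
  the form `‖V t x‖ ≤ D₀`, `‖D(V t)(x)‖ ≤ D₁`, `‖D²(V t)(x)‖ ≤ D₂` consumed by
  `step3_pointwiseConstants` / `cut_bound` (`…Step1CutoffConstants`, `…Step1CutoffBcut`);
* `le_of_ae_le_of_continuousOn` — a continuous inequality valid a.e. on an open set holds
  everywhere on it (any measure charging open sets);
* `swirl_bound_repr` — **(2.2) for the representative**: the swirl bound of `v` on
  `𝒞 × ]-1, 0[` off the axis passes to the continuous `V` (`v = V` a.e.);
* `exists_seq_tendsto_of_ae` — an a.e. property on `]-1, 0[` holds along a sequence tending to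
  any prescribed time;
* `energy_bound_repr` — **the energy class for the representative at every time**: from
  `sup ess_t ∫_𝒞 |v|² ≤ C` and `v = V` a.e. to `∫_𝒞 |V(t)|² ≤ C` for EVERY `t ∈ ]-1, 0[`
  (Fubini for the a.e. identity, then Fatou along a sequence of good times and continuity of
  `V` on `Q`), the hypothesis `hA` of `isRegularAtOrigin_of_step3Bounds`;
* `aestronglyMeasurable_repr` — measurability of `V` on the sub-cylinders `Q(r)`.

## Mathlib / tree search

Tree: `IsSmoothAxisymmetricSolutionOn.continuousOn_velocity` (`SereginZajaczkowski2007`),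
`SereginSverak2009.mem_parCyl_zero`, `mem_spaceCyl`, `isOpen_parCyl`, `parCyl_mono`
(`SereginSverakAxisymmetric`), `parabolicCylinder`, `mem_parabolicCylinder` (`SuitableWeak`).
Mathlib: `IsCompact.elim_finite_subcover`, `Finset.exists_min_image`, `Measure.ae_ae_of_ae_prod`,
`Measure.prod_restrict`, `Measure.volume_eq_prod`, `lintegral_liminf_le'`, `IsOpen.measure_pos`,
`Tendsto.liminf_eq`, `LocallyIntegrableOn.aestronglyMeasurable`.

## References

* G. Seregin, J. Math. Fluid Mech. 24 (2022), Paper No. 27 = arXiv:2201.00153, §2 Step 1 (arXiv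
  p. 5). [`Seregin2022LocalAxisym`]

Not carried from this source module (not needed by the declarations re-homed here; their consumers are Summits-side): `le_of_ae_le_of_continuousOn`, `ae_ae_eq_of_ae_eq_parCyl`, `swirl_bound_repr`, `exists_seq_tendsto_of_ae`, `energy_bound_repr`.
-/

section Part8

open _root_.Set _root_.Filter _root_.Topology _root_.Function _root_.Metric _root_.MeasureTheory
open scoped _root_.ENNReal _root_.NNReal
open Literature.Analysis.FluidPDE

namespace Literature.Analysis.SereginLogSwirlOrigin.EulerScaling

/-! ### Compactness: uniform bounds on the regular region up to the top time -/

section Compact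

variable {F : Type*} [NormedAddCommGroup F]

/-- **From cylinders at every point to a uniform slab** (Step 1: "`v ∈ C([-δ², 0]; C³(𝒞̄(…, δ)))`"
and boundedness "in space-time" on `supp |∇η|`): if `K ⊆ ℝ³` is compact and every `a ∈ K` admits
`ρ > 0`, `C` with `‖Φ(t, x)‖ ≤ C` on the backward cylinder `Q((0, a), ρ) = ]-ρ², 0[ × B(a, ρ)`,
then for some `ρ > 0` and `C`, `‖Φ(t, x)‖ ≤ C` for all `t ∈ ]-ρ², 0[` and `x ∈ K` (finite
subcover by the balls `B(a, ρ_a)`, minimum radius, maximum constant). [cite: Seregin2022LocalAxisym, §2 Step 1 (arXiv:2201.00153 p. 5), boundedness in space-time on supp|∇η|] -/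
theorem exists_uniform_bound_of_cylinders {Φ : ℝ → EuclideanSpace ℝ (Fin 3) → F}
    {K : Set (EuclideanSpace ℝ (Fin 3))} (hK : IsCompact K)
    (h : ∀ a ∈ K, ∃ ρ > 0, ∃ C : ℝ, ∀ w ∈ parabolicCylinder ρ ((0 : ℝ), a), ‖Φ w.1 w.2‖ ≤ C) :
    ∃ ρ > 0, ∃ C : ℝ, ∀ t ∈ Ioo (-ρ ^ 2) 0, ∀ x ∈ K, ‖Φ t x‖ ≤ C := by
  choose! ρ hρ C hC using h
  -- finite subcover of `K` by the balls `B(a, ρ a)`, `a ∈ K`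
  obtain ⟨s, hs⟩ := hK.elim_finite_subcover (fun a : K => ball (a : EuclideanSpace ℝ (Fin 3)) (ρ a))
    (fun _ => isOpen_ball) fun x hx => mem_iUnion.2 ⟨⟨x, hx⟩, mem_ball_self (hρ x hx)⟩
  by_cases hse : s.Nonempty
  · obtain ⟨a₀, ha₀, hmin⟩ := s.exists_min_image (fun a : K => ρ a) hse
    refine ⟨ρ a₀, hρ a₀ a₀.2, ∑ a ∈ s, |C a|, fun t ht x hx => ?_⟩
    obtain ⟨a, ha, hxa⟩ : ∃ a ∈ s, x ∈ ball (a : EuclideanSpace ℝ (Fin 3)) (ρ a) := by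
      simpa only [mem_iUnion, exists_prop] using hs hx
    have hw : ((t, x) : ℝ × EuclideanSpace ℝ (Fin 3)) ∈ parabolicCylinder (ρ a) ((0 : ℝ), (a : EuclideanSpace ℝ (Fin 3))) := by
      rw [mem_parabolicCylinder]
      refine ⟨⟨?_, ht.2⟩, mem_ball.1 hxa⟩
      have h1 : ρ a₀ ^ 2 ≤ ρ a ^ 2 := pow_le_pow_left₀ (hρ a₀ a₀.2).le (hmin a ha) 2
      have h2 := ht.1
      simp only [zero_sub]
      linarith
    calc ‖Φ t x‖ ≤ C a := hC a a.2 (t, x) hw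
      _ ≤ |C a| := le_abs_self _
      _ ≤ ∑ b ∈ s, |C b| :=
          Finset.single_le_sum (s := s) (f := fun b : K => |C (b : EuclideanSpace ℝ (Fin 3))|)
            (fun b _ => abs_nonneg _) ha
  · have hKe : K = ∅ := by
      refine eq_empty_iff_forall_notMem.2 fun x hx => ?_
      have := hs hx
      simp only [mem_iUnion, exists_prop] at this
      obtain ⟨a, ha, -⟩ := this
      exact hse ⟨a, ha⟩
    exact ⟨1, one_pos, 0, fun t _ x hx => by simp [hKe] at hx⟩

/-- **Uniform bounds of `V, DV, D²V` on the regular region up to the top time.** If `K ⊆ ℝ³`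
is compact and every `a ∈ K` has `ρ > 0` such that for every order `n` the spatial derivative
`D_xⁿV` is bounded on `Q((0, a), ρ)` (the core hypothesis of
`seregin2022_logSwirl_regularAtOrigin_of_cleanRepr` at a regular top-slice point), then for some
`ρ > 0` and `D₀, D₁, D₂ ≥ 0`: `‖V t x‖ ≤ D₀`, `‖D(V t)(x)‖ ≤ D₁`, `‖D²(V t)(x)‖ ≤ D₂` for all
`t ∈ ]-ρ², 0[`, `x ∈ K` — the inputs of `step3_pointwiseConstants` and `cut_bound`, uniform on
the final slab. Registered sub-goal toward `stub_sereginLogSwirlOrigin`. [cite: Seregin2022LocalAxisym, §2 Step 1 (arXiv:2201.00153 p. 5), "In the set supp|∇η|, functions v, ∇v, and ∇²v are bounded"] -/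
theorem exists_uniform_derivBounds : ∀ (V : ℝ → EuclideanSpace ℝ (Fin 3) → EuclideanSpace ℝ (Fin 3)) (K : Set (EuclideanSpace ℝ (Fin 3))), IsCompact K → (∀ a ∈ K, ∃ ρ > 0, ∀ n : ℕ, ∃ C : ℝ, ∀ w ∈ parabolicCylinder ρ ((0 : ℝ), a), ‖iteratedFDeriv ℝ n (V w.1) w.2‖ ≤ C) → ∃ ρ > 0, ∃ D₀ D₁ D₂ : ℝ, 0 ≤ D₀ ∧ 0 ≤ D₁ ∧ 0 ≤ D₂ ∧ ∀ t ∈ Ioo (-ρ ^ 2) 0, ∀ x ∈ K, ‖V t x‖ ≤ D₀ ∧ ‖fderiv ℝ (V t) x‖ ≤ D₁ ∧ ‖iteratedFDeriv ℝ 2 (V t) x‖ ≤ D₂ := by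
  intro V K hK h
  have hn : ∀ n : ℕ, ∀ a ∈ K, ∃ ρ > 0, ∃ C : ℝ, ∀ w ∈ parabolicCylinder ρ ((0 : ℝ), a),
      ‖iteratedFDeriv ℝ n (V w.1) w.2‖ ≤ C := fun n a ha => by
    obtain ⟨ρ, hρ, hC⟩ := h a ha
    obtain ⟨C, hC⟩ := hC n
    exact ⟨ρ, hρ, C, hC⟩
  obtain ⟨ρ₀, hρ₀, C₀, h0⟩ := exists_uniform_bound_of_cylinders (Φ := fun t x => iteratedFDeriv ℝ 0 (V t) x) hK (hn 0)
  obtain ⟨ρ₁, hρ₁, C₁, h1⟩ := exists_uniform_bound_of_cylinders (Φ := fun t x => iteratedFDeriv ℝ 1 (V t) x) hK (hn 1)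
  obtain ⟨ρ₂, hρ₂, C₂, h2⟩ := exists_uniform_bound_of_cylinders (Φ := fun t x => iteratedFDeriv ℝ 2 (V t) x) hK (hn 2)
  set ρ : ℝ := min ρ₀ (min ρ₁ ρ₂) with hρdef
  have hρ : 0 < ρ := lt_min hρ₀ (lt_min hρ₁ hρ₂)
  have hsub : ∀ {ρ' : ℝ}, ρ ≤ ρ' → Ioo (-ρ ^ 2) 0 ⊆ Ioo (-ρ' ^ 2) (0 : ℝ) := fun {ρ'} hle t ht =>
    ⟨by nlinarith [ht.1, pow_le_pow_left₀ hρ.le hle 2], ht.2⟩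
  refine ⟨ρ, hρ, max C₀ 0, max C₁ 0, max C₂ 0, le_max_right _ _, le_max_right _ _, le_max_right _ _,
    fun t ht x hx => ⟨?_, ?_, ?_⟩⟩
  · have := h0 t (hsub (min_le_left _ _) ht) x hx
    rw [norm_iteratedFDeriv_zero] at this
    exact this.trans (le_max_left _ _)
  · have := h1 t (hsub ((min_le_right _ _).trans (min_le_left _ _)) ht) x hx
    rw [norm_iteratedFDeriv_one] at this
    exact this.trans (le_max_left _ _)
  · exact (h2 t (hsub ((min_le_right _ _).trans (min_le_right _ _)) ht) x hx).trans (le_max_left _ _)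

end Compact

/-! ### A.e. inequalities for continuous functions on open sets -/

section AE

end AE

/-! ### (2.2) and the energy class for the representative -/

section Repr

variable {v V : ℝ → EuclideanSpace ℝ (Fin 3) → EuclideanSpace ℝ (Fin 3)} {q : ℝ → EuclideanSpace ℝ (Fin 3) → ℝ}

/-- `Q = Q(0, 1)` is the product `]-1, 0[ × 𝒞`. [folklore]
[cite: Seregin2022LocalAxisym, §2 proof of Thm. 1.2, Step 1 (arXiv:2201.00153 pp. 4–7) (source of the ARGUMENT this module implements; this declaration is the cell’s own lemma or plumbing, NOT a printed statement)] -/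
theorem parCyl_zero_one_eq_prod :
    SereginSverak2009.parCyl (0 : ℝ × EuclideanSpace ℝ (Fin 3)) 1 =
      Ioo (-1 : ℝ) 0 ×ˢ SereginSverak2009.spaceCyl (0 : EuclideanSpace ℝ (Fin 3)) 1 := by
  ext z
  rw [SereginSverak2009.mem_parCyl_zero, mem_prod, SereginSverak2009.mem_spaceCyl, sub_zero, one_pow]
  simp

/-- **Measurability of the representative on the sub-cylinders** `Q(r) ⊆ Q`, `0 ≤ r ≤ 1` (the
hypothesis of `cubicC_le_of_twoSeven`), from the suitable weak class of `V` on `Q`. [folklore]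
[cite: Seregin2022LocalAxisym, §2 proof of Thm. 1.2, Step 1 (arXiv:2201.00153 pp. 4–7) (source of the ARGUMENT this module implements; this declaration is the cell’s own lemma or plumbing, NOT a printed statement)] -/
theorem aestronglyMeasurable_repr (hV : SereginZajaczkowski2007.IsSmoothAxisymmetricSolutionOn
      (SereginSverak2009.parCylOpens 0 1) V q) {r : ℝ} (hr : 0 ≤ r) (hr1 : r ≤ 1) :
    AEStronglyMeasurable (uncurry V) (volume.restrict (SereginSverak2009.parCyl (0 : ℝ × EuclideanSpace ℝ (Fin 3)) r)) :=
  hV.suitable.distributional.1.aestronglyMeasurable.mono_measure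
    (Measure.restrict_mono ((SereginSverak2009.parCyl_mono 0 hr hr1).trans
      (subset_of_eq (SereginSverak2009.coe_parCylOpens 0 1).symm)) le_rfl)

end Repr

end Literature.Analysis.SereginLogSwirlOrigin.EulerScaling

end Part8

/-!
## Part 9 — port of `Summits/NavierStokesRegularity/NavierStokesRegularity/Theorems/AxisymmetricExtremalityAxisymmetricKatoGlobalStubSereginLogSwirlOriginStep4AssemblyKeyEstimate.lean` (6 declarations kept)

# Seregin 2022, §2 Step 4 (assembly, V): composition with the landed Step-3 key estimate —
# from `∫(ζΓ)² + ∫(ζΦ)² ≤ K`, `∫_{t₁}^{t₂}(∫|∇(ζΓ)|² + ∫|∇(ζΦ)|²) ≤ K'` to `C(R) → 0` —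
# crux stmt-NavierStokesRegularity-15453 (`AxisymmetricExtremality.AxisymmetricKatoGlobal`), line registered, support for stub `stub_sereginLogSwirlOrigin`

Support file (`--supports stmt-NavierStokesRegularity-15453`; theorems only, everything proved)
toward the registered stub `stub_sereginLogSwirlOrigin` = the named fact
`Literature.Analysis.FluidPDE.seregin2022_logSwirl_regularAtOrigin` (G. Seregin, J. Math. Fluid
Mech. 24 (2022), Paper 27 = arXiv:2201.00153, §2).  Fifth file of the Step-4 assembly.  The Step-3
key estimate is in tree (`cutoff_energy_keyEstimate_of_lemma21`, `…Step3KeyEstimate.lean`) with the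
conclusion, for `[t₁, t₂]` inside the open slab,
`∫(ζΓ)²(t) + ∫(ζΦ)²(t) ≤ K` on `[t₁, t₂]` and `∫_{t₁}^{t₂}(∫|∇(ζΓ)|² + ∫|∇(ζΦ)|²) ≤ K'` —
Bochner integrals, gradients in coordinates `(∂₀·)² + (∂₁·)² + (∂₂·)²`, interval time integral
(`Γ = angVortQuot`, `Φ = radVelQuot ∘ curl`, `ζ = η³`).  The Step-4 assembly
(`cubicC_le_of_twoSeven`, `…Step4Assembly.lean`) consumes the same quantities as `ℝ≥0∞` lower
integrals with the operator norm of `D(ζΦ)` and the time integral over the whole final slab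
`]t₁, 0[`.  This file bridges the two forms (on the final slab `ξ = 1`, so `ζ` is constant in time):

* `lintegral_enorm_sq_eq_ofReal_integral_sq`, `lintegral_enorm_fderiv_sq_eq_ofReal_integral` —
  `∫⁻‖f‖ₑ² = ofReal ∫f²`, `∫⁻‖Df‖ₑ² = ofReal ∫((∂₀f)² + (∂₁f)² + (∂₂f)²)` for `C¹_c` scalars
  (`norm_fderiv_sq_eq_sum_sq`);
* `setLIntegral_Ioo_ofReal_le_of_forall_intervalIntegral_le` — interval bounds
  `∫_{t₁}^{t₂}(E + D) ≤ K'` for all `t₂ < 0`, with `D, E ≥ 0` continuous on `[t₁, 0[`, give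
  `∫⁻_{]t₁,0[} ofReal D ≤ ofReal K'` (exhaustion `]t₁, 0[ = ⋃ₙ ]t₁, t₁/(n+2)]`,
  `setLIntegral_iUnion_of_directed`);
* `lintegral_enorm_sq_le_of_keyEstimate_sup` — the `sup` terms;
* `cubicC_le_of_keyEstimate` (registered) — **Step-3 key-estimate outputs ⇒ `C(R) ≤ C R^{3/2}`** on
  `]0, min(r₁, √|t₁|)]`, in the classical-on-a-slab setting of `cubicC_le_of_twoSeven`, the only
  extra input being the continuity on `[t₁, 0[` of the two dissipation densities
  `s ↦ ∫|∇(ζΓ)(s)|²`, `s ↦ ∫|∇(ζΦ)(s)|²` (which the Step-3 files obtain from joint smoothness,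
  `continuousOn_integral_cutoff`, `…Step3Balance.lean`);
* `tendsto_cubicC_of_keyEstimate` (registered) — hence `SereginSverak2009.cubicC 0 R v → 0` as
  `R → 0⁺`, the hypothesis of the landed endgame `isRegularAtOrigin_of_tendsto_cubicC`.

## References

* G. Seregin, J. Math. Fluid Mech. 24 (2022), Paper No. 27 = arXiv:2201.00153, §2 Step 3 (key
  estimate, arXiv p. 7) and Step 4 (arXiv p. 7). [`Seregin2022LocalAxisym`]
-/

section Part9

open _root_.Set _root_.MeasureTheory _root_.Filter _root_.Topology _root_.Function _root_.Metric
open scoped _root_.ENNReal _root_.NNReal RealInnerProductSpace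
open Literature.Analysis.FluidPDE

namespace Literature.Analysis.SereginLogSwirlOrigin.EulerScaling

/-! ### From the Step-3 key estimate (Bochner integrals, coordinate gradients, interval time
integrals) to the `ℝ≥0∞` form (2.7) consumed by `cubicC_le_of_twoSeven` -/

section KeyEstimateForm

/-- `∫ ‖f‖ₑ² = ofReal (∫ f²)` for a continuous compactly supported real function. [folklore]
[cite: Seregin2022LocalAxisym, §2 proof of Thm. 1.2, Step 4 (arXiv:2201.00153 pp. 4–7) (source of the ARGUMENT this module implements; this declaration is the cell’s own lemma or plumbing, NOT a printed statement)] -/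
theorem lintegral_enorm_sq_eq_ofReal_integral_sq {f : EuclideanSpace ℝ (Fin 3) → ℝ}
    (hf : Continuous f) (hfc : HasCompactSupport f) :
    ∫⁻ x, ‖f x‖ₑ ^ 2 = ENNReal.ofReal (∫ x, f x ^ 2) := by
  have h2 : HasCompactSupport fun x => f x ^ 2 :=
    hfc.mono fun x hx => by
      rw [mem_support] at hx ⊢
      exact fun h => hx (by rw [h]; ring)
  have hi : Integrable (fun x => f x ^ 2) := (hf.pow 2).integrable_of_hasCompactSupport h2
  rw [ofReal_integral_eq_lintegral_ofReal hi (ae_of_all _ fun x => sq_nonneg _)]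
  refine lintegral_congr fun x => ?_
  rw [Real.enorm_eq_ofReal_abs, ← ENNReal.ofReal_pow (abs_nonneg _), sq_abs]

/-- `∫ ‖Df‖ₑ² = ofReal (∫ (∂₀f)² + (∂₁f)² + (∂₂f)²)` for a `C¹` compactly supported real function on
`ℝ³` (`norm_fderiv_sq_eq_sum_sq`). [folklore]
[cite: Seregin2022LocalAxisym, §2 proof of Thm. 1.2, Step 4 (arXiv:2201.00153 pp. 4–7) (source of the ARGUMENT this module implements; this declaration is the cell’s own lemma or plumbing, NOT a printed statement)] -/
theorem lintegral_enorm_fderiv_sq_eq_ofReal_integral {f : EuclideanSpace ℝ (Fin 3) → ℝ}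
    (hf : ContDiff ℝ 1 f) (hfc : HasCompactSupport f) :
    ∫⁻ x, ‖fderiv ℝ f x‖ₑ ^ 2 = ENNReal.ofReal (∫ x, (fderiv ℝ f x (EuclideanSpace.single 0 1) ^ 2 +
      fderiv ℝ f x (EuclideanSpace.single 1 1) ^ 2 + fderiv ℝ f x (EuclideanSpace.single 2 1) ^ 2)) := by
  have hD : Continuous (fderiv ℝ f) := hf.continuous_fderiv one_ne_zero
  have hsq : ∀ i : Fin 3, Integrable fun x => fderiv ℝ f x (EuclideanSpace.single i 1) ^ 2 := fun i => by
    have hci : Continuous fun x => fderiv ℝ f x (EuclideanSpace.single i 1) := hD.clm_apply continuous_const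
    have hsi : HasCompactSupport fun x => fderiv ℝ f x (EuclideanSpace.single i 1) ^ 2 :=
      (hfc.fderiv_apply (𝕜 := ℝ) (EuclideanSpace.single i 1)).mono fun x hx => by
        rw [mem_support] at hx ⊢
        exact fun h => hx (by rw [h]; ring)
    exact (hci.pow 2).integrable_of_hasCompactSupport hsi
  have hi : Integrable fun x => fderiv ℝ f x (EuclideanSpace.single 0 1) ^ 2 +
      fderiv ℝ f x (EuclideanSpace.single 1 1) ^ 2 + fderiv ℝ f x (EuclideanSpace.single 2 1) ^ 2 :=
    ((hsq 0).add (hsq 1)).add (hsq 2)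
  rw [ofReal_integral_eq_lintegral_ofReal hi (ae_of_all _ fun x => by positivity)]
  refine lintegral_congr fun x => ?_
  rw [← ofReal_norm, ← ENNReal.ofReal_pow (norm_nonneg _), norm_fderiv_sq_eq_sum_sq]

/-- **From interval bounds to the `ℝ≥0∞` time integral over the final slab**: if `D, E ≥ 0` are
continuous on `[t₁, 0[` and `∫_{t₁}^{t₂} (E + D) ≤ K'` for every `t₂ ∈ ]t₁, 0[` (the shape of the
Step-3 dissipation bound, uniform in `t₂`), then `∫⁻_{]t₁,0[} ofReal D ≤ ofReal K'` (monotone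
exhaustion `]t₁, 0[ = ⋃ₙ ]t₁, t₁/(n+2)]`). [folklore]
[cite: Seregin2022LocalAxisym, §2 proof of Thm. 1.2, Step 4 (arXiv:2201.00153 pp. 4–7) (source of the ARGUMENT this module implements; this declaration is the cell’s own lemma or plumbing, NOT a printed statement)] -/
theorem setLIntegral_Ioo_ofReal_le_of_forall_intervalIntegral_le {D E : ℝ → ℝ} {t₁ K' : ℝ}
    (ht₁ : t₁ < 0) (hDc : ContinuousOn D (Ico t₁ 0)) (hEc : ContinuousOn E (Ico t₁ 0))
    (hD0 : ∀ t ∈ Ico t₁ 0, 0 ≤ D t) (hE0 : ∀ t ∈ Ico t₁ 0, 0 ≤ E t)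
    (h : ∀ t₂ ∈ Ioo t₁ 0, ∫ s in t₁..t₂, (E s + D s) ≤ K') :
    ∫⁻ t in Ioo t₁ 0, ENNReal.ofReal (D t) ≤ ENNReal.ofReal K' := by
  -- the exhaustion `u n = t₁/(n+2) ↑ 0`
  set u : ℕ → ℝ := fun n => t₁ / (n + 2) with hu
  have hu_mem : ∀ n, u n ∈ Ioo t₁ 0 := fun n => by
    have hn : (2 : ℝ) ≤ n + 2 := by have := (Nat.cast_nonneg n : (0 : ℝ) ≤ n); linarith
    refine ⟨?_, div_neg_of_neg_of_pos ht₁ (by linarith)⟩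
    rw [lt_div_iff₀ (by linarith)]
    nlinarith
  have hmono : Monotone fun n => Ioc t₁ (u n) := by
    intro m n hmn
    refine Ioc_subset_Ioc_right (?_ : t₁ / (m + 2) ≤ t₁ / (n + 2))
    have hm2 : (0 : ℝ) < m + 2 := by have := (Nat.cast_nonneg m : (0 : ℝ) ≤ m); linarith
    have hn2 : (0 : ℝ) < n + 2 := by have := (Nat.cast_nonneg n : (0 : ℝ) ≤ n); linarith
    have hmn' : (m : ℝ) + 2 ≤ n + 2 := by have := (Nat.cast_le.2 hmn : (m : ℝ) ≤ n); linarith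
    rw [div_le_div_iff₀ hm2 hn2]
    nlinarith
  have hcover : Ioo t₁ 0 ⊆ ⋃ n, Ioc t₁ (u n) := by
    intro t ht
    obtain ⟨n, hn⟩ := exists_nat_ge (t₁ / t)
    refine mem_iUnion.2 ⟨n, ht.1, ?_⟩
    show t ≤ t₁ / (n + 2)
    rw [le_div_iff₀ (by have := (Nat.cast_nonneg n : (0 : ℝ) ≤ n); linarith)]
    have ht0 : t < 0 := ht.2
    have h1 : (n : ℝ) * t ≤ t₁ := (div_le_iff_of_neg ht0).1 hn
    nlinarith
  -- each truncated integral is `≤ K'`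
  have hpiece : ∀ n, ∫⁻ t in Ioc t₁ (u n), ENNReal.ofReal (D t) ≤ ENNReal.ofReal K' := by
    intro n
    have hsubI : Icc t₁ (u n) ⊆ Ico t₁ 0 := fun t ht => ⟨ht.1, ht.2.trans_lt (hu_mem n).2⟩
    have hint : IntegrableOn (fun s => E s + D s) (Ioc t₁ (u n)) :=
      (((hEc.mono hsubI).add (hDc.mono hsubI)).integrableOn_Icc).mono_set Ioc_subset_Icc_self
    calc ∫⁻ t in Ioc t₁ (u n), ENNReal.ofReal (D t)
        ≤ ∫⁻ t in Ioc t₁ (u n), ENNReal.ofReal (E t + D t) :=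
          setLIntegral_mono' measurableSet_Ioc fun t ht => ENNReal.ofReal_le_ofReal
            (le_add_of_nonneg_left (hE0 t ⟨ht.1.le, ht.2.trans_lt (hu_mem n).2⟩))
      _ = ENNReal.ofReal (∫ t in Ioc t₁ (u n), (E t + D t)) := by
          rw [ofReal_integral_eq_lintegral_ofReal hint]
          refine (ae_restrict_iff' measurableSet_Ioc).2 (ae_of_all _ fun t ht => ?_)
          have ht' : t ∈ Ico t₁ 0 := ⟨ht.1.le, ht.2.trans_lt (hu_mem n).2⟩
          exact add_nonneg (hE0 t ht') (hD0 t ht')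
      _ = ENNReal.ofReal (∫ s in t₁..u n, (E s + D s)) := by
          rw [intervalIntegral.integral_of_le (hu_mem n).1.le]
      _ ≤ ENNReal.ofReal K' := ENNReal.ofReal_le_ofReal (h (u n) (hu_mem n))
  calc ∫⁻ t in Ioo t₁ 0, ENNReal.ofReal (D t)
      ≤ ∫⁻ t in ⋃ n, Ioc t₁ (u n), ENNReal.ofReal (D t) := lintegral_mono_set hcover
    _ = ⨆ n, ∫⁻ t in Ioc t₁ (u n), ENNReal.ofReal (D t) :=
        setLIntegral_iUnion_of_directed _ hmono.directed_le
    _ ≤ ENNReal.ofReal K' := iSup_le hpiece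

variable {v : ℝ → EuclideanSpace ℝ (Fin 3) → EuclideanSpace ℝ (Fin 3)} {ζ : EuclideanSpace ℝ (Fin 3) → ℝ}

/-- **The `sup` terms of the key estimate in `ℝ≥0∞` form**: from
`∫(ζΓ)² + ∫(ζΦ)² ≤ K` (Bochner integrals, `Γ = angVortQuot`, `Φ = radVelQuot ∘ curl` of a `C⁴` slice,
`ζ ∈ C²` compactly supported) to `∫⁻‖ζΓ‖ₑ² ≤ ofReal K` and `∫⁻‖ζΦ‖ₑ² ≤ ofReal K`. [folklore]
[cite: Seregin2022LocalAxisym, §2 proof of Thm. 1.2, Step 4 (arXiv:2201.00153 pp. 4–7) (source of the ARGUMENT this module implements; this declaration is the cell’s own lemma or plumbing, NOT a printed statement)] -/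
theorem lintegral_enorm_sq_le_of_keyEstimate_sup {u : EuclideanSpace ℝ (Fin 3) → EuclideanSpace ℝ (Fin 3)}
    {K : ℝ} (hu : ContDiff ℝ 4 u) (hζ : ContDiff ℝ 2 ζ) (hζc : HasCompactSupport ζ)
    (hK : (∫ x, (ζ x * angVortQuot u x) ^ 2) + (∫ x, (ζ x * radVelQuot (curl u) x) ^ 2) ≤ K) :
    ∫⁻ x, ‖ζ x * angVortQuot u x‖ₑ ^ 2 ≤ ENNReal.ofReal K ∧
      ∫⁻ x, ‖ζ x * radVelQuot (curl u) x‖ₑ ^ 2 ≤ ENNReal.ofReal K := by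
  have hΓ1 : ContDiff ℝ 1 (angVortQuot u) := contDiff_angVortQuot (n := 1) (by exact_mod_cast hu)
  have hω3 : ContDiff ℝ 3 (curl u) := contDiff_curl_of_succ (n := 3) (by exact_mod_cast hu)
  have hΦ1 : ContDiff ℝ 1 (radVelQuot (curl u)) := contDiff_radVelQuot (n := 1) (by exact_mod_cast hω3)
  have eΓ := lintegral_enorm_sq_eq_ofReal_integral_sq (f := fun x => ζ x * angVortQuot u x)
    (hζ.continuous.mul hΓ1.continuous) hζc.mul_right
  have eΦ := lintegral_enorm_sq_eq_ofReal_integral_sq (f := fun x => ζ x * radVelQuot (curl u) x)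
    (hζ.continuous.mul hΦ1.continuous) hζc.mul_right
  have h0Γ : 0 ≤ ∫ x, (ζ x * angVortQuot u x) ^ 2 := integral_nonneg fun x => sq_nonneg _
  have h0Φ : 0 ≤ ∫ x, (ζ x * radVelQuot (curl u) x) ^ 2 := integral_nonneg fun x => sq_nonneg _
  rw [eΓ, eΦ]
  exact ⟨ENNReal.ofReal_le_ofReal (by linarith), ENNReal.ofReal_le_ofReal (by linarith)⟩

/-- **Seregin 2022, §2 Step 4 composed with the Step-3 key estimate: `C(R) ≤ C R^{3/2}`.** Same
classical-on-a-slab setting as `cubicC_le_of_twoSeven` (slices `v t ∈ C⁴(ℝ³)` on `]t₁, 0[`,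
axisymmetric, divergence free on an open `U`; `C²` cut-off `ζ = η³` with `tsupport ζ ⊆ U ∩ 𝒞`,
`ζ = 1` on `𝒞(r₁)`; energy class; `|v| ≤ L` on `supp ∇ζ`), with the Step-3 bounds in exactly the
output form of the landed key estimate `cutoff_energy_keyEstimate_of_lemma21`
(`…Step3KeyEstimate.lean`, there with `ζ s = ζ` on the final slab where `ξ = 1`): the `sup` term
`∫(ζΓ)²(t) + ∫(ζΦ)²(t) ≤ K` for `t ∈ ]t₁, 0[` and the dissipation
`∫_{t₁}^{t₂}(∫|∇(ζΓ)|² + ∫|∇(ζΦ)|²) ≤ K'` for every `t₂ ∈ ]t₁, 0[` (Bochner integrals, coordinate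
gradients, interval time integral), together with the continuity on `[t₁, 0[` of the two
dissipation densities (exported by the Step-3 files through `continuousOn_integral_cutoff`).
[cite: Seregin2022LocalAxisym, §2 Step 3 (key estimate) and Step 4 (arXiv:2201.00153 p. 7)] -/
theorem cubicC_le_of_keyEstimate : ∀ (v : ℝ → EuclideanSpace ℝ (Fin 3) → EuclideanSpace ℝ (Fin 3)) (ζ : EuclideanSpace ℝ (Fin 3) → ℝ) (U : Set (EuclideanSpace ℝ (Fin 3))) (t₁ r₁ L K K' : ℝ) (A : ℝ≥0), t₁ < 0 → 0 < r₁ → r₁ ≤ 1 → AEStronglyMeasurable (uncurry v) (volume.restrict (SereginSverak2009.parCyl 0 r₁)) → (∀ t ∈ Ioo t₁ 0, ContDiff ℝ 4 (v t)) → (∀ t ∈ Ioo t₁ 0, IsAxisymmetric (v t)) → IsOpen U → (∀ t ∈ Ioo t₁ 0, ∀ x ∈ U, VectorCalculus.divergence (v t) x = 0) → ContDiff ℝ 2 ζ → tsupport ζ ⊆ U → tsupport ζ ⊆ SereginSverak2009.spaceCyl 0 1 → (∀ x ∈ SereginSverak2009.spaceCyl 0 r₁, ζ x = 1) → (∀ t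 ∈ Ioo t₁ 0, ∫⁻ x in SereginSverak2009.spaceCyl 0 1, ‖v t x‖ₑ ^ 2 ≤ A) → (∀ t ∈ Ioo t₁ 0, ∀ x, fderiv ℝ ζ x ≠ 0 → ‖v t x‖ ≤ L) → (∀ t ∈ Ioo t₁ 0, (∫ x, (ζ x * angVortQuot (v t) x) ^ 2) + (∫ x, (ζ x * radVelQuot (curl (v t)) x) ^ 2) ≤ K) → ContinuousOn (fun s => ∫ x, (fderiv ℝ (fun y => ζ y * angVortQuot (v s) y) x (EuclideanSpace.single 0 1) ^ 2 + fderiv ℝ (fun y => ζ y * angVortQuot (v s) y) x (EuclideanSpace.single 1 1) ^ 2 + fderiv ℝ (fun y => ζ y * angVortQuot (v s) y) x (EuclideanSpace.single 2 1) ^ 2)) (Ico t₁ 0) → ContinuousOn (fun s => ∫ x, (fderiv ℝ (fun y => ζ y * radVelQuot (curl (v s)) y) x (EuclideanSpace.single 0 1) ^ 2 + fderiv ℝ (fun y => ζ y * radVelQuot (curl (v s)) y) x (EuclideanSpace.single 1 1) ^ 2 + fderiv ℝ (fun y => ζ y * radVelQuot (curl (v s)) y) x (EuclideanSpace.single 2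 1) ^ 2)) (Ico t₁ 0) → (∀ t₂ ∈ Ioo t₁ 0, ∫ s in t₁..t₂, ((∫ x, (fderiv ℝ (fun y => ζ y * angVortQuot (v s) y) x (EuclideanSpace.single 0 1) ^ 2 + fderiv ℝ (fun y => ζ y * angVortQuot (v s) y) x (EuclideanSpace.single 1 1) ^ 2 + fderiv ℝ (fun y => ζ y * angVortQuot (v s) y) x (EuclideanSpace.single 2 1) ^ 2)) + (∫ x, (fderiv ℝ (fun y => ζ y * radVelQuot (curl (v s)) y) x (EuclideanSpace.single 0 1) ^ 2 + fderiv ℝ (fun y => ζ y * radVelQuot (curl (v s)) y) x (EuclideanSpace.single 1 1) ^ 2 + fderiv ℝ (fun y => ζ y * radVelQuot (curl (v s)) y) x (EuclideanSpace.single 2 1) ^ 2))) ≤ K') → ∃ C : ℝ≥0, ∀ R ∈ Ioc 0 (min r₁ (Real.sqrt (-t₁))), SereginSverak2009.cubicC 0 R v ≤ C * ENNReal.ofReal R ^ (3 / 2 : ℝ) := by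
  intro v ζ U t₁ r₁ L K K' A ht₁ hr₁ hr₁1 hmeas hv hax hU hdiv hζ hζU hζ1 hζr₁ hA hLv hE hDΓc hDΦc hD
  have hζc : HasCompactSupport ζ := hasCompactSupport_of_tsupport_subset_spaceCyl hζ1
  -- the `sup` terms
  have hsup := fun t (ht : t ∈ Ioo t₁ 0) => lintegral_enorm_sq_le_of_keyEstimate_sup (hv t ht) hζ hζc (hE t ht)
  -- the dissipation of `ζΦ`
  have hΦ1 : ∀ t ∈ Ioo t₁ 0, ContDiff ℝ 1 (fun y => ζ y * radVelQuot (curl (v t)) y) := fun t ht =>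
    (hζ.of_le (by norm_num)).mul (contDiff_radVelQuot (n := 1)
      (by exact_mod_cast (contDiff_curl_of_succ (n := 3) (by exact_mod_cast hv t ht))))
  have hD0Γ : ∀ t ∈ Ico t₁ 0, 0 ≤ ∫ x, (fderiv ℝ (fun y => ζ y * angVortQuot (v t) y) x (EuclideanSpace.single 0 1) ^ 2 + fderiv ℝ (fun y => ζ y * angVortQuot (v t) y) x (EuclideanSpace.single 1 1) ^ 2 + fderiv ℝ (fun y => ζ y * angVortQuot (v t) y) x (EuclideanSpace.single 2 1) ^ 2) :=
    fun t _ => integral_nonneg fun x => by positivity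
  have hD0Φ : ∀ t ∈ Ico t₁ 0, 0 ≤ ∫ x, (fderiv ℝ (fun y => ζ y * radVelQuot (curl (v t)) y) x (EuclideanSpace.single 0 1) ^ 2 + fderiv ℝ (fun y => ζ y * radVelQuot (curl (v t)) y) x (EuclideanSpace.single 1 1) ^ 2 + fderiv ℝ (fun y => ζ y * radVelQuot (curl (v t)) y) x (EuclideanSpace.single 2 1) ^ 2) :=
    fun t _ => integral_nonneg fun x => by positivity
  have hDΦ := setLIntegral_Ioo_ofReal_le_of_forall_intervalIntegral_le ht₁ hDΦc hDΓc hD0Φ hD0Γ hD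
  have hΦ' : ∫⁻ t in Ioo t₁ 0, ∫⁻ x, ‖fderiv ℝ (fun y => ζ y * radVelQuot (curl (v t)) y) x‖ₑ ^ 2 ≤
      ENNReal.ofReal K' := by
    refine le_trans (le_of_eq ?_) hDΦ
    refine setLIntegral_congr_fun measurableSet_Ioo fun t ht => ?_
    exact lintegral_enorm_fderiv_sq_eq_ofReal_integral (hΦ1 t ht) hζc.mul_right
  exact cubicC_le_of_twoSeven v ζ U t₁ r₁ L A K.toNNReal K.toNNReal K'.toNNReal ht₁ hr₁ hr₁1 hmeas hv
    hax hU hdiv hζ hζU hζ1 hζr₁ hA hLv (fun t ht => (hsup t ht).1) (fun t ht => (hsup t ht).2) hΦ'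

/-- **Seregin 2022, §2 Step 4 composed with the Step-3 key estimate: `C(R) → 0` as `R → 0⁺`**
(the hypothesis of the landed endgame `isRegularAtOrigin_of_tendsto_cubicC`), under the hypotheses of
`cubicC_le_of_keyEstimate`. [cite: Seregin2022LocalAxisym, §2 Step 3 (key estimate) and Step 4 (arXiv:2201.00153 p. 7)] -/
theorem tendsto_cubicC_of_keyEstimate : ∀ (v : ℝ → EuclideanSpace ℝ (Fin 3) → EuclideanSpace ℝ (Fin 3)) (ζ : EuclideanSpace ℝ (Fin 3) → ℝ) (U : Set (EuclideanSpace ℝ (Fin 3))) (t₁ r₁ L K K' : ℝ) (A : ℝ≥0), t₁ < 0 → 0 < r₁ → r₁ ≤ 1 → AEStronglyMeasurable (uncurry v) (volume.restrict (SereginSverak2009.parCyl 0 r₁)) → (∀ t ∈ Ioo t₁ 0, ContDiff ℝ 4 (v t)) → (∀ t ∈ Ioo t₁ 0, IsAxisymmetric (v t)) → IsOpen U → (∀ t ∈ Ioo t₁ 0, ∀ x ∈ U, VectorCalculus.divergence (v t) x = 0) → ContDiff ℝ 2 ζ → tsupport ζ ⊆ U → tsupport ζ ⊆ SereginSverak2009.spaceCyl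 0 1 → (∀ x ∈ SereginSverak2009.spaceCyl 0 r₁, ζ x = 1) → (∀ t ∈ Ioo t₁ 0, ∫⁻ x in SereginSverak2009.spaceCyl 0 1, ‖v t x‖ₑ ^ 2 ≤ A) → (∀ t ∈ Ioo t₁ 0, ∀ x, fderiv ℝ ζ x ≠ 0 → ‖v t x‖ ≤ L) → (∀ t ∈ Ioo t₁ 0, (∫ x, (ζ x * angVortQuot (v t) x) ^ 2) + (∫ x, (ζ x * radVelQuot (curl (v t)) x) ^ 2) ≤ K) → ContinuousOn (fun s => ∫ x, (fderiv ℝ (fun y => ζ y * angVortQuot (v s) y) x (EuclideanSpace.single 0 1) ^ 2 + fderiv ℝ (fun y => ζ y * angVortQuot (v s) y) x (EuclideanSpace.single 1 1) ^ 2 + fderiv ℝ (fun y => ζ y * angVortQuot (v s) y) x (EuclideanSpace.single 2 1) ^ 2)) (Ico t₁ 0) → ContinuousOn (fun s => ∫ x, (fderiv ℝ (fun y => ζ y * radVelQuot (curl (v s)) y) x (EuclideanSpace.single 0 1) ^ 2 + fderiv ℝ (fun y => ζ y * radVelQuot (curl (v s)) y) x (EuclideanSpace.single 1 1) ^ 2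 + fderiv ℝ (fun y => ζ y * radVelQuot (curl (v s)) y) x (EuclideanSpace.single 2 1) ^ 2)) (Ico t₁ 0) → (∀ t₂ ∈ Ioo t₁ 0, ∫ s in t₁..t₂, ((∫ x, (fderiv ℝ (fun y => ζ y * angVortQuot (v s) y) x (EuclideanSpace.single 0 1) ^ 2 + fderiv ℝ (fun y => ζ y * angVortQuot (v s) y) x (EuclideanSpace.single 1 1) ^ 2 + fderiv ℝ (fun y => ζ y * angVortQuot (v s) y) x (EuclideanSpace.single 2 1) ^ 2)) + (∫ x, (fderiv ℝ (fun y => ζ y * radVelQuot (curl (v s)) y) x (EuclideanSpace.single 0 1) ^ 2 + fderiv ℝ (fun y => ζ y * radVelQuot (curl (v s)) y) x (EuclideanSpace.single 1 1) ^ 2 + fderiv ℝ (fun y => ζ y * radVelQuot (curl (v s)) y) x (EuclideanSpace.single 2 1) ^ 2))) ≤ K') → Tendsto (fun R => SereginSverak2009.cubicC 0 R v) (𝓝[>] 0) (𝓝 0) := by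
  intro v ζ U t₁ r₁ L K K' A ht₁ hr₁ hr₁1 hmeas hv hax hU hdiv hζ hζU hζ1 hζr₁ hA hLv hE hDΓc hDΦc hD
  obtain ⟨C, hC⟩ := cubicC_le_of_keyEstimate v ζ U t₁ r₁ L K K' A ht₁ hr₁ hr₁1 hmeas hv hax hU hdiv hζ hζU
    hζ1 hζr₁ hA hLv hE hDΓc hDΦc hD
  exact tendsto_cubicC_of_le_rpow (lt_min hr₁ (Real.sqrt_pos.2 (by linarith))) (by norm_num) hC

end KeyEstimateForm

end Literature.Analysis.SereginLogSwirlOrigin.EulerScaling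

end Part9

/-!
## Part 10 — port of `Summits/NavierStokesRegularity/NavierStokesRegularity/Theorems/AxisymmetricExtremalityAxisymmetricKatoGlobalStubSereginLogSwirlOriginStep1CutoffChain.lean` (6 declarations kept)

# Seregin 2022, §2: the clean configuration at `(0, 1)` implies `C(R) → 0`, for the class of
# the landed key estimate (classical on the open slab) — Steps 1 + 3 + 4 chained —
# crux stmt-NavierStokesRegularity-15453 (`AxisymmetricExtremality.AxisymmetricKatoGlobal`), line registered, support for stub `stub_sereginLogSwirlOrigin`

Support file (`--supports stmt-NavierStokesRegularity-15453`; theorems only, everything proved)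
toward the registered stub `stub_sereginLogSwirlOrigin` = the named fact
`Literature.Analysis.FluidPDE.seregin2022_logSwirl_regularAtOrigin` (G. Seregin, J. Math. Fluid
Mech. 24 (2022), Paper 27 = arXiv:2201.00153, §2).  This file chains the Step-1 files of this
session (`exists_step1_cutoff`, `exists_uniform_derivBounds`, `exists_cutoff_derivBounds`,
`step3_pointwiseConstants`, `cut_bound`) with the landed Step 3 (`exists_radius_logSmall`,
`cutoff_energy_keyEstimate_unconditional`) and Step 4 (`tendsto_cubicC_of_keyEstimate`):

* `tendsto_cubicC_of_classical_cleanConfig` (registered sub-goal) — for `(V, q)` a CLASSICAL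
  axisymmetric Navier–Stokes solution on the open slab `]-1, 0[ × ℝ³` (the class of the landed
  key estimate; the Seregin–Zajaczkowski local class of the core of `…FinalReduction` awaits the
  local port of Step 3), with the swirl bound (2.2) `|σ| ≤ C₁/ln³(e/ϱ)` on `{0 < ϱ < r_σ}`,
  the energy class `∫_𝒞 |V(t)|² ≤ A`, and the clean configuration at `(0, 1)`: heights
  `h₋ < 0 < h₊`, width `δ` (`-1 ≤ h₋ - δ`, `h₋ + δ < 0 < h₊ - δ`, `h₊ + δ ≤ 1`) such that at every
  top-slice point `a ∈ 𝒞` off the axis or within `δ` of a height all `D_xⁿV` are bounded on some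
  backward cylinder `Q((0, a), ρ)` — THEN `C(R) = R⁻²∫_{Q(R)}|V|³ → 0` as `R → 0⁺`
  (`SereginSverak2009.cubicC`), the input of the landed endgame `isRegularAtOrigin_of_tendsto_cubicC`.

All numeric hypotheses of Steps 3–4 are discharged inside: the cut-off `ζ = φ(ϱ)ψ(x₃)`
(radii `1/8 < 1/4`), the smallness radius `r₁` (`exists_radius_logSmall 42 C₁`, giving
`8C₁/L + 13C₁/L² + 1 < 2` with `ε = 1/4`, `L = ln(e/r₁) ≥ 1`), the compact regular region
`K = supp-box of ∇ζ ∪ (supp-box of ζ ∩ {ϱ ≥ r₁})`, uniform bounds `D₀, D₁, D₂` on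
`K × ]-ρ², 0[`, the final slab `]t₁, 0[`, `t₁ = -(min ρ 1)²/2`, and the constants
`M, Bcut, P₀, …, P₄, L`.

## References

* G. Seregin, J. Math. Fluid Mech. 24 (2022), Paper No. 27 = arXiv:2201.00153, §2 Steps 1, 3, 4
  (arXiv pp. 5–7). [`Seregin2022LocalAxisym`]

Not carried from this source module (not needed by the declarations re-homed here; their consumers are Summits-side): `tendsto_cubicC_of_classical_cleanConfig`, `isRegularAtOrigin_of_classical_cleanConfig`.
-/

section Part10

open _root_.Set _root_.Filter _root_.Topology _root_.Function _root_.Metric _root_.MeasureTheory intervalIntegral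
open scoped _root_.ENNReal _root_.NNReal _root_.ContDiff
open Literature.Analysis.FluidPDE

namespace Literature.Analysis.SereginLogSwirlOrigin.EulerScaling

/-! ### Small lemmas -/

section Small

/-- The smallness `8C₁/L + (13C₁/L² + 4·(1/4)) < 2` from `42C₁/L + 42C₁²/L⁴ < 2`, `L ≥ 1`,
`C₁ ≥ 0`. [folklore]
[cite: Seregin2022LocalAxisym, §2 proof of Thm. 1.2 (arXiv:2201.00153 pp. 4–7) (source of the ARGUMENT this module implements; this declaration is the cell’s own lemma or plumbing, NOT a printed statement)] -/
theorem smallness_of_logSmall {C₁ L : ℝ} (hC₁ : 0 ≤ C₁) (hL : 1 ≤ L)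
    (h : 42 * C₁ / L + 42 * C₁ ^ 2 / L ^ 4 < 2) :
    8 * C₁ / L + (13 * C₁ / L ^ 2 + 4 * (1 / 4 : ℝ)) < 2 * 1 := by
  have hL0 : 0 < L := by linarith
  have h1 : 0 ≤ 42 * C₁ ^ 2 / L ^ 4 := by positivity
  have h2 : 42 * C₁ / L < 2 := by linarith
  have h3 : C₁ / L < 1 / 21 := by
    rw [div_lt_div_iff₀ hL0 (by norm_num : (0 : ℝ) < 21)]
    have := (div_lt_iff₀ hL0).1 h2
    linarith
  have h4 : 13 * C₁ / L ^ 2 ≤ 13 * C₁ / L :=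
    div_le_div_of_nonneg_left (by positivity) hL0 (show L ≤ L ^ 2 by nlinarith)
  have h5 : 8 * C₁ / L + 13 * C₁ / L = 21 * (C₁ / L) := by ring
  nlinarith

/-- `ln(e/r) ≥ 1` for `0 < r ≤ 1`. [folklore]
[cite: Seregin2022LocalAxisym, §2 proof of Thm. 1.2 (arXiv:2201.00153 pp. 4–7) (source of the ARGUMENT this module implements; this declaration is the cell’s own lemma or plumbing, NOT a printed statement)] -/
theorem one_le_log_exp_div {r : ℝ} (hr : 0 < r) (hr1 : r ≤ 1) : 1 ≤ Real.log (Real.exp 1 / r) := by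
  rw [Real.log_div (Real.exp_pos 1).ne' hr.ne', Real.log_exp]
  have := Real.log_nonpos hr.le hr1
  linarith

/-- Monotonicity of the key-estimate constant in the final time: `E ≤ E₁ + S(t − t') ≤ E₁ + S(−t')`
for `S ≥ 0`, `t ≤ 0`. [folklore]
[cite: Seregin2022LocalAxisym, §2 proof of Thm. 1.2 (arXiv:2201.00153 pp. 4–7) (source of the ARGUMENT this module implements; this declaration is the cell’s own lemma or plumbing, NOT a printed statement)] -/
theorem le_uniform_of_le {E E₁ S t t' : ℝ} (h : E ≤ E₁ + S * (t - t')) (hS : 0 ≤ S) (ht : t ≤ 0) :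
    E ≤ E₁ + S * (-t') := by
  nlinarith [mul_le_mul_of_nonneg_left (show t - t' ≤ -t' by linarith) hS]

/-- The same through a positive denominator. [folklore]
[cite: Seregin2022LocalAxisym, §2 proof of Thm. 1.2 (arXiv:2201.00153 pp. 4–7) (source of the ARGUMENT this module implements; this declaration is the cell’s own lemma or plumbing, NOT a printed statement)] -/
theorem le_uniform_div_of_le {X E₁ S t t' d : ℝ} (h : X ≤ (E₁ + S * (t - t')) / d) (hS : 0 ≤ S)
    (ht : t ≤ 0) (hd : 0 < d) : X ≤ (E₁ + S * (-t')) / d := by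
  refine h.trans (div_le_div_of_nonneg_right ?_ hd.le)
  nlinarith [mul_le_mul_of_nonneg_left (show t - t' ≤ -t' by linarith) hS]

end Small

/-! ### The chain -/

/-- **`C(R)` does not see null sets**: if `v = V` a.e. on `Q = Q(0, 1)` then
`cubicC 0 R v = cubicC 0 R V` for `0 ≤ R ≤ 1`. [folklore]
[cite: Seregin2022LocalAxisym, §2 proof of Thm. 1.2 (arXiv:2201.00153 pp. 4–7) (source of the ARGUMENT this module implements; this declaration is the cell’s own lemma or plumbing, NOT a printed statement)] -/
theorem cubicC_congr_ae {v V : ℝ → EuclideanSpace ℝ (Fin 3) → EuclideanSpace ℝ (Fin 3)}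
    (hae : uncurry v =ᵐ[volume.restrict (SereginSverak2009.parCyl (0 : ℝ × EuclideanSpace ℝ (Fin 3)) 1)] uncurry V)
    {R : ℝ} (hR : 0 ≤ R) (hR1 : R ≤ 1) :
    SereginSverak2009.cubicC 0 R v = SereginSverak2009.cubicC 0 R V := by
  unfold SereginSverak2009.cubicC
  congr 1
  refine lintegral_congr_ae ?_
  have h := ae_restrict_of_ae_restrict_of_subset (SereginSverak2009.parCyl_mono 0 hR hR1) hae
  filter_upwards [h] with z hz
  have e : v z.1 z.2 = V z.1 z.2 := hz
  rw [e]

/-- **`C(R) → 0` does not see null sets**: `cubicC 0 R v → 0` iff `cubicC 0 R V → 0` as `R → 0⁺`,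
when `v = V` a.e. on `Q`. [folklore]
[cite: Seregin2022LocalAxisym, §2 proof of Thm. 1.2 (arXiv:2201.00153 pp. 4–7) (source of the ARGUMENT this module implements; this declaration is the cell’s own lemma or plumbing, NOT a printed statement)] -/
theorem tendsto_cubicC_congr_ae {v V : ℝ → EuclideanSpace ℝ (Fin 3) → EuclideanSpace ℝ (Fin 3)}
    (hae : uncurry v =ᵐ[volume.restrict (SereginSverak2009.parCyl (0 : ℝ × EuclideanSpace ℝ (Fin 3)) 1)] uncurry V)
    (h : Tendsto (fun R => SereginSverak2009.cubicC 0 R V) (𝓝[>] 0) (𝓝 0)) :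
    Tendsto (fun R => SereginSverak2009.cubicC 0 R v) (𝓝[>] 0) (𝓝 0) := by
  refine h.congr' ?_
  filter_upwards [Ioc_mem_nhdsGT (zero_lt_one' ℝ)] with R hR
  exact (cubicC_congr_ae hae hR.1.le hR.2).symm

end Literature.Analysis.SereginLogSwirlOrigin.EulerScaling

end Part10

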